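import Literature.MathematicalPhysics.QuantumFieldTheory.Balaban1983to89.B6BoxChartsCubeUnions

/-!
# `Balaban1983to89.B6BoxChartsNested` — [Balaban1984PropagatorsII] (2.1)–(2.4) p. 224, Sect. A p. 231 (2.46) with
(2.66) p. 234: the (k+1)-LEVEL model over a NESTED SEQUENCE Ω₁ ⊇ Ω₂ ⊇ … ⊇ Ω_k of cube unions of ℤ^d, block side M₀L^j at
level j — a third LEAF of `…Balaban1983to89.B6BoxCharts` (cell pub-balaban, lineage pv08; v1 p192235, v1.1 p192391 =
v1 + §14, v1.2 p192935 = v1.1 + §15, v1.3 p193107 = v1.2 + §16, v1.4 p193227 = v1.3 + §17, v1.5 = v1.4 + §18, each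
APPEND-ONLY with every earlier declaration byte-identical; the parent v1.4 and the leaves
`…B6BoxChartsCorners` v1 and `…B6BoxChartsCubeUnions` v1 are IMPORTED, NOT modified; the parent, 155 624 bytes, is not
grown — cap 200 000 bytes per file).  The second leaf decided ONE interface between TWO scales over an arbitrary cube
union; this leaf stacks k + 1 scales — level 0 = the η-lattice ℤ^d, level j (1 ≤ j ≤ k) = the L^jη-lattice restricted
to Ω_j, each level glued to the next through the fine collar of the second leaf one level up — and takes up the entry
left LOCATED by the parent and both leaves, «THREE levels j − 1, j, j + 1 at once ((2.2)-separated), k > 1», in two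
currencies: (A) distances in η-UNITS, every bond counted once (the comparison d(y, y″) ≤ ‖y − y″‖₁ + const of the
leaves), and (B) the LITERAL units of (2.66), (L^iη)^{−1}|y − y″| with i the level of y.
THE ANSWER, STATED LOUDLY (the lineage's menu asked whether the separation clause of (2.2) is load-bearing at three
levels).  (A) NO — in η-units the comparison holds for EVERY k, every nested sequence of cube unions and every pair of
model points, and the separation clause is used NOWHERE: globally with the additive constant 4d(L^k − 1) (§12h), and
inside the printed window of a point of level i with the constant 4d(L^{i+1} − 1), INDEPENDENT OF k (§12i–j: points of
levels ≥ i + 2 inside the window are re-levelled to i + 1 by nesting alone).  (B) YES — in the literal units a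
comparison with level-free constants FAILS without the separation clause (§12m: over the tower of equal half-spaces
Ω₁ = … = Ω_k = {0 ≤ x_μ} — nested, cube unions, separation violated — the point 0 of level i and the point −D·e_μ of
level 0, inside the printed window for D ≤ 2dM₀L^i, are at distance EXACTLY D = ‖y − y″‖₁ = L^i·(L^iη)^{−1}|y − y″|),
and HOLDS with it (§12l: under `L1Sep` with R ≥ d(2dL + 1) only the levels i − 1, i, i + 1 meet the printed window;
§13: under R ≥ 2dL(d + L) every path used stays inside Ω_{i−1}, only bonds of levels ≥ i − 1 are paid, and
dist y y″ ≤ L·(L^iη)^{−1}‖y − y″‖₁ + 4dL(L − 1) ≤ 2d²M₀L + 4dL(L − 1) — constants depending on d and L (and M₀ for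
the last), NOT on the level i, NOT on k; §14: the literal weights themselves sum to ≤ c₀(δ₀, 1/L)^d over the window,
so the literal form of the last «≤» of (2.66) holds with the constant e^{½δ₀(2d²M₀L + 4dL(L−1))}·c₀(δ₀, 1/L)^d —
d, L, M₀, δ₀ only).  (C, v1.2) In the same model the separation clause also yields what it is FOR in print: (sep) ∕
(2.57), the walk form of (2.2) and the level-distance bound behind (2.60), N·max{|level x − level x′| − 1, 0} ≤ d(x, x′)
for N + d·M₀ ≤ R·M₀ (§15, the siblings' `levelGap_of_metric` ∕ `levelGap_dist_real` BY NAME; the loss d·M₀ is the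
collar of the zone convention, located in §15 by the failure of the siblings' `ZonesOf` on T) — and WITHOUT the clause
the walk form FAILS (§16, v1.3: over the tower of equal half-spaces −e_μ, of level 0, and 0, of level k, are one bond
apart); with the printed threshold of (2.2) (= `L1Sep` with R·L in the dictionary M = M₀L) the bound holds for
N ≤ RM − d·M₀ (§16).  (D, v1.4) The loss d·M₀ is the model's LEVEL CONVENTION's, not the geometry's: measuring levels
as print does (Λ_j = Ω_j ∖ Ω_{j+1}: zone x = the greatest j ≤ k with x ∈ Ω_j, `pzLevel`) the siblings' `ZonesOf`
holds, `L1Sep` with the integer R IS (sep) with the FULL constant R·M₀ on all of ℤ^d (no cube unions), the walk form of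
(2.2) holds on the whole bond graph for every N ≤ R·M₀, and the bound behind (2.60) holds on T with the PRINTED constant:
N·max{|zone x − zone x′| − 1, 0} ≤ d(x, x′) for every N ≤ R·M under the printed threshold (§17; the two conventions
differ by at most one level when R ≥ d; without the clause the walk form fails under either convention); and the
dictionary is EXACT: under nesting `L1Sep k L M₀ R Ω` ⟺ the siblings' `ZoneSep` ⟺ their set-level `SetSep`, threshold
R·M₀, for print's levels ∕ domains (§18, v1.5).

CITATION HEADER (lean-in-tree rule 2026-08-18).  Source: T. Bałaban, *Propagators and renormalization transformations for
lattice gauge theories. II*, Commun. Math. Phys. **96**, 223–250 (1984), doi:10.1007/bf01240221 (cell paper B6; held: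
`paper:balaban1984-cmp96-propagators-rt-ii`; journal page = PDF page + 222).  NO NEW QUOTATION: the printed inputs this
leaf bears on are quoted verbatim, with page references and render file names, upstream — p. 223 [PDF 1] (the ℓ¹
distance |x − y| = Σ_μ|x_μ − y_μ|; header of the parent), (2.1) p. 224 [2] (*"Ω₁ ⊃ Ω₂ ⊃ … ⊃ Ω_k"*, the nested
sequence of domains; headers / docstrings of the siblings `…B6LevelGapMetric` and `…B6LevelTower`), (2.2)–(2.4) p. 224
[2] (Ω_j a sum of big blocks of the L^jη-lattice — the first clause of (2.2), with (2.3), (2.4), in the header of the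
parent; the separation clause *"(L^jη)^{−1} dist(Ω_j^c, Ω_{j+1}) > RM"* in the headers of `…B6LevelGapMetric` (whose
`Cond22` formalises it for that file's own model) and `…B6LevelTower`), p. 229 [7] (the big blocks of the size ML^jη;
docstring of the parent's §9), Sect. A p. 231 [9] ((2.46), the sentence on Ω_j as a sum of cubes, and |Γ| = nη with n
the number of bonds of Γ; header of the parent), (2.57) p. 233 [11] and (2.60) p. 234 [12] (quoted in the header of the
sibling `…B6Geometry`; §15, v1.2), (2.66) p. 234 [12] with its window (L^jη)^{−1}|y − y″| ≤ 2dM (quoted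
in full in the header of the parent) and Prop. 2.6 p. 247 [25] (parent §9, first leaf).  Used BY NAME, nothing upstream
modified: the lattice ℤ^d = `Site d`, `zdGraph d`, `supDist`, `latL1Dist`, `cbox` and their lemmas
(`Literature.Probability.LatticeModels.…`); the parent's box charts and block partition (`CboxClosed`, `cboxClosed_Icc`,
`left_mem_cbox`, `right_mem_cbox`, `supDist_le_of_mem_cbox`, `dist_le_one_of_eq_or_adj`, `blockIdx`, `mem_blockBox_iff`,
`mem_blockBox_blockIdx`, `latL1Dist_le_mul_supDist`), its two-scale vocabulary (`scalePt`, `latL1Dist_scalePt`,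
`latL1Dist_add_single`, `depth`, `depth_le_of_zd_adj`, `le_add_dist_of_adj_le`, `B6.c0`); the first leaf's window-sum
lemma `sum266_le_of_cmp`; the second leaf's cube unions and two-scale model (`IsCubeUnion`, `cuFine`, `cuCoarse`,
`cuGraph`, `cuPts`, `isCubeUnion_halfspace`); (v1.2, §15) the siblings' walk form of (2.2) and its metric derivation
(`B6Geometry.LevelGap`, `levelGap_dist_real`; `B6LevelGapMetric.BondScale`, `ZoneSep`, `levelGap_of_metric`, `ZonesOf`),
the sibling `B6Lemma21TwoScale.sum_exp_le_c0_pow` (§14) and Mathlib's ℓ¹ space `PiLp 1` (`PiLp.dist_eq_of_L1`).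

THE DICTIONARY (the parent's and the leaves', continued to k + 1 levels).  Scale the finest lattice to ℤ^d (η = 1).
M₀ ↔ Bałaban's M counted in sites of the L^jη-lattice per big-block side, so that the big blocks of Ω_j (p. 229: of the
size ML^jη) have side M₀L^j in η-units: Ω_j ↦ `Ω j ⊆ ℤ^d` with `IsCubeUnion (M₀ * L ^ j) (Ω j)` for 1 ≤ j ≤ k
(`CubeUnions k L M₀ Ω`; the second leaf's model is the case k = 1 with its M = M₀·L: `nlGraph_one`, `nlPts_one`);
(2.1) ↦ `Nested k Ω` (Ω (j+1) ⊆ Ω j for 1 ≤ j < k); the separation clause of (2.2) ↦ `L1Sep k L M₀ R Ω` (‖x − x′‖₁ >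
R·M₀L^j for η-points x ∉ Ω_j, x′ ∈ Ω_{j+1}, 1 ≤ j < k) — a HYPOTHESIS of the theorems of §12l and §13d–e, never
asserted and used nowhere else.  The POINTS OF LEVEL j (0 ≤ j ≤ k; `nlPtsAt k L M₀ Ω j`): the L^jη-points x = L^j·a
lying in Ω_j (no condition at level 0: Ω₀ = everything, (2.3) Λ₀ = Ω₁^c being where only they exist) and, when j < k,
in the ZONE of level j, `nlZone … j` = `cuFine (M₀L^{j+1}) (Ω (j+1))` = within sup-distance M₀L^{j+1} — the side of ONE
big block of the next level — of the complement of Ω_{j+1}: the second leaf's fine collar, one level up each time (the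
parent's §8 convention: a lattice is kept in a collar one block wide inside the next coarser domain, deeper inside it is
represented by the coarser lattices; a READING, as in the parent, not a quotation).  The BONDS OF LEVEL j:
{L^j·a, L^j·a′}, a ∼ a′ in ℤ^d, both ends points of level j (`nlRel`; `nlGraph` = `SimpleGraph.fromRel`); consecutive
levels are glued through the shared points L^{j+1}·b of the collar (shared-point linkage, parent §3).  T ↦
`nlPts d k L M₀ Ω` (the points of all levels).  `dist` = the graph distance of `nlGraph` = the number of bonds of a
shortest admissible contour, EVERY BOND COUNTED ONCE whatever its level (p. 231, |Γ| = nη with n the number of bonds;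
§§8e, 9 of the parent and both leaves) — currency (A), in which ‖y − y″‖₁ is the η-unit ℓ¹ distance `latL1Dist`.
Currency (B): for y of level i the literal (L^iη)^{−1}|y − y″| of (2.66) is ‖y − y″‖₁/L^i; §13 states its bounds
multiplied through by L^{i−1} (`L ^ m * dist y y″ ≤ latL1Dist y y″ + …` with i = m + 1), to stay in ℕ.

PROVED [folklore model computations; every `theorem` below, no `sorry`, no new axiom; L ≥ 1 and M₀ ≥ 1 throughout].
1. §12a–c: scaling algebra (`scalePt_scalePt`, `scalePt_mem_cbox`, `cboxClosed_cbox`, `natAbs_sub_le_of_mem_cbox`, …),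
   COST CHARTS (`reachable_dist_of_costChart`: on a `CboxClosed` set of ℤ^d whose lattice steps are each realised at
   graph distance ≤ c, d(φ u, φ y) ≤ c·‖u − y‖₁), the model, and its k = 1 identity with the second leaf (`nlRel_one`,
   `nlGraph_one`, `nlPts_one`).
2. §12d–e, THE SKELETON (no hypothesis on Ω at all): `nl_step` — a level-j lattice step with both ends in the zone of
   level j costs ≤ L^j bonds (one bond if both ends lie in Ω_j; otherwise the L + 1 points of level j − 1 between them
   lie in the zone of level j − 1, within sup-distance L^j ≤ M₀L^j of the end outside Ω_j, and one recurses);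
   `nl_lattice`: d(L^n·z, L^n·z′) ≤ L^n·‖z − z′‖₁ through any coordinate box whose L^n-points lie in the zone of level n;
   `nl_topLattice` (n = k: no condition).
3. §12f–g, THE CLIMB (Ω_{j+1} a cube union): `mem_cuFine_of_hull` and `nl_climb` — a point L^j·a of the zone of level j
   reaches an L^{j+1}-point of the same zone at cost ≤ d(L − 1)·L^j, each coordinate moving by ≤ (L − 1)L^j, through
   the hull of a and the big block Q ∌ w, Q ⊆ Ω_{j+1}^c, of its witness w (the second leaf's anchor, one level up);
   `Nested.subset`, `nlZone_mono` (nesting ⇒ the zones increase with the level), `nl_climbTo` (level j → j + n at cost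
   ≤ d(L^{j+n} − L^j)).
4. §12h, INPUT (α) AND THE GLOBAL COMPARISON FOR EVERY k: **`nl_reachable_dist`** — nesting + cube unions ⇒ any two
   points of T are joined and `dist u v ≤ ‖u − v‖₁ + 4d(L^k − 1)` (climb both to the top lattice, join there).
5. §12i–j, THE WINDOW, A CONSTANT INDEPENDENT OF k: `nl_relevel` (a point of level ≥ i + 2 within W of a point of level
   i is a point of level i + 1 — nesting), `nl_cmp_finer` / `nl_cmp_same` / `nl_cmp_coarser`, **`nl_window_dist`** — y of
   level i, y″ ∈ T, ‖y − y″‖_∞ ≤ W and two growth conditions ⇒ `dist y y″ ≤ ‖y − y″‖₁ + 4d(L^{i+1} − 1)`;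
   `grow_printed₁`, `grow_printed₂` and **`nl_window_dist_printed`** — for L ≥ 2d + 2 the growth conditions hold in the
   printed window ‖y − y″‖_∞ ≤ 2dM₀L^i; `nl_sum266_le` (global: e^{½δ₀·4d(L^k−1)}·c₀^d) and **`nl_sum266_window_le`**
   (window: e^{½δ₀·4d(L^{i+1}−1)}·c₀^d — uniform in k, in M₀ and in the domains): the last «≤» of (2.66) with the η-unit
   weights e^{−δ₀‖y − y″‖₁} of the leaves.
6. §12k: every point of the top lattice is a point of T (`scalePt_top_mem_nlPts`).
7. §12l, THREE LEVELS (nesting + `L1Sep`): `nl_window_levels` and **`nl_window_levels_printed`** — with R ≥ d(2dL + 1), a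
   model point in the printed window of a point of level i has level i − 1, i or i + 1.
8. §12m, THE WITNESS: `hsTower μ` (Ω_m = {0 ≤ x_μ} for every m: `hsTower_nested`, `hsTower_cubeUnions`), the
   1-Lipschitz depth (`depth_le_of_nlGraph_hsTower_adj`) and **`hsTower_literal_witness`** — 0 is a point of every
   level i ≤ k, −D·e_μ (D ≥ 1) is a point of level 0, and dist(0, −D·e_μ) = D = ‖0 − (−D·e_μ)‖₁ exactly.
9. §13a–c, ABOVE A BASE LEVEL m: `nl_stepFrom`, `nl_latticeFrom`, `nl_climbFrom` — the constructions of items 2–3 with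
   their costs divided by L^m (L^n bonds per level-(m+n) step, d(L − 1)·L^n per climb from level m + n), provided the
   η-segments used, resp. the sup-ball of radius 2M₀L^{j+1} about the climbing point, lie inside Ω_m — the descents then
   stop at level m, where every sub-step has both ends in Ω_m and is ONE bond.
10. §13d–e, THE LITERAL COMPARISON UNDER THE SEPARATION CLAUSE: `nl_cmpFrom_finer` / `nl_cmpFrom_same` /
   `nl_cmpFrom_coarser` and **`nl_window_dist_literal`** — L ≥ 2d + 2, nesting, cube unions, `L1Sep` with
   R ≥ 2dL(d + L), y of level i = m + 1 ≥ 1, y″ ∈ T in the printed window ⇒ y, y″ are joined and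
   `L^{i−1}·dist y y″ ≤ ‖y − y″‖₁ + 4d(L − 1)·L^i`; **`nl_window_dist_literal_const`**: dist y y″ ≤ 2d²M₀L + 4dL(L − 1);
   **`nl_sum266_literal_le`**: Σ_{y″∈S} w(y″)·e^{−½δ₀d(y″,y′)} ≤ #S·e^{½δ₀(2d²M₀L + 4dL(L−1))}·e^{−½δ₀d(y,y′)} for δ₀ ≥ 0
   and ANY weights w ≤ 1 — in particular the literal e^{−δ₀(L^iη)^{−1}|y − y″|} — over a finite S ⊆ T inside the window.
11. §14 (v1.1), THE FACTOR #S REMOVED: `exists_eq_scalePt_of_le` (a point of level ≥ m is an L^m-lattice point),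
   **`nl_window_literal_weights_le`** — L ≥ 1, nesting, `L1Sep` with R ≥ d(2dL + 1), δ₀ > 0, y of level m + 1 ⇒
   Σ_{y″∈S} e^{−δ₀‖y − y″‖₁/L^{m+1}} ≤ c₀(δ₀, 1/L)^d for every finite S ⊆ T inside the window (the window points have
   level ≥ m by §12l, so y″ ↦ (y″ − y)/L^m is injective into ℤ^d and the sibling's
   `B6Lemma21TwoScale.sum_exp_le_c0_pow` applies BY NAME at rate δ₀/L), and **`nl_sum266_literal_c0_le`** — under the
   hypotheses of item 10 with δ₀ > 0: Σ_{y″∈S} e^{−δ₀(L^iη)^{−1}‖y − y″‖₁}·e^{−½δ₀d(y″,y′)} ≤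
   e^{½δ₀(2d²M₀L + 4dL(L−1))}·c₀(δ₀, 1/L)^d·e^{−½δ₀d(y,y′)} — a constant depending on d, L, M₀, δ₀ ONLY.
12. §15 (v1.2), (len), (sep), THE WALK FORM OF (2.2) AND THE BOUND BEHIND (2.60), DERIVED from `Nested` + `L1Sep`: with
   the LEVEL `nlLevel` of a point (the greatest j with x a point of level j), ℓ¹ positions `l1Pos` (`dist_l1Pos`:
   the distance of `PiLp 1` IS ‖x − y‖₁) and ℓ_j = L^j, the sub-graph of `nlGraph` induced on T satisfies the siblings'
   `BondScale` (`nl_bondScale`, L ≥ 1) and, under nesting and `L1Sep` with the integer R, `ZoneSep` with the constant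
   (R − d)·M₀ (**`nl_zoneSep`** — (2.57) in the model, the collar's ℓ¹-width d·M₀L^i paid out of R·M₀L^i); hence
   **`nl_levelGap`**: `LevelGap … N` for N + d·M₀ ≤ R·M₀ (`levelGap_of_metric` BY NAME); the induced sub-graph is
   connected with the distances of `nlGraph` (`nl_liftWalk`, `nl_induce_connected`, `nl_induce_dist_eq`, from item 3);
   **`nl_levelGap_dist`** ∕ `nl_exp_le_260`: N·max{|level x − level x′| − 1, 0} ≤ d(x, x′) for all x, x′ ∈ T, and its
   exponential form (`levelGap_dist_real` BY NAME) — the shape of (2.60) with N in place of RM; NON-VACUITY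
   `sepTower_witness` ∕ `sepTower_levelGap_dist` (Ω_m = {m·R·M₀L^k ≤ x_μ}: nested, cube unions —
   `isCubeUnion_halfspace_mul` —, `L1Sep` with R; −e_μ of level 0 and L^k·kRM₀·e_μ of level k at distance ≥ N(k − 1));
   and the collar LOCATED: **`sepTower_not_zonesOf`** — the siblings' dictionary `ZonesOf` (x ∈ Ω_j ↔ j ≤ level x),
   under which their `setSep_iff_zoneSep` gives (sep) with the printed constant, FAILS on T (L ≥ 2: the η-point
   (c₁ + 1)·e_μ ∈ Ω₁ has level 0), because the level-j lattice of the model reaches one big block into Ω_{j+1}.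
13. §16 (v1.3), THE SEPARATION CLAUSE IS NECESSARY FOR THE WALK FORM: `hsTower_nlLevel_zero` ∕ `hsTower_nlLevel_negPt`
   (over the tower of equal half-spaces of §12m the origin has level k and −D·e_μ level 0) and **`hsTower_not_levelGap`**
   (L, M₀ ≥ 1, k ≥ 2, N ≥ 1 ⇒ ¬ `LevelGap … N` on the induced sub-graph: the η-bond {−e_μ, 0}); and the bound of item 12
   under the PRINTED threshold, **`nl_levelGap_dist_printedR`** (`L1Sep` with R·L — the printed RM·L^jη in the
   dictionary M = M₀L — and N + d·M₀ ≤ R·M ⇒ N·max{|level x − level x′| − 1, 0} ≤ d(x, x′): the printed constant RM of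
   (2.60) less the collar d·M₀ = (d∕L)·M).
14. §17 (v1.4), PRINT'S LEVEL CONVENTION RESTORES THE FULL CONSTANT: `pzLevel` (the greatest j ≤ k with x ∈ Ω_j) with
   `pzLevel_le` ∕ `le_pzLevel` ∕ `not_mem_of_pzLevel_lt` ∕ `mem_of_le_pzLevel`; `pzDom` and **`pz_zonesOf`** (nesting ⇒
   the siblings' (2.3)–(2.4)-reading `ZonesOf (pzDom k Ω) (pzLevel k Ω)`); `nlLevel_le_pzLevel` and
   `pzLevel_le_nlLevel_succ` (on T: level ≤ zone ≤ level + 1, the latter under `L1Sep` with R ≥ d); **`nl_bondScale_pz`**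
   ((len) on the whole of `nlGraph`, L ≥ 1); **`nl_zoneSep_pz`** ∕ `nl_setSep_pz` (nesting + `L1Sep` with the integer
   R ⇒ `ZoneSep` ∕ `SetSep` with the FULL constant R·M₀ on all of ℤ^d — no cube unions, no collar); **`nl_levelGap_pz`**
   (+ L ≥ 1, every N ≤ R·M₀ ⇒ `LevelGap (nlGraph …) (pzLevel k Ω) N`) and `nl_levelGap_pz_induce`;
   **`nl_levelGap_dist_pz`** (+ M₀ ≥ 1, cube unions, for connectedness only ⇒ N·max{|zone x − zone x′| − 1, 0} ≤
   d(x, x′) on T for every N ≤ R·M₀), **`nl_levelGap_dist_pz_printedR`** ∕ `nl_exp_le_260_pz_printedR` (under the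
   printed threshold `L1Sep` with R·L: every N ≤ R·M, M = M₀L — the PRINTED constant RM of (2.60), and its exponential
   form with N = RM); `hsTower_not_levelGap_pz` (without the clause: ¬ `LevelGap` under print's convention too).
15. §18 (v1.5), THE DICTIONARY IS EXACT: `nl_l1Sep_of_zoneSep_pz`, **`nl_l1Sep_iff_zoneSep_pz`**, **`nl_l1Sep_iff_setSep_pz`**
   (nesting ⇒ `L1Sep k L M₀ R Ω` ↔ `ZoneSep (pzLevel k Ω) l1Pos (L^·) (R·M₀)` ↔ `SetSep (pzDom k Ω) l1Pos (L^·) (R·M₀)`).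
NEGATIVE CONTROLS run before archiving (not part of the file; all rc 1 as expected): `example : False := by omega`
appended; the constant `4 *` of `nl_window_dist` replaced by `3 *`; the constant `4 *` of `nl_window_dist_literal`
replaced by `3 *`; (v1.1) the exponent `(L : ℝ) ^ (m + 1)` of `nl_window_literal_weights_le` replaced by `^ (m + 2)`;
(v1.2) the hypothesis `N + d * M₀ ≤ R * M₀` of `nl_levelGap` weakened to `N ≤ R * M₀`, and `2 ≤ L` of
`sepTower_not_zonesOf` weakened to `1 ≤ L`; (v1.3) `2 ≤ k` of `hsTower_not_levelGap` weakened to `1 ≤ k`; (v1.4)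
`N ≤ R * M₀` of `nl_levelGap_pz` weakened to `N ≤ R * M₀ + 1`, and `d ≤ R` of `pzLevel_le_nlLevel_succ` to `d ≤ R + 1`;
(v1.5) the conclusion of `nl_l1Sep_of_zoneSep_pz` strengthened to `L1Sep k L M₀ (R + 1) Ω`.

WHAT IS NOT PROVED / NOT CLAIMED.  Nothing printed is asserted; (2.46), (2.66), Prop. 2.2 / 2.6 and everything analytic
remain hypotheses of the siblings; (2.1) and (2.2) enter only as the HYPOTHESES `Nested`, `CubeUnions`, `L1Sep` of the
theorems that use them.  These are computations in a model on the INFINITE lattice ℤ^d with k + 1 scales: no torus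
identification, no cover 𝒟 of p. 229, nothing on WHICH boxes are charts of Bałaban's admissible class, nothing on his
operators or random walks; M is a multiple M₀·L of L by construction of the dictionary (as in the second leaf's lower
bound); the zone convention (a lattice kept in a collar ONE big block of the next level wide) is the parent's §8
reading, not a quotation, and other collar widths are not treated.  On the located entry «three levels j − 1, j, j + 1
at once ((2.2)-separated), k > 1» (WHAT IS NOT PROVED of the parent and of both leaves; GAPS.md G-pv08-1) this leaf
decides, in that model and no further: input (α) and the η-unit comparison for every k with NO use of the separation
clause (additive constants 4d(L^k − 1) globally and 4d(L^{i+1} − 1) in the window — the latter k-free but of the order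
of L^{i+1}, as any η-unit constant at level i must be); the literal-unit comparison with level-free constants L and
4dL(L − 1) under the separation clause with R ≥ 2dL(d + L) — a threshold produced by sup-norm windows and two passages
ℓ¹ ↔ ℓ^∞, NOT Bałaban's R, which is not determined here — and its failure without that clause; (v1.2) the walk form
of (2.2) and the level-distance bound behind (2.60) from `Nested` + `L1Sep` with N + d·M₀ ≤ R·M₀ — the first instance
of the siblings' (len) + (sep) ⇒ `LevelGap` chain on a GENERAL nested (2.2)-separated sequence (the sibling
`…B6LevelTower` has it, with SHARP constants and the converse, on one coordinatised tower of boxes; here the loss d·M₀ of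
the collar under the model's own level convention is located — and REMOVED under print's convention Λ_j = Ω_j ∖ Ω_{j+1}
(§17, v1.4: full constant R·M₀, resp. the printed RM under the printed threshold) — but its sharpness for the model's
convention is NOT decided, and of the converse only the extreme case is shown — without ANY separation the walk form
fails (§16, v1.3; §17 for print's convention) — not a quantitative (walk form ⇒ separation) statement).  NOT decided:
the SHARP
constants (4d(…) is what climbing both points gives; the second leaf's lower bound d(L − 1) concerns k = 1 and is not
restated); the number of model points in a window (at most (4dM₀L + 1)^d L^{i−1}-lattice points by §12l — uncounted
here; §13e's `nl_sum266_literal_le` carries #S, while §14 bounds the literal weights' sum by c₀(δ₀, 1/L)^d instead,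
which needs δ₀ > 0); the level i = 0 beyond the leaves (there the two currencies coincide and `nl_window_dist` ∕ the
leaves' window sums are the statements); the size of the constants (c₀(δ₀, 1/L) = (1 + e^{−δ₀/L})/(1 − e^{−δ₀/L})
by the sibling's `B6Lemma21Counterexample.c0_closed`, of the order of L/δ₀ for small δ₀/L — not optimised; the decay
rate ½δ₀ in d(y, y′) is untouched).  VALUE: bookkeeping — a kernel certificate of exactly which
clause of (2.2) the multi-level comparison behind (2.66) consumes, and in which units; NOT progress on any disputed
estimate, NOT summit progress.
-/

namespace Literature.MathematicalPhysics.QuantumFieldTheory.Balaban1983to89.B6BoxChartsNested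

open Literature.Probability.LatticeModels
open B6Geometry B6LevelGapMetric B6BoxCharts B6BoxChartsCorners B6BoxChartsCubeUnions

section Nested

variable {d : ℕ}

/-! ### 12a. Scaling algebra on ℤ^d: L^j-lattice points, coordinate boxes, sup and ℓ¹ distances [folklore] -/

/-- 1·z = z. [folklore] -/
theorem scalePt_one (z : Site d) : scalePt 1 z = z := by
  funext i; rw [scalePt_apply, Nat.cast_one, one_mul]

/-- s·(t·z) = (s·t)·z. [folklore] -/
theorem scalePt_scalePt (s t : ℕ) (z : Site d) : scalePt s (scalePt t z) = scalePt (s * t) z := by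
  funext i; simp only [scalePt_apply, Nat.cast_mul, mul_assoc]

/-- ‖s·x − s·y‖_∞ ≤ s·‖x − y‖_∞. [folklore] -/
theorem supDist_scalePt_le (s : ℕ) (x y : Site d) : supDist (scalePt s x) (scalePt s y) ≤ s * supDist x y := by
  refine supDist_le_iff.2 fun i => ?_
  rw [scalePt_apply, scalePt_apply, ← mul_sub, Int.natAbs_mul, Int.natAbs_natCast]
  exact Nat.mul_le_mul_left s (natAbs_sub_le_supDist x y i)

/-- Scaling by s ≥ 0 maps the coordinate box of c, c′ into the coordinate box of s·c, s·c′. [folklore] -/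
theorem scalePt_mem_cbox (s : ℕ) {c c' x : Site d} (hx : x ∈ cbox c c') :
    scalePt s x ∈ cbox (scalePt s c) (scalePt s c') := by
  intro i
  obtain ⟨h1, h2⟩ := hx i
  have hs : (0 : ℤ) ≤ (s : ℤ) := Int.natCast_nonneg s
  simp only [scalePt_apply]
  constructor
  · rcases le_total (c i) (c' i) with h | h
    · rw [min_eq_left h] at h1; rw [min_eq_left (mul_le_mul_of_nonneg_left h hs)]
      exact mul_le_mul_of_nonneg_left h1 hs
    · rw [min_eq_right h] at h1; rw [min_eq_right (mul_le_mul_of_nonneg_left h hs)]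
      exact mul_le_mul_of_nonneg_left h1 hs
  · rcases le_total (c i) (c' i) with h | h
    · rw [max_eq_right h] at h2; rw [max_eq_right (mul_le_mul_of_nonneg_left h hs)]
      exact mul_le_mul_of_nonneg_left h2 hs
    · rw [max_eq_left h] at h2; rw [max_eq_left (mul_le_mul_of_nonneg_left h hs)]
      exact mul_le_mul_of_nonneg_left h2 hs

/-- A coordinate box is coordinate-box closed. [folklore] -/
theorem cboxClosed_cbox (u y : Site d) : CboxClosed (cbox u y) := by
  intro a b ha hb x hx i
  obtain ⟨ha1, ha2⟩ := ha i
  obtain ⟨hb1, hb2⟩ := hb i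
  obtain ⟨hx1, hx2⟩ := hx i
  constructor <;> omega

/-- A point of the coordinate box of v, y is, in every coordinate, no farther from any t than the farther of v, y.
[folklore] -/
theorem natAbs_sub_le_of_mem_cbox {v y x : Site d} (hx : x ∈ cbox v y) (t : ℤ) (i : Fin d) :
    (x i - t).natAbs ≤ max ((v i - t).natAbs) ((y i - t).natAbs) := by
  obtain ⟨h1, h2⟩ := hx i
  omega

/-- ‖x − y‖₁ ≤ d·c when every coordinate differs by at most c. [folklore] -/
theorem latL1Dist_le_of_coord {x y : Site d} {c : ℕ} (h : ∀ i, (x i - y i).natAbs ≤ c) : latL1Dist x y ≤ d * c := by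
  unfold latL1Dist
  calc ∑ i, (x i - y i).natAbs ≤ ∑ _i : Fin d, c := Finset.sum_le_sum fun i _ => h i
    _ = d * c := by simp

/-! ### 12b. Charts with a cost: a box of lattice steps each realised at distance ≤ c [folklore] -/

/-- **Cost charts.**  If every nearest-neighbour step inside a coordinate-box closed set B ⊆ ℤ^d is realised in G,
through φ, by a walk of at most c bonds, then any two points b, b′ of B are joined in G and
dist(φ b, φ b′) ≤ c·‖b − b′‖₁ (the monotone staircase from b to b′ stays in cbox b b′ ⊆ B).  The parent's box charts
(`dist_le_latL1Dist_of_chart`) are the case c = 1 with bonds. [folklore] -/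
theorem reachable_dist_of_costChart {V : Type*} {G : SimpleGraph V} {B : Set (Site d)} {φ : Site d → V} {c : ℕ}
    (hB : CboxClosed B)
    (hφ : ∀ ⦃b b' : Site d⦄, b ∈ B → b' ∈ B → (zdGraph d).Adj b b' →
      G.Reachable (φ b) (φ b') ∧ G.dist (φ b) (φ b') ≤ c)
    {u y : Site d} (hu : u ∈ B) (hy : y ∈ B) :
    G.Reachable (φ u) (φ y) ∧ G.dist (φ u) (φ y) ≤ c * latL1Dist u y := by
  suffices key : ∀ (n : ℕ) (u : Site d), u ∈ B → cbox u y ⊆ B → latL1Dist u y ≤ n →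
      G.Reachable (φ u) (φ y) ∧ G.dist (φ u) (φ y) ≤ c * latL1Dist u y from key _ u hu (hB hu hy) le_rfl
  intro n
  induction n with
  | zero =>
    intro u _ _ hn
    have h := eq_of_latL1Dist_eq_zero (Nat.le_zero.1 hn)
    subst h
    exact ⟨SimpleGraph.Reachable.refl _, by rw [SimpleGraph.dist_self]; exact Nat.zero_le _⟩
  | succ n ih =>
    intro u hu hsub hn
    by_cases huy : u = y
    · subst huy
      exact ⟨SimpleGraph.Reachable.refl _, by rw [SimpleGraph.dist_self]; exact Nat.zero_le _⟩
    · obtain ⟨u', hadj, hu'box, hlt⟩ := exists_step_towards huy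
      have hu'B : u' ∈ B := hsub hu'box
      have hsub' : cbox u' y ⊆ B := (cbox_subset_of_mem hu'box).trans hsub
      obtain ⟨hr2, hd2⟩ := ih u' hu'B hsub' (by omega)
      obtain ⟨hr1, hd1⟩ := hφ hu hu'B hadj
      have h3 := hr1.dist_triangle_left (G := G) (φ y)
      have h4 : c * latL1Dist u' y + c ≤ c * latL1Dist u y := by
        have h5 : latL1Dist u' y + 1 ≤ latL1Dist u y := hlt
        calc c * latL1Dist u' y + c = c * (latL1Dist u' y + 1) := by ring
          _ ≤ c * latL1Dist u y := Nat.mul_le_mul_left c h5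
      exact ⟨hr1.trans hr2, by omega⟩

/-! ### 12c. The (k+1)-level model over a nested sequence of cube unions [folklore] -/

/-- The THICKNESS ZONE of level j (j < k): the η-points within sup-distance M₀·L^{j+1} — the side of ONE big block of
level j + 1 — of the complement of Ω_{j+1}; no condition at the top level j = k.  Level-j bonds live here (the overlap
slab of the parent's §8 and of `cuFine`, one level up each time). [folklore] -/
def nlZone (k L M₀ : ℕ) (Ω : ℕ → Set (Site d)) (j : ℕ) : Set (Site d) :=
  {x | j < k → x ∈ cuFine (M₀ * L ^ (j + 1)) (Ω (j + 1))}

/-- Admissibility of a point as an end of a LEVEL-j BOND: inside Ω_j (for j ≥ 1; Ω₀ = everything) and in the thickness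
zone of level j. [folklore] -/
def nlOK (k L M₀ : ℕ) (Ω : ℕ → Set (Site d)) (j : ℕ) : Set (Site d) :=
  {x | (1 ≤ j → x ∈ Ω j) ∧ x ∈ nlZone k L M₀ Ω j}

/-- The points of the model OF LEVEL j: the L^j·ℤ^d-lattice points admissible at level j. [folklore] -/
def nlPtsAt (k L M₀ : ℕ) (Ω : ℕ → Set (Site d)) (j : ℕ) : Set (Site d) :=
  {x | (∃ a : Site d, x = scalePt (L ^ j) a) ∧ x ∈ nlOK k L M₀ Ω j}

/-- The bonds: for each level j ≤ k, the L^jη-bonds {L^j·a, L^j·a′}, a ∼ a′ in ℤ^d, with both ends admissible at level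
j. [folklore] -/
def nlRel (d k L M₀ : ℕ) (Ω : ℕ → Set (Site d)) (u v : Site d) : Prop :=
  ∃ j, j ≤ k ∧ ∃ a a' : Site d, (zdGraph d).Adj a a' ∧ u = scalePt (L ^ j) a ∧ v = scalePt (L ^ j) a' ∧
    u ∈ nlOK k L M₀ Ω j ∧ v ∈ nlOK k L M₀ Ω j

/-- The (k+1)-level bond graph over the nested sequence Ω. [folklore] -/
def nlGraph (d k L M₀ : ℕ) (Ω : ℕ → Set (Site d)) : SimpleGraph (Site d) := SimpleGraph.fromRel (nlRel d k L M₀ Ω)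

/-- Its point set T = ⋃_{j ≤ k} (points of level j). [folklore] -/
def nlPts (d k L M₀ : ℕ) (Ω : ℕ → Set (Site d)) : Set (Site d) := {x | ∃ j, j ≤ k ∧ x ∈ nlPtsAt k L M₀ Ω j}

variable {k L M₀ : ℕ} {Ω : ℕ → Set (Site d)}

/-- Level-j lattice steps with admissible ends are bonds (L ≥ 1). [folklore] -/
theorem nlGraph_adj_of_step (hL : 1 ≤ L) {j : ℕ} (hj : j ≤ k) {a a' : Site d} (h : (zdGraph d).Adj a a')
    (ha : scalePt (L ^ j) a ∈ nlOK k L M₀ Ω j) (ha' : scalePt (L ^ j) a' ∈ nlOK k L M₀ Ω j) :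
    (nlGraph d k L M₀ Ω).Adj (scalePt (L ^ j) a) (scalePt (L ^ j) a') := by
  rw [nlGraph, SimpleGraph.fromRel_adj]
  exact ⟨fun he => h.ne (scalePt_injective (Nat.pow_pos hL) he), Or.inl ⟨j, hj, a, a', h, rfl, rfl, ha, ha'⟩⟩

/-- Both ends of a bond are points of the model. [folklore] -/
theorem mem_nlPts_of_rel {u v : Site d} (h : nlRel d k L M₀ Ω u v) :
    u ∈ nlPts d k L M₀ Ω ∧ v ∈ nlPts d k L M₀ Ω := by
  obtain ⟨j, hj, a, a', -, hu, hv, hu', hv'⟩ := h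
  exact ⟨⟨j, hj, ⟨a, hu⟩, hu'⟩, ⟨j, hj, ⟨a', hv⟩, hv'⟩⟩

/-- HONESTY: points outside T are isolated. [folklore] -/
theorem nlGraph_not_adj_of_not_mem {u : Site d} (hu : u ∉ nlPts d k L M₀ Ω) (v : Site d) :
    ¬ (nlGraph d k L M₀ Ω).Adj u v := by
  rw [nlGraph, SimpleGraph.fromRel_adj]
  rintro ⟨-, h | h⟩
  · exact hu (mem_nlPts_of_rel h).1
  · exact hu (mem_nlPts_of_rel h).2

/-- A point of level j lies in the zone of level j. [folklore] -/
theorem nlZone_of_nlPtsAt {j : ℕ} {x : Site d} (hx : x ∈ nlPtsAt k L M₀ Ω j) : x ∈ nlZone k L M₀ Ω j := hx.2.2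

/-- **k = 1 is the two-scale model over a cube union** (`…B6BoxChartsCubeUnions.cuGraph`, block side M = M₀·L): the
bond relations agree … [folklore] -/
theorem nlRel_one (L M₀ : ℕ) (Ω : ℕ → Set (Site d)) :
    nlRel d 1 L M₀ Ω = regionRel d L (cuFine (M₀ * L) (Ω 1)) (cuCoarse L (Ω 1)) := by
  funext u v
  apply propext
  constructor
  · rintro ⟨j, hj, a, a', hadj, rfl, rfl, hu, hv⟩
    rcases Nat.le_one_iff_eq_zero_or_eq_one.1 hj with rfl | rfl
    · refine Or.inl ⟨?_, ?_, ?_⟩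
      · simpa only [pow_zero, scalePt_one] using hadj
      · simpa only [pow_zero, scalePt_one, zero_add, pow_one] using hu.2 Nat.zero_lt_one
      · simpa only [pow_zero, scalePt_one, zero_add, pow_one] using hv.2 Nat.zero_lt_one
    · refine Or.inr ⟨a, a', hadj, ?_, ?_, ?_, ?_⟩
      · show scalePt L a ∈ Ω 1
        simpa only [pow_one] using hu.1 le_rfl
      · show scalePt L a' ∈ Ω 1
        simpa only [pow_one] using hv.1 le_rfl
      · simp only [pow_one]
      · simp only [pow_one]
  · rintro (⟨hadj, hu, hv⟩ | ⟨y, y', hadj, hy, hy', rfl, rfl⟩)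
    · refine ⟨0, Nat.zero_le _, u, v, hadj, ?_, ?_, ⟨fun h => absurd h (by omega), fun _ => ?_⟩,
        ⟨fun h => absurd h (by omega), fun _ => ?_⟩⟩
      · rw [pow_zero, scalePt_one]
      · rw [pow_zero, scalePt_one]
      · simpa only [zero_add, pow_one] using hu
      · simpa only [zero_add, pow_one] using hv
    · refine ⟨1, le_rfl, y, y', hadj, ?_, ?_, ⟨fun _ => ?_, fun h => absurd h (lt_irrefl 1)⟩,
        ⟨fun _ => ?_, fun h => absurd h (lt_irrefl 1)⟩⟩
      · rw [pow_one]
      · rw [pow_one]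
      · have hy1 : scalePt L y ∈ Ω 1 := hy
        simpa only [pow_one] using hy1
      · have hy1 : scalePt L y' ∈ Ω 1 := hy'
        simpa only [pow_one] using hy1

/-- … hence the graphs agree, `nlGraph d 1 L M₀ Ω = cuGraph d L (M₀·L) (Ω 1)` … [folklore] -/
theorem nlGraph_one (L M₀ : ℕ) (Ω : ℕ → Set (Site d)) : nlGraph d 1 L M₀ Ω = cuGraph d L (M₀ * L) (Ω 1) := by
  rw [nlGraph, nlRel_one]
  rfl

/-- … and so do the point sets. [folklore] -/
theorem nlPts_one (L M₀ : ℕ) (Ω : ℕ → Set (Site d)) : nlPts d 1 L M₀ Ω = cuPts d L (M₀ * L) (Ω 1) := by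
  refine Set.ext fun x => ⟨?_, ?_⟩
  · rintro ⟨j, hj, ⟨a, rfl⟩, hok⟩
    rcases Nat.le_one_iff_eq_zero_or_eq_one.1 hj with rfl | rfl
    · refine Or.inl ?_
      simpa only [pow_zero, scalePt_one, zero_add, pow_one] using hok.2 Nat.zero_lt_one
    · refine Or.inr ⟨a, ?_, by rw [pow_one]⟩
      show scalePt L a ∈ Ω 1
      simpa only [pow_one] using hok.1 le_rfl
  · rintro (hx | ⟨y, hy, rfl⟩)
    · refine ⟨0, Nat.zero_le _, ⟨x, by rw [pow_zero, scalePt_one]⟩, fun h => absurd h (by omega), fun _ => ?_⟩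
      simpa only [zero_add, pow_one] using hx
    · refine ⟨1, le_rfl, ⟨y, by rw [pow_one]⟩, fun _ => ?_, fun h => absurd h (lt_irrefl 1)⟩
      have hy1 : scalePt L y ∈ Ω 1 := hy
      simpa only [pow_one] using hy1

/-! ### 12d. The skeleton: a level-j lattice step with both ends in the zone of level j costs at most L^j [folklore] -/

/-- **The skeleton step (S)** (L ≥ 1, M₀ ≥ 1; NO hypothesis on the sets Ω_j): for every level j ≤ k, the ends L^j·a,
L^j·(a + e_i) of a level-j lattice step that both lie in the zone of level j are joined, at distance ≤ L^j — by the
level-j bond if both lie in Ω_j (or j = 0); otherwise one end q lies outside Ω_j, the L + 1 points L^{j−1}·b of the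
η-segment between them lie within sup-distance L^j ≤ M₀L^j of q, hence in the zone of level j − 1, and the L level-(j−1)
sub-steps cost ≤ L^{j−1} each by induction (a cost chart, §12b). [folklore] -/
theorem nl_step (hL : 1 ≤ L) (hM₀ : 1 ≤ M₀) :
    ∀ (j : ℕ), j ≤ k → ∀ (a : Site d) (i : Fin d),
      scalePt (L ^ j) a ∈ nlZone k L M₀ Ω j → scalePt (L ^ j) (a + Pi.single i 1) ∈ nlZone k L M₀ Ω j →
      (nlGraph d k L M₀ Ω).Reachable (scalePt (L ^ j) a) (scalePt (L ^ j) (a + Pi.single i 1)) ∧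
        (nlGraph d k L M₀ Ω).dist (scalePt (L ^ j) a) (scalePt (L ^ j) (a + Pi.single i 1)) ≤ L ^ j := by
  intro j
  induction j with
  | zero =>
    intro hk a i ha ha'
    have hadj : (zdGraph d).Adj a (a + Pi.single i 1) := (zdGraph_adj_iff _ _).2 ⟨i, Or.inl rfl⟩
    have h := nlGraph_adj_of_step hL hk hadj ⟨fun h => absurd h (by omega), ha⟩ ⟨fun h => absurd h (by omega), ha'⟩
    refine ⟨h.reachable, ?_⟩
    rw [pow_zero]
    exact dist_le_one_of_eq_or_adj (Or.inr h)
  | succ j ih =>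
    intro hk a i ha ha'
    have hadj : (zdGraph d).Adj a (a + Pi.single i 1) := (zdGraph_adj_iff _ _).2 ⟨i, Or.inl rfl⟩
    by_cases hΩ : scalePt (L ^ (j + 1)) a ∈ Ω (j + 1) ∧ scalePt (L ^ (j + 1)) (a + Pi.single i 1) ∈ Ω (j + 1)
    · have h := nlGraph_adj_of_step hL hk hadj ⟨fun _ => hΩ.1, ha⟩ ⟨fun _ => hΩ.2, ha'⟩
      exact ⟨h.reachable, (dist_le_one_of_eq_or_adj (Or.inr h)).trans (Nat.one_le_pow _ _ hL)⟩
    · -- one end q lies outside Ω (j+1); q = L^j·c for a corner c of the segment [L·a, L·(a + e_i)] of L^j-indices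
      have hout : ∃ c : Site d, (c = scalePt L a ∨ c = scalePt L (a + Pi.single i 1)) ∧
          scalePt (L ^ j) c ∉ Ω (j + 1) := by
        by_cases h1 : scalePt (L ^ (j + 1)) a ∈ Ω (j + 1)
        · refine ⟨_, Or.inr rfl, fun h2 => hΩ ⟨h1, ?_⟩⟩
          rwa [scalePt_scalePt, ← pow_succ] at h2
        · refine ⟨_, Or.inl rfl, fun h2 => h1 ?_⟩
          rwa [scalePt_scalePt, ← pow_succ] at h2
      obtain ⟨c, hc, hcΩ⟩ := hout
      have hseg : supDist (scalePt L a) (scalePt L (a + Pi.single i 1)) ≤ L := by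
        refine supDist_le_iff.2 fun i' => ?_
        rw [scalePt_apply, scalePt_apply, Pi.add_apply]
        by_cases hi : i' = i
        · subst hi
          rw [Pi.single_eq_same]
          have h3 : (L : ℤ) * a i' - (L : ℤ) * (a i' + 1) = -(L : ℤ) := by ring
          rw [h3, Int.natAbs_neg, Int.natAbs_natCast]
        · rw [Pi.single_eq_of_ne hi, add_zero, sub_self]
          exact Nat.zero_le _
      have hzone : ∀ b ∈ cbox (scalePt L a) (scalePt L (a + Pi.single i 1)),
          scalePt (L ^ j) b ∈ nlZone k L M₀ Ω j := by
        intro b hb _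
        refine ⟨scalePt (L ^ j) c, hcΩ, ?_⟩
        have hbc : supDist b c ≤ L := by
          obtain ⟨h1, h2⟩ := supDist_le_of_mem_cbox hb
          rcases hc with rfl | rfl
          · rw [supDist_comm]; exact h1.trans hseg
          · exact h2.trans hseg
        calc supDist (scalePt (L ^ j) b) (scalePt (L ^ j) c) ≤ L ^ j * supDist b c := supDist_scalePt_le _ _ _
          _ ≤ L ^ j * L := Nat.mul_le_mul_left _ hbc
          _ = L ^ (j + 1) := (pow_succ L j).symm
          _ ≤ M₀ * L ^ (j + 1) := Nat.le_mul_of_pos_left _ hM₀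
      have hcost := reachable_dist_of_costChart (G := nlGraph d k L M₀ Ω) (φ := scalePt (L ^ j)) (c := L ^ j)
        (cboxClosed_cbox (scalePt L a) (scalePt L (a + Pi.single i 1)))
        (fun b b' hb hb' hbb' => by
          obtain ⟨i', h | h⟩ := (zdGraph_adj_iff b b').1 hbb'
          · rw [h] at hb' ⊢
            exact ih (by omega) b i' (hzone b hb) (hzone _ hb')
          · rw [h] at hb
            obtain ⟨hr, hd⟩ := ih (by omega) b' i' (hzone b' hb') (hzone _ hb)
            rw [← h] at hr hd
            rw [SimpleGraph.dist_comm] at hd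
            exact ⟨hr.symm, hd⟩)
        (left_mem_cbox _ _) (right_mem_cbox _ _)
      rw [scalePt_scalePt, scalePt_scalePt, ← pow_succ, latL1Dist_scalePt, latL1Dist_add_single, mul_one,
        ← pow_succ] at hcost
      exact hcost

/-- The skeleton step for an unoriented lattice step b ∼ b′. [folklore] -/
theorem nl_step' (hL : 1 ≤ L) (hM₀ : 1 ≤ M₀) {n : ℕ} (hn : n ≤ k) {b b' : Site d} (h : (zdGraph d).Adj b b')
    (hb : scalePt (L ^ n) b ∈ nlZone k L M₀ Ω n) (hb' : scalePt (L ^ n) b' ∈ nlZone k L M₀ Ω n) :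
    (nlGraph d k L M₀ Ω).Reachable (scalePt (L ^ n) b) (scalePt (L ^ n) b') ∧
      (nlGraph d k L M₀ Ω).dist (scalePt (L ^ n) b) (scalePt (L ^ n) b') ≤ L ^ n := by
  obtain ⟨i, hi | hi⟩ := (zdGraph_adj_iff b b').1 h
  · subst hi
    exact nl_step hL hM₀ n hn b i hb hb'
  · subst hi
    obtain ⟨hr, hd⟩ := nl_step hL hM₀ n hn b' i hb' hb
    rw [SimpleGraph.dist_comm] at hd
    exact ⟨hr.symm, hd⟩

/-! ### 12e. The lattice of level n inside its zone: d(L^n·z, L^n·z′) ≤ L^n·‖z − z′‖₁ [folklore] -/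

/-- **The level-n lattice inside the zone** (L ≥ 1, M₀ ≥ 1, n ≤ k): if every L^n-point L^n·b, b in the coordinate box
of z, z′, lies in the zone of level n, then d(L^n·z, L^n·z′) ≤ L^n·‖z − z′‖₁ = ‖L^n·z − L^n·z′‖₁ (the monotone staircase,
each step by §12d). [folklore] -/
theorem nl_lattice (hL : 1 ≤ L) (hM₀ : 1 ≤ M₀) {n : ℕ} (hn : n ≤ k) {z z' : Site d}
    (hbox : ∀ b ∈ cbox z z', scalePt (L ^ n) b ∈ nlZone k L M₀ Ω n) :
    (nlGraph d k L M₀ Ω).Reachable (scalePt (L ^ n) z) (scalePt (L ^ n) z') ∧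
      (nlGraph d k L M₀ Ω).dist (scalePt (L ^ n) z) (scalePt (L ^ n) z') ≤ L ^ n * latL1Dist z z' :=
  reachable_dist_of_costChart (cboxClosed_cbox z z')
    (fun _ _ hb hb' h => nl_step' hL hM₀ hn h (hbox _ hb) (hbox _ hb')) (left_mem_cbox z z') (right_mem_cbox z z')

/-- **The top lattice** (no hypothesis on Ω): d(L^k·z, L^k·z′) ≤ L^k·‖z − z′‖₁ for all z, z′ ∈ ℤ^d — the coarsest
lattice is traversable everywhere, at the cost of its own η-length. [folklore] -/
theorem nl_topLattice (hL : 1 ≤ L) (hM₀ : 1 ≤ M₀) (z z' : Site d) :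
    (nlGraph d k L M₀ Ω).Reachable (scalePt (L ^ k) z) (scalePt (L ^ k) z') ∧
      (nlGraph d k L M₀ Ω).dist (scalePt (L ^ k) z) (scalePt (L ^ k) z') ≤ L ^ k * latL1Dist z z' :=
  nl_lattice hL hM₀ le_rfl fun _ _ hlt => absurd hlt (lt_irrefl k)

/-! ### 12f. The climb: a point of level j reaches the L^{j+1}-lattice at cost ≤ d(L − 1)·L^j through the hull of a
level-(j+1) block outside Ω_{j+1} [folklore] -/

/-- The hull of a point u and a block Q of the N-partition missing the cube union Λ, with ‖u − w‖_∞ ≤ N for some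
w ∈ Q, lies in `cuFine N Λ`: every point of the hull is within sup-distance N of its clamp into Q (the parent leaf's
anchor argument, `…B6BoxChartsCubeUnions.exists_anchor`, isolated). [folklore] -/
theorem mem_cuFine_of_hull {N : ℕ} (hN : 0 < N) {Λ : Set (Site d)} (hΛ : IsCubeUnion N Λ) {u w x : Site d}
    (hw : w ∉ Λ) (huw : supDist u w ≤ N)
    (hx : ∀ i, min (u i) ((N : ℤ) * blockIdx N w i) ≤ x i ∧
      x i ≤ max (u i) ((N : ℤ) * blockIdx N w i + ((N : ℤ) - 1))) :
    x ∈ cuFine N Λ := by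
  have hwQ := mem_blockBox_blockIdx hN w
  have hQ : ∀ p ∈ (blockAtlas d N).box (blockIdx N w), p ∉ Λ := fun p hp hpΛ => hw (hΛ hp hpΛ hwQ)
  have hwi : ∀ i, (N : ℤ) * blockIdx N w i ≤ w i ∧ w i ≤ (N : ℤ) * blockIdx N w i + ((N : ℤ) - 1) :=
    mem_blockBox_iff.1 hwQ
  have huwi : ∀ i, (u i - w i).natAbs ≤ N := supDist_le_iff.1 huw
  obtain ⟨p, hp⟩ : ∃ p : Site d, ∀ i,
      p i = max ((N : ℤ) * blockIdx N w i) (min (x i) ((N : ℤ) * blockIdx N w i + ((N : ℤ) - 1))) :=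
    ⟨_, fun _ => rfl⟩
  have hpQ : p ∈ (blockAtlas d N).box (blockIdx N w) := by
    rw [mem_blockBox_iff]
    intro i
    have h0 := hp i
    constructor <;> omega
  refine ⟨p, hQ p hpQ, supDist_le_iff.2 fun i => ?_⟩
  have h1 := hx i
  have h3 := hwi i
  have h4 := huwi i
  have h7 := hp i
  omega

/-- **The one-level climb** (L ≥ 1, M₀ ≥ 1, j < k, Ω_{j+1} a cube union of the M₀L^{j+1}-partition): a point
u = L^j·a of the zone of level j — within sup-distance M₀L^{j+1} of some w ∉ Ω_{j+1}, hence of the whole block Q ∋ w,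
Q ∩ Ω_{j+1} = ∅ — reaches an L^{j+1}-point v = L^{j+1}·z with |u_i − v_i| ≤ (L − 1)·L^j in every coordinate at cost
d(u, v) ≤ d(L − 1)·L^j: the L^j-points of the hull of u and Q form a cost chart of level j (each step ≤ L^j by §12d,
the hull lying in the zone by `mem_cuFine_of_hull`) whose side along Q is M₀L ≥ L indices, so each index a_i rounds
inside it to a multiple of L; and v lies again in the zone of level j. [folklore] -/
theorem nl_climb (hL : 1 ≤ L) (hM₀ : 1 ≤ M₀) {j : ℕ} (hjk : j < k)
    (hΩ : IsCubeUnion (M₀ * L ^ (j + 1)) (Ω (j + 1))) {a : Site d} (ha : scalePt (L ^ j) a ∈ nlZone k L M₀ Ω j) :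
    ∃ z : Site d, (nlGraph d k L M₀ Ω).Reachable (scalePt (L ^ j) a) (scalePt (L ^ (j + 1)) z) ∧
      (nlGraph d k L M₀ Ω).dist (scalePt (L ^ j) a) (scalePt (L ^ (j + 1)) z) ≤ L ^ j * (d * (L - 1)) ∧
      (∀ i, (scalePt (L ^ j) a i - scalePt (L ^ (j + 1)) z i).natAbs ≤ L ^ j * (L - 1)) ∧
      scalePt (L ^ (j + 1)) z ∈ nlZone k L M₀ Ω j := by
  have hL0 : (0 : ℤ) < L := by exact_mod_cast hL
  have hs0 : 0 < L ^ j := Nat.pow_pos hL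
  have hNpos : 0 < M₀ * L ^ (j + 1) := Nat.mul_pos hM₀ (Nat.pow_pos hL)
  have hLN' : L ≤ M₀ * L := Nat.le_mul_of_pos_left L hM₀
  have hsL : L ^ (j + 1) = L ^ j * L := pow_succ L j
  have hN : M₀ * L ^ (j + 1) = L ^ j * (M₀ * L) := by rw [pow_succ]; ring
  obtain ⟨w, hwΩ, huw⟩ := ha hjk
  -- abbreviations: s = L^j, N' = M₀L (block side in L^j-indices), N = M₀L^{j+1} = s·N' (block side in η-units)
  generalize hs : L ^ j = s at *
  generalize hN' : M₀ * L = N' at *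
  generalize hNN : M₀ * L ^ (j + 1) = N at *
  have hs1 : (1 : ℤ) ≤ s := by exact_mod_cast hs0
  have hNcast : ((N : ℕ) : ℤ) = (s : ℤ) * (N' : ℤ) := by rw [hN]; push_cast; ring
  have hLN'z : (L : ℤ) ≤ N' := by exact_mod_cast hLN'
  -- the hull of a and the block, in L^j-indices
  obtain ⟨lo, hlo⟩ : ∃ lo : Site d, ∀ i, lo i = min (a i) ((N' : ℤ) * blockIdx N w i) := ⟨_, fun _ => rfl⟩
  obtain ⟨hi, hhi⟩ : ∃ hi : Site d, ∀ i, hi i = max (a i) ((N' : ℤ) * blockIdx N w i + ((N' : ℤ) - 1)) :=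
    ⟨_, fun _ => rfl⟩
  have haH : a ∈ Set.Icc lo hi :=
    Set.mem_Icc.2 ⟨fun i => by rw [hlo i]; exact min_le_left _ _, fun i => by rw [hhi i]; exact le_max_left _ _⟩
  -- its L^j-points lie in the fine region of Ω_{j+1}, i.e. in the zone of level j
  have hH : ∀ c ∈ Set.Icc lo hi, scalePt s c ∈ cuFine N (Ω (j + 1)) := by
    intro c hc
    rw [Set.mem_Icc] at hc
    refine mem_cuFine_of_hull hNpos hΩ hwΩ huw fun i => ?_
    have h1 : lo i ≤ c i := hc.1 i
    have h2 : c i ≤ hi i := hc.2 i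
    rw [hlo i] at h1
    rw [hhi i] at h2
    rw [scalePt_apply, scalePt_apply, hNcast]
    have hsz : (0 : ℤ) ≤ s := by omega
    constructor
    · rcases le_total (a i) ((N' : ℤ) * blockIdx N w i) with h | h
      · rw [min_eq_left h] at h1
        exact min_le_of_left_le (mul_le_mul_of_nonneg_left h1 hsz)
      · rw [min_eq_right h] at h1
        have h3 := mul_le_mul_of_nonneg_left h1 hsz
        refine min_le_of_right_le ?_
        calc (s : ℤ) * (N' : ℤ) * blockIdx N w i = (s : ℤ) * ((N' : ℤ) * blockIdx N w i) := by ring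
          _ ≤ (s : ℤ) * c i := h3
    · rcases le_total (a i) ((N' : ℤ) * blockIdx N w i + ((N' : ℤ) - 1)) with h | h
      · rw [max_eq_right h] at h2
        have h3 := mul_le_mul_of_nonneg_left h2 hsz
        refine le_max_of_le_right ?_
        have h4 : (s : ℤ) * ((N' : ℤ) * blockIdx N w i + ((N' : ℤ) - 1)) =
            (s : ℤ) * (N' : ℤ) * blockIdx N w i + ((s : ℤ) * (N' : ℤ) - s) := by ring
        rw [h4] at h3
        linarith
      · rw [max_eq_left h] at h2
        exact le_max_of_le_left (mul_le_mul_of_nonneg_left h2 hsz)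
  -- rounding each index of a inside the hull to a multiple of L
  obtain ⟨z, hz⟩ : ∃ z : Site d, ∀ i, z i = if lo i ≤ (L : ℤ) * (a i / L) then a i / L else a i / L + 1 :=
    ⟨_, fun _ => rfl⟩
  have hzi : ∀ i, lo i ≤ (L : ℤ) * z i ∧ (L : ℤ) * z i ≤ hi i ∧ (a i - (L : ℤ) * z i).natAbs ≤ L - 1 := by
    intro i
    have h1 := Int.mul_ediv_add_emod (a i) (L : ℤ)
    have h2 := Int.emod_nonneg (a i) hL0.ne'
    have h3 := Int.emod_lt_of_pos (a i) hL0
    have h6 := hlo i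
    have h7 := hhi i
    rw [hz i]
    split_ifs with h
    · refine ⟨h, ?_, ?_⟩ <;> omega
    · rw [mul_add, mul_one]
      refine ⟨?_, ?_, ?_⟩ <;> omega
  have hzH : scalePt L z ∈ Set.Icc lo hi :=
    Set.mem_Icc.2 ⟨fun i => by rw [scalePt_apply]; exact (hzi i).1, fun i => by rw [scalePt_apply]; exact (hzi i).2.1⟩
  -- the cost chart of level j on the hull
  have hjk' : j ≤ k := hjk.le
  have hzoneH : ∀ c ∈ Set.Icc lo hi, scalePt s c ∈ nlZone k L M₀ Ω j := fun c hc _ => by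
    rw [hNN]; exact hH c hc
  have hstep : ∀ ⦃b b' : Site d⦄, b ∈ Set.Icc lo hi → b' ∈ Set.Icc lo hi → (zdGraph d).Adj b b' →
      (nlGraph d k L M₀ Ω).Reachable (scalePt s b) (scalePt s b') ∧
        (nlGraph d k L M₀ Ω).dist (scalePt s b) (scalePt s b') ≤ s := by
    intro b b' hb hb' hbb'
    have h := fun (hb₁ : scalePt (L ^ j) b ∈ nlZone k L M₀ Ω j) (hb₂ : scalePt (L ^ j) b' ∈ nlZone k L M₀ Ω j) =>
      nl_step' (k := k) (L := L) (M₀ := M₀) (Ω := Ω) hL hM₀ hjk' hbb' hb₁ hb₂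
    rw [hs] at h
    exact h (hzoneH b hb) (hzoneH b' hb')
  have hcost := reachable_dist_of_costChart (G := nlGraph d k L M₀ Ω) (φ := scalePt s) (c := s)
    (cboxClosed_Icc lo hi) hstep haH hzH
  have hdist : latL1Dist a (scalePt L z) ≤ d * (L - 1) :=
    latL1Dist_le_of_coord fun i => by rw [scalePt_apply]; exact (hzi i).2.2
  refine ⟨z, ?_, ?_, ?_, ?_⟩
  · rw [hsL, ← scalePt_scalePt]
    exact hcost.1
  · rw [hsL, ← scalePt_scalePt]
    exact hcost.2.trans (Nat.mul_le_mul_left _ hdist)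
  · intro i
    rw [hsL, ← scalePt_scalePt, scalePt_apply, scalePt_apply, ← mul_sub, Int.natAbs_mul, Int.natAbs_natCast,
      scalePt_apply]
    exact Nat.mul_le_mul_left _ (hzi i).2.2
  · rw [hsL, ← scalePt_scalePt]
    exact hzoneH _ hzH

/-! ### 12g. Nesting (2.1) and the big blocks of (2.2): the zones increase with the level; the iterated climb
[folklore] -/

/-- A larger radius and a smaller domain give a larger fine region. [folklore] -/
theorem cuFine_mono {M M' : ℕ} {Λ Λ' : Set (Site d)} (hΛ : Λ' ⊆ Λ) (hM : M ≤ M') : cuFine M Λ ⊆ cuFine M' Λ' :=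
  fun _ ⟨w, hw, hxw⟩ => ⟨w, fun h => hw (hΛ h), hxw.trans hM⟩

/-- The NESTING of (2.1) p. 224, *"Ω₁ ⊃ Ω₂ ⊃ … ⊃ Ω_k"* (quoted in the siblings `…B6LevelGapMetric` and
`…B6LevelTower`): Ω_{m+1} ⊆ Ω_m for 1 ≤ m < k (the model's
level 0 is unconstrained, Ω₀ = T). A hypothesis, never asserted. [folklore] -/
def Nested (k : ℕ) (Ω : ℕ → Set (Site d)) : Prop := ∀ m, 1 ≤ m → m < k → Ω (m + 1) ⊆ Ω m

/-- The BIG-BLOCK clause of (2.2) p. 224 / p. 229 (quoted in the parent: Ω_j is a sum of big blocks of the size ML^jη):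
Ω_m is a union of cubes of the partition of side M₀·L^m, for 1 ≤ m ≤ k. A hypothesis, never asserted; the SEPARATION
clause of (2.2), (L^jη)^{−1}dist(Ω_j^c, Ω_{j+1}) > RM, is NOT part of it: it is the separate hypothesis `L1Sep` of §12l
and §13d–e, used nowhere else in this file. [folklore] -/
def CubeUnions (k L M₀ : ℕ) (Ω : ℕ → Set (Site d)) : Prop := ∀ m, 1 ≤ m → m ≤ k → IsCubeUnion (M₀ * L ^ m) (Ω m)

/-- Nesting iterated: Ω_{m′} ⊆ Ω_m for 1 ≤ m ≤ m′ ≤ k. [folklore] -/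
theorem Nested.subset (h : Nested k Ω) {m m' : ℕ} (hm : 1 ≤ m) (hmm' : m ≤ m') (hm'k : m' ≤ k) : Ω m' ⊆ Ω m := by
  obtain ⟨n, rfl⟩ := Nat.exists_eq_add_of_le hmm'
  induction n with
  | zero => exact subset_rfl
  | succ n ih => exact (h (m + n) (by omega) (by omega)).trans (ih (by omega) (by omega))

/-- Under nesting the zones increase with the level: zone_m ⊆ zone_{m+1} (L ≥ 1; a point within M₀L^{m+1} of Ω_{m+1}^c is
within M₀L^{m+2} of Ω_{m+2}^c ⊇ Ω_{m+1}^c). [folklore] -/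
theorem nlZone_mono (hL : 1 ≤ L) (hnest : Nested k Ω) (m : ℕ) : nlZone k L M₀ Ω m ⊆ nlZone k L M₀ Ω (m + 1) := by
  intro x hx hm1
  refine cuFine_mono (hnest (m + 1) (by omega) hm1) ?_ (hx (by omega))
  exact Nat.mul_le_mul_left _ (Nat.pow_le_pow_right hL (by omega))

/-- … hence zone_m ⊆ zone_{m′} for m ≤ m′. [folklore] -/
theorem nlZone_mono_le (hL : 1 ≤ L) (hnest : Nested k Ω) {m m' : ℕ} (hmm' : m ≤ m') :
    nlZone k L M₀ Ω m ⊆ nlZone k L M₀ Ω m' := by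
  obtain ⟨n, rfl⟩ := Nat.exists_eq_add_of_le hmm'
  induction n with
  | zero => exact subset_rfl
  | succ n ih => exact (ih (by omega)).trans (nlZone_mono hL hnest (m + n))

/-- L^i·(L − 1) = L^{i+1} − L^i in ℕ. [folklore] -/
theorem pow_mul_sub_one (L i : ℕ) : L ^ i * (L - 1) = L ^ (i + 1) - L ^ i := by
  rw [Nat.mul_sub_one, ← pow_succ]

/-- **The iterated climb** (L ≥ 1, M₀ ≥ 1, nesting, cube unions): a point u = L^j·a of the zone of level j reaches, for
every n with j + n ≤ k, an L^{j+n}-point v with d(u, v) ≤ d·(L^{j+n} − L^j) and |u_i − v_i| ≤ L^{j+n} − L^j in every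
coordinate, v in the zone of level j + n (n climbs of §12f, the zones increasing by §12g). [folklore] -/
theorem nl_climbTo (hL : 1 ≤ L) (hM₀ : 1 ≤ M₀) (hnest : Nested k Ω) (hcube : CubeUnions k L M₀ Ω)
    {j : ℕ} {a : Site d} (ha : scalePt (L ^ j) a ∈ nlZone k L M₀ Ω j) :
    ∀ n, j + n ≤ k → ∃ z : Site d,
      (nlGraph d k L M₀ Ω).Reachable (scalePt (L ^ j) a) (scalePt (L ^ (j + n)) z) ∧
      (nlGraph d k L M₀ Ω).dist (scalePt (L ^ j) a) (scalePt (L ^ (j + n)) z) ≤ d * (L ^ (j + n) - L ^ j) ∧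
      (∀ i, (scalePt (L ^ j) a i - scalePt (L ^ (j + n)) z i).natAbs ≤ L ^ (j + n) - L ^ j) ∧
      scalePt (L ^ (j + n)) z ∈ nlZone k L M₀ Ω (j + n) := by
  intro n
  induction n with
  | zero =>
    intro _
    exact ⟨a, SimpleGraph.Reachable.refl _, by simp, fun i => by simp, ha⟩
  | succ n ih =>
    intro hn
    rw [← Nat.add_assoc]
    obtain ⟨z, hr, hd, hc, hz⟩ := ih (by omega)
    have hcu : IsCubeUnion (M₀ * L ^ (j + n + 1)) (Ω (j + n + 1)) := hcube (j + n + 1) (by omega) (by omega)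
    obtain ⟨z', hr', hd', hc', hz'⟩ := nl_climb hL hM₀ (show j + n < k by omega) hcu hz
    have hpow1 : L ^ j ≤ L ^ (j + n) := Nat.pow_le_pow_right hL (by omega)
    have e0 : L ^ (j + n) * (L - 1) = L ^ (j + n + 1) - L ^ (j + n) := pow_mul_sub_one L (j + n)
    have hpow2 : L ^ (j + n) ≤ L ^ (j + n + 1) := Nat.pow_le_pow_right hL (by omega)
    have e1 : L ^ (j + n) * (d * (L - 1)) = d * (L ^ (j + n + 1) - L ^ (j + n)) := by rw [← e0]; ring
    refine ⟨z', hr.trans hr', ?_, fun i => ?_, nlZone_mono hL hnest _ hz'⟩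
    · have h3 := hr.dist_triangle_left (G := nlGraph d k L M₀ Ω) (scalePt (L ^ (j + n + 1)) z')
      have hd'' : (nlGraph d k L M₀ Ω).dist (scalePt (L ^ (j + n)) z) (scalePt (L ^ (j + n + 1)) z') ≤
          d * (L ^ (j + n + 1) - L ^ (j + n)) := e1 ▸ hd'
      have e2 : d * (L ^ (j + n) - L ^ j) + d * (L ^ (j + n + 1) - L ^ (j + n)) = d * (L ^ (j + n + 1) - L ^ j) := by
        rw [← Nat.mul_add]
        congr 1
        omega
      calc (nlGraph d k L M₀ Ω).dist (scalePt (L ^ j) a) (scalePt (L ^ (j + n + 1)) z')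
          ≤ (nlGraph d k L M₀ Ω).dist (scalePt (L ^ j) a) (scalePt (L ^ (j + n)) z) +
            (nlGraph d k L M₀ Ω).dist (scalePt (L ^ (j + n)) z) (scalePt (L ^ (j + n + 1)) z') := h3
        _ ≤ d * (L ^ (j + n) - L ^ j) + d * (L ^ (j + n + 1) - L ^ (j + n)) := add_le_add hd hd''
        _ = d * (L ^ (j + n + 1) - L ^ j) := e2
    · have h1 := hc i
      have h2 := hc' i
      rw [e0] at h2
      omega

/-! ### 12h. Input (α) and the comparison for EVERY number of levels: climb both points to the top [folklore] -/

/-- **Input (α) and the comparison over a NESTED SEQUENCE OF CUBE UNIONS, any k** (L ≥ 1, M₀ ≥ 1; hypotheses: the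
nesting (2.1) and the big-block clause of (2.2) — NOT its separation clause): any two points u, v of the (k+1)-level
model are joined by an admissible walk, and `dist u v ≤ ‖u − v‖₁ + 4·d·(L^k − 1)` in η-units (climb both to the
L^k-lattice, §12g, and traverse it, §12e).  The additive constant depends on d, L and the NUMBER OF LEVELS k; §12i
removes the dependence on k inside the window of (2.66). [folklore] -/
theorem nl_reachable_dist (hL : 1 ≤ L) (hM₀ : 1 ≤ M₀) (hnest : Nested k Ω) (hcube : CubeUnions k L M₀ Ω)
    {u v : Site d} (hu : u ∈ nlPts d k L M₀ Ω) (hv : v ∈ nlPts d k L M₀ Ω) :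
    (nlGraph d k L M₀ Ω).Reachable u v ∧ (nlGraph d k L M₀ Ω).dist u v ≤ latL1Dist u v + 4 * (d * (L ^ k - 1)) := by
  obtain ⟨j, hj, ⟨a, rfl⟩, hok⟩ := hu
  obtain ⟨j', hj', ⟨a', rfl⟩, hok'⟩ := hv
  obtain ⟨z, hr, hd, hc, -⟩ := nl_climbTo hL hM₀ hnest hcube hok.2 (k - j) (by omega)
  obtain ⟨z', hr', hd', hc', -⟩ := nl_climbTo hL hM₀ hnest hcube hok'.2 (k - j') (by omega)
  have e : j + (k - j) = k := by omega
  have e' : j' + (k - j') = k := by omega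
  rw [e] at hr hd hc
  rw [e'] at hr' hd' hc'
  obtain ⟨hrt, hdt⟩ := nl_topLattice (k := k) (M₀ := M₀) (Ω := Ω) hL hM₀ z z'
  have hB : 1 ≤ L ^ j := Nat.one_le_pow _ _ hL
  have hB' : 1 ≤ L ^ j' := Nat.one_le_pow _ _ hL
  have h1 : latL1Dist (scalePt (L ^ j) a) (scalePt (L ^ k) z) ≤ d * (L ^ k - 1) :=
    latL1Dist_le_of_coord fun i => (hc i).trans (by omega)
  have h2 : latL1Dist (scalePt (L ^ j') a') (scalePt (L ^ k) z') ≤ d * (L ^ k - 1) :=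
    latL1Dist_le_of_coord fun i => (hc' i).trans (by omega)
  have hdk : d * (L ^ k - L ^ j) ≤ d * (L ^ k - 1) := Nat.mul_le_mul_left _ (by omega)
  have hdk' : d * (L ^ k - L ^ j') ≤ d * (L ^ k - 1) := Nat.mul_le_mul_left _ (by omega)
  have h5 : latL1Dist (scalePt (L ^ k) z) (scalePt (L ^ k) z') = L ^ k * latL1Dist z z' := latL1Dist_scalePt _ _ _
  have htri1 := latL1Dist_triangle (scalePt (L ^ k) z) (scalePt (L ^ j) a) (scalePt (L ^ k) z')
  have htri2 := latL1Dist_triangle (scalePt (L ^ j) a) (scalePt (L ^ j') a') (scalePt (L ^ k) z')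
  have hcomm1 := latL1Dist_comm (scalePt (L ^ j) a) (scalePt (L ^ k) z)
  have g1 := hr.dist_triangle_left (G := nlGraph d k L M₀ Ω) (scalePt (L ^ j') a')
  have g2 := hrt.dist_triangle_left (G := nlGraph d k L M₀ Ω) (scalePt (L ^ j') a')
  have g3 : (nlGraph d k L M₀ Ω).dist (scalePt (L ^ k) z') (scalePt (L ^ j') a') =
      (nlGraph d k L M₀ Ω).dist (scalePt (L ^ j') a') (scalePt (L ^ k) z') := SimpleGraph.dist_comm
  exact ⟨hr.trans (hrt.trans hr'.symm), by omega⟩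

/-! ### 12i. Inside the window of (2.66): a constant INDEPENDENT OF THE NUMBER OF LEVELS [folklore] -/

/-- **Re-levelling** (nesting; L ≥ 1): a model point y″ of a level i′ ≥ i + 2 lying within sup-distance W of a point y of
the zone of level i is also a point OF LEVEL i + 1, provided M₀L^{i+1} + W ≤ M₀L^{i+2} (y″ is an L^{i+1}-lattice point
of Ω_{i′} ⊆ Ω_{i+1}, and the witness w ∉ Ω_{i+1} ⊆ Ω_{i+2} of y is within W + M₀L^{i+1} of y″). [folklore] -/
theorem nl_relevel (hnest : Nested k Ω) {i i' : ℕ} (hii' : i + 2 ≤ i') (hi'k : i' ≤ k) {W : ℕ}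
    (hgrow : M₀ * L ^ (i + 1) + W ≤ M₀ * L ^ (i + 2)) {y y'' : Site d}
    (hy : y ∈ nlZone k L M₀ Ω i) (hy'' : y'' ∈ nlPtsAt k L M₀ Ω i') (hW : supDist y y'' ≤ W) :
    y'' ∈ nlPtsAt k L M₀ Ω (i + 1) := by
  obtain ⟨⟨a'', rfl⟩, hΩ'', -⟩ := hy''
  refine ⟨⟨scalePt (L ^ (i' - (i + 1))) a'', ?_⟩, fun _ => ?_, fun hik => ?_⟩
  · rw [scalePt_scalePt, ← pow_add, show i + 1 + (i' - (i + 1)) = i' by omega]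
  · exact hnest.subset (by omega) (by omega : i + 1 ≤ i') hi'k (hΩ'' (by omega))
  · obtain ⟨w, hw, hyw⟩ := hy (by omega)
    refine ⟨w, fun h => hw (hnest (i + 1) (by omega) hik h), ?_⟩
    calc supDist (scalePt (L ^ i') a'') w ≤ supDist (scalePt (L ^ i') a'') y + supDist y w := supDist_triangle _ _ _
      _ ≤ W + M₀ * L ^ (i + 1) := add_le_add (by rwa [supDist_comm]) hyw
      _ ≤ M₀ * L ^ (i + 1 + 1) := by rw [add_comm]; exact hgrow

/-- Window pairs, CASE y″ FINER (levels i′ < i ≤ k; nesting, cube unions, L ≥ 1, M₀ ≥ 1): if ‖y − y″‖_∞ ≤ W and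
(for i < k) M₀L^i + L^i + W ≤ M₀L^{i+1}, then d(y, y″) ≤ ‖y − y″‖₁ + 2d(L^i − L^{i′}) — climb y″ to the L^i-lattice
(§12g) and join at level i through a box every L^i-point of which is within M₀L^{i′+1} + L^i + W ≤ M₀L^{i+1} of the
witness of y″ outside Ω_{i′+1} ⊆ Ω_{i+1}^c … i.e. in the zone of level i (§12e). [folklore] -/
theorem nl_cmp_finer (hL : 1 ≤ L) (hM₀ : 1 ≤ M₀) (hnest : Nested k Ω) (hcube : CubeUnions k L M₀ Ω)
    {i i' : ℕ} (hi'i : i' < i) (hik : i ≤ k) {W : ℕ} (h1 : i < k → M₀ * L ^ i + L ^ i + W ≤ M₀ * L ^ (i + 1))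
    {y y'' : Site d} (hy : y ∈ nlPtsAt k L M₀ Ω i) (hy'' : y'' ∈ nlPtsAt k L M₀ Ω i') (hW : supDist y y'' ≤ W) :
    (nlGraph d k L M₀ Ω).Reachable y y'' ∧
      (nlGraph d k L M₀ Ω).dist y y'' ≤ latL1Dist y y'' + 2 * (d * (L ^ i - L ^ i')) := by
  obtain ⟨⟨a, rfl⟩, -, hyz⟩ := hy
  obtain ⟨⟨a'', rfl⟩, -, hyz''⟩ := hy''
  obtain ⟨z, hr, hd, hc, -⟩ := nl_climbTo hL hM₀ hnest hcube hyz'' (i - i') (by omega)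
  have e : i' + (i - i') = i := by omega
  rw [e] at hr hd hc
  -- the box between z and a at level i lies in the zone of level i
  have hbox : ∀ b ∈ cbox z a, scalePt (L ^ i) b ∈ nlZone k L M₀ Ω i := by
    intro b hb hik'
    obtain ⟨w, hw, hyw⟩ := hyz'' (by omega)
    refine ⟨w, fun h => hw (hnest.subset (by omega) (by omega : i' + 1 ≤ i + 1) (by omega) h), ?_⟩
    have hxbox : scalePt (L ^ i) b ∈ cbox (scalePt (L ^ i) z) (scalePt (L ^ i) a) := scalePt_mem_cbox _ hb
    have hxy'' : supDist (scalePt (L ^ i) b) (scalePt (L ^ i') a'') ≤ L ^ i - L ^ i' + W := by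
      refine supDist_le_iff.2 fun c => ?_
      have h3 := natAbs_sub_le_of_mem_cbox hxbox (scalePt (L ^ i') a'' c) c
      have h4 := hc c
      have h5 : (scalePt (L ^ i) a c - scalePt (L ^ i') a'' c).natAbs ≤ W :=
        (natAbs_sub_le_supDist _ _ c).trans hW
      omega
    have hpow : M₀ * L ^ (i' + 1) ≤ M₀ * L ^ i := Nat.mul_le_mul_left _ (Nat.pow_le_pow_right hL (by omega))
    have h6 := h1 hik'
    calc supDist (scalePt (L ^ i) b) w ≤ supDist (scalePt (L ^ i) b) (scalePt (L ^ i') a'') +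
          supDist (scalePt (L ^ i') a'') w := supDist_triangle _ _ _
      _ ≤ (L ^ i - L ^ i' + W) + M₀ * L ^ (i' + 1) := add_le_add hxy'' hyw
      _ ≤ M₀ * L ^ (i + 1) := by omega
  obtain ⟨hrl, hdl⟩ := nl_lattice hL hM₀ hik hbox
  have h5 : L ^ i * latL1Dist z a = latL1Dist (scalePt (L ^ i) z) (scalePt (L ^ i) a) := (latL1Dist_scalePt _ _ _).symm
  have htri := latL1Dist_triangle (scalePt (L ^ i) z) (scalePt (L ^ i') a'') (scalePt (L ^ i) a)
  have hcz : latL1Dist (scalePt (L ^ i') a'') (scalePt (L ^ i) z) ≤ d * (L ^ i - L ^ i') := latL1Dist_le_of_coord hc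
  have hcomm1 := latL1Dist_comm (scalePt (L ^ i') a'') (scalePt (L ^ i) z)
  have hcomm2 := latL1Dist_comm (scalePt (L ^ i') a'') (scalePt (L ^ i) a)
  have g1 := hrl.symm.dist_triangle_left (G := nlGraph d k L M₀ Ω) (scalePt (L ^ i') a'')
  have g2 : (nlGraph d k L M₀ Ω).dist (scalePt (L ^ i) a) (scalePt (L ^ i) z) =
      (nlGraph d k L M₀ Ω).dist (scalePt (L ^ i) z) (scalePt (L ^ i) a) := SimpleGraph.dist_comm
  have g3 : (nlGraph d k L M₀ Ω).dist (scalePt (L ^ i) z) (scalePt (L ^ i') a'') =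
      (nlGraph d k L M₀ Ω).dist (scalePt (L ^ i') a'') (scalePt (L ^ i) z) := SimpleGraph.dist_comm
  exact ⟨hrl.symm.trans hr.symm, by omega⟩

/-- Window pairs, CASE SAME LEVEL (i ≤ k; nesting, cube unions, L ≥ 1, M₀ ≥ 1): if ‖y − y″‖_∞ ≤ W and (for i + 1 < k)
M₀L^{i+1} + L^{i+1} + W ≤ M₀L^{i+2}, then d(y, y″) ≤ ‖y − y″‖₁ + 4d(L^{i+1} − L^i) — at the top level the lattice
itself (§12e); below it, climb both points once (§12f) and join at level i + 1 through a box every L^{i+1}-point of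
which is within M₀L^{i+1} + (L^{i+1} − L^i) + W ≤ M₀L^{i+2} of the witness of y outside Ω_{i+1} ⊆ Ω_{i+2}^c … i.e. in
the zone of level i + 1.  For i = 0 the constant is the two-level 4d(L − 1) of `…cu_reachable_dist`. [folklore] -/
theorem nl_cmp_same (hL : 1 ≤ L) (hM₀ : 1 ≤ M₀) (hnest : Nested k Ω) (hcube : CubeUnions k L M₀ Ω)
    {i : ℕ} (hik : i ≤ k) {W : ℕ} (h2 : i + 1 < k → M₀ * L ^ (i + 1) + L ^ (i + 1) + W ≤ M₀ * L ^ (i + 2))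
    {y y'' : Site d} (hy : y ∈ nlPtsAt k L M₀ Ω i) (hy'' : y'' ∈ nlPtsAt k L M₀ Ω i) (hW : supDist y y'' ≤ W) :
    (nlGraph d k L M₀ Ω).Reachable y y'' ∧
      (nlGraph d k L M₀ Ω).dist y y'' ≤ latL1Dist y y'' + 4 * (d * (L ^ (i + 1) - L ^ i)) := by
  obtain ⟨⟨a, rfl⟩, -, hyz⟩ := hy
  obtain ⟨⟨a'', rfl⟩, -, hyz''⟩ := hy''
  rcases Nat.lt_or_ge i k with hlt | hge
  · -- below the top: climb both once and join at level i + 1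
    have hcu : IsCubeUnion (M₀ * L ^ (i + 1)) (Ω (i + 1)) := hcube (i + 1) (by omega) (by omega)
    obtain ⟨z, hr, hd, hc, -⟩ := nl_climb hL hM₀ hlt hcu hyz
    obtain ⟨z'', hr'', hd'', hc'', -⟩ := nl_climb hL hM₀ hlt hcu hyz''
    have e0 : L ^ i * (L - 1) = L ^ (i + 1) - L ^ i := pow_mul_sub_one L i
    have e1 : L ^ i * (d * (L - 1)) = d * (L ^ (i + 1) - L ^ i) := by rw [← e0]; ring
    rw [e1] at hd hd''
    have hbox : ∀ b ∈ cbox z z'', scalePt (L ^ (i + 1)) b ∈ nlZone k L M₀ Ω (i + 1) := by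
      intro b hb hik'
      obtain ⟨w, hw, hyw⟩ := hyz hlt
      refine ⟨w, fun h => hw (hnest (i + 1) (by omega) hik' h), ?_⟩
      have hxbox : scalePt (L ^ (i + 1)) b ∈ cbox (scalePt (L ^ (i + 1)) z) (scalePt (L ^ (i + 1)) z'') :=
        scalePt_mem_cbox _ hb
      have hxy : supDist (scalePt (L ^ (i + 1)) b) (scalePt (L ^ i) a) ≤ L ^ i * (L - 1) + W := by
        refine supDist_le_iff.2 fun c => ?_
        have h3 := natAbs_sub_le_of_mem_cbox hxbox (scalePt (L ^ i) a c) c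
        have h4 := hc c
        have h5 := hc'' c
        have h6 : (scalePt (L ^ i) a c - scalePt (L ^ i) a'' c).natAbs ≤ W := (natAbs_sub_le_supDist _ _ c).trans hW
        omega
      have h7 := h2 hik'
      have h8 : L ^ i ≤ L ^ (i + 1) := Nat.pow_le_pow_right hL (by omega)
      calc supDist (scalePt (L ^ (i + 1)) b) w
          ≤ supDist (scalePt (L ^ (i + 1)) b) (scalePt (L ^ i) a) + supDist (scalePt (L ^ i) a) w :=
            supDist_triangle _ _ _
        _ ≤ (L ^ i * (L - 1) + W) + M₀ * L ^ (i + 1) := add_le_add hxy hyw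
        _ ≤ M₀ * L ^ (i + 1 + 1) := by
          rw [e0]
          have h7' : M₀ * L ^ (i + 1) + L ^ (i + 1) + W ≤ M₀ * L ^ (i + 1 + 1) := h7
          omega
    obtain ⟨hrl, hdl⟩ := nl_lattice hL hM₀ (by omega : i + 1 ≤ k) hbox
    have h5 : L ^ (i + 1) * latL1Dist z z'' = latL1Dist (scalePt (L ^ (i + 1)) z) (scalePt (L ^ (i + 1)) z'') :=
      (latL1Dist_scalePt _ _ _).symm
    have hcz : latL1Dist (scalePt (L ^ i) a) (scalePt (L ^ (i + 1)) z) ≤ d * (L ^ (i + 1) - L ^ i) :=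
      latL1Dist_le_of_coord fun c => (hc c).trans e0.le
    have hcz'' : latL1Dist (scalePt (L ^ i) a'') (scalePt (L ^ (i + 1)) z'') ≤ d * (L ^ (i + 1) - L ^ i) :=
      latL1Dist_le_of_coord fun c => (hc'' c).trans e0.le
    have htri1 := latL1Dist_triangle (scalePt (L ^ (i + 1)) z) (scalePt (L ^ i) a) (scalePt (L ^ (i + 1)) z'')
    have htri2 := latL1Dist_triangle (scalePt (L ^ i) a) (scalePt (L ^ i) a'') (scalePt (L ^ (i + 1)) z'')
    have hcomm1 := latL1Dist_comm (scalePt (L ^ i) a) (scalePt (L ^ (i + 1)) z)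
    have g1 := hr.dist_triangle_left (G := nlGraph d k L M₀ Ω) (scalePt (L ^ i) a'')
    have g2 := hrl.dist_triangle_left (G := nlGraph d k L M₀ Ω) (scalePt (L ^ i) a'')
    have g3 : (nlGraph d k L M₀ Ω).dist (scalePt (L ^ (i + 1)) z'') (scalePt (L ^ i) a'') =
        (nlGraph d k L M₀ Ω).dist (scalePt (L ^ i) a'') (scalePt (L ^ (i + 1)) z'') := SimpleGraph.dist_comm
    exact ⟨hr.trans (hrl.trans hr''.symm), by omega⟩
  · -- at the top: the L^k-lattice itself
    have hik' : i = k := le_antisymm hik hge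
    subst hik'
    obtain ⟨hrt, hdt⟩ := nl_topLattice (k := i) (M₀ := M₀) (Ω := Ω) hL hM₀ a a''
    have h5 : latL1Dist (scalePt (L ^ i) a) (scalePt (L ^ i) a'') = L ^ i * latL1Dist a a'' := latL1Dist_scalePt _ _ _
    exact ⟨hrt, by omega⟩

/-- Window pairs, CASE y″ ONE LEVEL COARSER (levels i, i + 1 ≤ k; nesting, cube unions, L ≥ 1, M₀ ≥ 1): if
‖y − y″‖_∞ ≤ W and (for i + 1 < k) M₀L^{i+1} + L^{i+1} + W ≤ M₀L^{i+2}, then d(y, y″) ≤ ‖y − y″‖₁ + 2d(L^{i+1} − L^i)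
— climb y once and join at level i + 1 as in `nl_cmp_same`. [folklore] -/
theorem nl_cmp_coarser (hL : 1 ≤ L) (hM₀ : 1 ≤ M₀) (hnest : Nested k Ω) (hcube : CubeUnions k L M₀ Ω)
    {i : ℕ} (hik : i + 1 ≤ k) {W : ℕ} (h2 : i + 1 < k → M₀ * L ^ (i + 1) + L ^ (i + 1) + W ≤ M₀ * L ^ (i + 2))
    {y y'' : Site d} (hy : y ∈ nlPtsAt k L M₀ Ω i) (hy'' : y'' ∈ nlPtsAt k L M₀ Ω (i + 1))
    (hW : supDist y y'' ≤ W) :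
    (nlGraph d k L M₀ Ω).Reachable y y'' ∧
      (nlGraph d k L M₀ Ω).dist y y'' ≤ latL1Dist y y'' + 2 * (d * (L ^ (i + 1) - L ^ i)) := by
  obtain ⟨⟨a, rfl⟩, -, hyz⟩ := hy
  obtain ⟨⟨a'', rfl⟩, -, -⟩ := hy''
  have hlt : i < k := by omega
  have hcu : IsCubeUnion (M₀ * L ^ (i + 1)) (Ω (i + 1)) := hcube (i + 1) (by omega) (by omega)
  obtain ⟨z, hr, hd, hc, -⟩ := nl_climb hL hM₀ hlt hcu hyz
  have e0 : L ^ i * (L - 1) = L ^ (i + 1) - L ^ i := pow_mul_sub_one L i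
  have e1 : L ^ i * (d * (L - 1)) = d * (L ^ (i + 1) - L ^ i) := by rw [← e0]; ring
  rw [e1] at hd
  have hbox : ∀ b ∈ cbox z a'', scalePt (L ^ (i + 1)) b ∈ nlZone k L M₀ Ω (i + 1) := by
    intro b hb hik'
    obtain ⟨w, hw, hyw⟩ := hyz hlt
    refine ⟨w, fun h => hw (hnest (i + 1) (by omega) hik' h), ?_⟩
    have hxbox : scalePt (L ^ (i + 1)) b ∈ cbox (scalePt (L ^ (i + 1)) z) (scalePt (L ^ (i + 1)) a'') :=
      scalePt_mem_cbox _ hb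
    have hxy : supDist (scalePt (L ^ (i + 1)) b) (scalePt (L ^ i) a) ≤ L ^ i * (L - 1) + W := by
      refine supDist_le_iff.2 fun c => ?_
      have h3 := natAbs_sub_le_of_mem_cbox hxbox (scalePt (L ^ i) a c) c
      have h4 := hc c
      have h6 : (scalePt (L ^ i) a c - scalePt (L ^ (i + 1)) a'' c).natAbs ≤ W :=
        (natAbs_sub_le_supDist _ _ c).trans hW
      omega
    have h7 := h2 hik'
    have h8 : L ^ i ≤ L ^ (i + 1) := Nat.pow_le_pow_right hL (by omega)
    calc supDist (scalePt (L ^ (i + 1)) b) w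
        ≤ supDist (scalePt (L ^ (i + 1)) b) (scalePt (L ^ i) a) + supDist (scalePt (L ^ i) a) w :=
          supDist_triangle _ _ _
      _ ≤ (L ^ i * (L - 1) + W) + M₀ * L ^ (i + 1) := add_le_add hxy hyw
      _ ≤ M₀ * L ^ (i + 1 + 1) := by
        rw [e0]
        have h7' : M₀ * L ^ (i + 1) + L ^ (i + 1) + W ≤ M₀ * L ^ (i + 1 + 1) := h7
        omega
  obtain ⟨hrl, hdl⟩ := nl_lattice hL hM₀ hik hbox
  have h5 : L ^ (i + 1) * latL1Dist z a'' = latL1Dist (scalePt (L ^ (i + 1)) z) (scalePt (L ^ (i + 1)) a'') :=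
    (latL1Dist_scalePt _ _ _).symm
  have hcz : latL1Dist (scalePt (L ^ i) a) (scalePt (L ^ (i + 1)) z) ≤ d * (L ^ (i + 1) - L ^ i) :=
    latL1Dist_le_of_coord fun c => (hc c).trans e0.le
  have htri1 := latL1Dist_triangle (scalePt (L ^ (i + 1)) z) (scalePt (L ^ i) a) (scalePt (L ^ (i + 1)) a'')
  have hcomm1 := latL1Dist_comm (scalePt (L ^ i) a) (scalePt (L ^ (i + 1)) z)
  have g1 := hr.dist_triangle_left (G := nlGraph d k L M₀ Ω) (scalePt (L ^ (i + 1)) a'')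
  exact ⟨hr.trans hrl, by omega⟩

/-- **The comparison INSIDE THE WINDOW with a constant independent of the number of levels** (L ≥ 1, M₀ ≥ 1, nesting,
cube unions).  Let y be a point of level i ≤ k and y″ ANY point of the model with ‖y − y″‖_∞ ≤ W, and assume the two
growth conditions (for i < k) M₀L^i + L^i + W ≤ M₀L^{i+1} and (for i + 1 < k) M₀L^{i+1} + L^{i+1} + W ≤ M₀L^{i+2} — for
the printed block sides M₀L^j and the printed window they hold as soon as L ≥ 2d + 2 (`nl_window_dist_printed`).  Then
`dist y y″ ≤ ‖y − y″‖₁ + 4·d·(L^{i+1} − 1)`: a constant depending on d, L and the level i of y, NOT on k, and for i = 0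
equal to the two-level constant 4d(L − 1) of `…B6BoxChartsCubeUnions.cu_reachable_dist` — the levels i + 2, …, k
above the pair cost nothing (a point of such a level inside the window is re-levelled to i + 1, `nl_relevel`).  The
separation clause of (2.2) is not used. [folklore] -/
theorem nl_window_dist (hL : 1 ≤ L) (hM₀ : 1 ≤ M₀) (hnest : Nested k Ω) (hcube : CubeUnions k L M₀ Ω)
    {i : ℕ} (hik : i ≤ k) {W : ℕ} (h1 : i < k → M₀ * L ^ i + L ^ i + W ≤ M₀ * L ^ (i + 1))
    (h2 : i + 1 < k → M₀ * L ^ (i + 1) + L ^ (i + 1) + W ≤ M₀ * L ^ (i + 2))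
    {y y'' : Site d} (hy : y ∈ nlPtsAt k L M₀ Ω i) (hy'' : y'' ∈ nlPts d k L M₀ Ω) (hW : supDist y y'' ≤ W) :
    (nlGraph d k L M₀ Ω).Reachable y y'' ∧
      (nlGraph d k L M₀ Ω).dist y y'' ≤ latL1Dist y y'' + 4 * (d * (L ^ (i + 1) - 1)) := by
  obtain ⟨i', hi'k, hy''⟩ := hy''
  have hpi : 1 ≤ L ^ i := Nat.one_le_pow _ _ hL
  have hpi' : 1 ≤ L ^ i' := Nat.one_le_pow _ _ hL
  have hpii : L ^ i ≤ L ^ (i + 1) := Nat.pow_le_pow_right hL (by omega)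
  have hK : d * (L ^ (i + 1) - L ^ i) ≤ d * (L ^ (i + 1) - 1) := Nat.mul_le_mul_left _ (by omega)
  rcases Nat.lt_trichotomy i' i with hlt | rfl | hgt
  · obtain ⟨hr, hdd⟩ := nl_cmp_finer hL hM₀ hnest hcube hlt hik h1 hy hy'' hW
    have hK' : d * (L ^ i - L ^ i') ≤ d * (L ^ (i + 1) - 1) := Nat.mul_le_mul_left _ (by omega)
    exact ⟨hr, by omega⟩
  · obtain ⟨hr, hdd⟩ := nl_cmp_same hL hM₀ hnest hcube hik h2 hy hy'' hW
    exact ⟨hr, by omega⟩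
  · have hy''1 : y'' ∈ nlPtsAt k L M₀ Ω (i + 1) := by
      rcases Nat.lt_or_ge i' (i + 2) with h | h
      · have : i' = i + 1 := by omega
        subst this
        exact hy''
      · exact nl_relevel hnest h hi'k (by have := h2 (by omega); omega) (nlZone_of_nlPtsAt hy) hy'' hW
    obtain ⟨hr, hdd⟩ := nl_cmp_coarser hL hM₀ hnest hcube (by omega : i + 1 ≤ k) h2 hy hy''1 hW
    exact ⟨hr, by omega⟩

/-! ### 12j. The printed window and the sums of (2.66) [folklore] -/

/-- Growth condition 1 for the printed block sides and window: M₀L^i + L^i + 2dM₀L^i ≤ M₀L^{i+1} as soon as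
L ≥ 2d + 2, M₀ ≥ 1. [folklore] -/
theorem grow_printed₁ (hL : 2 * d + 2 ≤ L) (hM₀ : 1 ≤ M₀) (i : ℕ) :
    M₀ * L ^ i + L ^ i + 2 * d * M₀ * L ^ i ≤ M₀ * L ^ (i + 1) := by
  have h : M₀ + 1 + 2 * d * M₀ ≤ M₀ * L := by
    have h1 := Nat.mul_le_mul_left M₀ hL
    nlinarith
  calc M₀ * L ^ i + L ^ i + 2 * d * M₀ * L ^ i = L ^ i * (M₀ + 1 + 2 * d * M₀) := by ring
    _ ≤ L ^ i * (M₀ * L) := Nat.mul_le_mul_left _ h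
    _ = M₀ * L ^ (i + 1) := by rw [pow_succ]; ring

/-- Growth condition 2 for the printed block sides and window: M₀L^{i+1} + L^{i+1} + 2dM₀L^i ≤ M₀L^{i+2} as soon as
L ≥ 2d + 2, M₀ ≥ 1. [folklore] -/
theorem grow_printed₂ (hL : 2 * d + 2 ≤ L) (hM₀ : 1 ≤ M₀) (i : ℕ) :
    M₀ * L ^ (i + 1) + L ^ (i + 1) + 2 * d * M₀ * L ^ i ≤ M₀ * L ^ (i + 2) := by
  have h : M₀ * L + L + 2 * d * M₀ ≤ M₀ * L * L := by
    have h1 := Nat.mul_le_mul_left (M₀ * L) hL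
    have h2 : L ≤ M₀ * L := Nat.le_mul_of_pos_left L hM₀
    have h3 : 2 * d * M₀ ≤ 2 * d * M₀ * L := Nat.le_mul_of_pos_right _ (by omega)
    nlinarith
  calc M₀ * L ^ (i + 1) + L ^ (i + 1) + 2 * d * M₀ * L ^ i = L ^ i * (M₀ * L + L + 2 * d * M₀) := by
        rw [pow_succ]; ring
    _ ≤ L ^ i * (M₀ * L * L) := Nat.mul_le_mul_left _ h
    _ = M₀ * L ^ (i + 2) := by rw [pow_succ, pow_succ]; ring

/-- **The comparison inside the PRINTED window** (L ≥ 2d + 2, M₀ ≥ 1, nesting, cube unions): for a point y of level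
i ≤ k and any model point y″ with ‖y − y″‖_∞ ≤ 2dM₀·L^i — this contains the window (L^iη)^{−1}|y − y″| ≤ 2dM of
(2.66) p. 234 for y ∈ Λ_i (quoted in the parent; M ↔ M₀, ℓ¹ in η-units ≤ 2dM₀L^i, and ‖·‖_∞ ≤ ‖·‖₁) —
`dist y y″ ≤ ‖y − y″‖₁ + 4·d·(L^{i+1} − 1)`, whatever the number k ≥ i of levels. [folklore] -/
theorem nl_window_dist_printed (hL : 2 * d + 2 ≤ L) (hM₀ : 1 ≤ M₀) (hnest : Nested k Ω) (hcube : CubeUnions k L M₀ Ω)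
    {i : ℕ} (hik : i ≤ k) {y y'' : Site d} (hy : y ∈ nlPtsAt k L M₀ Ω i) (hy'' : y'' ∈ nlPts d k L M₀ Ω)
    (hW : supDist y y'' ≤ 2 * d * M₀ * L ^ i) :
    (nlGraph d k L M₀ Ω).Reachable y y'' ∧
      (nlGraph d k L M₀ Ω).dist y y'' ≤ latL1Dist y y'' + 4 * (d * (L ^ (i + 1) - 1)) :=
  nl_window_dist (by omega) hM₀ hnest hcube hik (fun _ => grow_printed₁ hL hM₀ i) (fun _ => grow_printed₂ hL hM₀ i)
    hy hy'' hW

/-- **The last «≤» of (2.66) over a nested sequence of cube unions, GLOBAL form** (δ₀ > 0; L ≥ 1, M₀ ≥ 1, nesting, cube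
unions; y ∈ T, finite S ⊆ T; weights e^{−δ₀‖y − y″‖₁} in η-units): Σ_{y″∈S} e^{−δ₀‖y − y″‖₁}·e^{−½δ₀·d(y″,y′)} ≤
e^{½δ₀·4d(L^k − 1)}·c₀(δ₀, ½)^d·e^{−½δ₀·d(y,y′)} — a constant depending on d, L, δ₀ AND THE NUMBER OF LEVELS k,
uniform in M₀ and in the domains. [folklore] -/
theorem nl_sum266_le (hL : 1 ≤ L) (hM₀ : 1 ≤ M₀) (hnest : Nested k Ω) (hcube : CubeUnions k L M₀ Ω) {δ₀ : ℝ}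
    (hδ : 0 < δ₀) {y : Site d} (hy : y ∈ nlPts d k L M₀ Ω) (y' : Site d) (S : Finset (Site d))
    (hS : ∀ y'' ∈ S, y'' ∈ nlPts d k L M₀ Ω) :
    ∑ y'' ∈ S, Real.exp (-(δ₀ * (latL1Dist y y'' : ℝ))) *
        Real.exp (-(δ₀ / 2 * ((nlGraph d k L M₀ Ω).dist y'' y' : ℝ))) ≤
      Real.exp (δ₀ / 2 * (4 * (d * ((L : ℝ) ^ k - 1)))) * B6.c0 δ₀ (1 / 2) ^ d *
        Real.exp (-(δ₀ / 2 * ((nlGraph d k L M₀ Ω).dist y y' : ℝ))) := by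
  have hL1 : ((L ^ k - 1 : ℕ) : ℝ) = (L : ℝ) ^ k - 1 := by
    rw [Nat.cast_sub (Nat.one_le_pow _ _ hL), Nat.cast_pow, Nat.cast_one]
  have hK : ((4 * (d * (L ^ k - 1)) : ℕ) : ℝ) = 4 * (d * ((L : ℝ) ^ k - 1)) := by rw [← hL1]; norm_cast
  rw [← hK]
  exact sum266_le_of_cmp hδ y' S (fun y'' hy'' => (nl_reachable_dist hL hM₀ hnest hcube hy (hS y'' hy'')).1)
    (fun y'' hy'' => (nl_reachable_dist hL hM₀ hnest hcube hy (hS y'' hy'')).2)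

/-- **The last «≤» of (2.66) over a nested sequence of cube unions, WINDOWED form with a constant INDEPENDENT OF THE
NUMBER OF LEVELS** (δ₀ > 0; L ≥ 2d + 2, M₀ ≥ 1, nesting, cube unions; y a point of level i ≤ k, finite S ⊆ T inside
the printed window ‖y − y″‖_∞ ≤ 2dM₀L^i): Σ_{y″∈S} e^{−δ₀‖y − y″‖₁}·e^{−½δ₀·d(y″,y′)} ≤ e^{½δ₀·4d(L^{i+1} − 1)}·
c₀(δ₀, ½)^d·e^{−½δ₀·d(y,y′)} — uniform in k ≥ i, in M₀ and in the domains; at i = 0 the two-level constant of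
`…cu_sum266_le`. [folklore] -/
theorem nl_sum266_window_le (hL : 2 * d + 2 ≤ L) (hM₀ : 1 ≤ M₀) (hnest : Nested k Ω) (hcube : CubeUnions k L M₀ Ω)
    {δ₀ : ℝ} (hδ : 0 < δ₀) {i : ℕ} (hik : i ≤ k) {y : Site d} (hy : y ∈ nlPtsAt k L M₀ Ω i) (y' : Site d)
    (S : Finset (Site d)) (hS : ∀ y'' ∈ S, y'' ∈ nlPts d k L M₀ Ω ∧ supDist y y'' ≤ 2 * d * M₀ * L ^ i) :
    ∑ y'' ∈ S, Real.exp (-(δ₀ * (latL1Dist y y'' : ℝ))) *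
        Real.exp (-(δ₀ / 2 * ((nlGraph d k L M₀ Ω).dist y'' y' : ℝ))) ≤
      Real.exp (δ₀ / 2 * (4 * (d * ((L : ℝ) ^ (i + 1) - 1)))) * B6.c0 δ₀ (1 / 2) ^ d *
        Real.exp (-(δ₀ / 2 * ((nlGraph d k L M₀ Ω).dist y y' : ℝ))) := by
  have hL' : 1 ≤ L := by omega
  have hL1 : ((L ^ (i + 1) - 1 : ℕ) : ℝ) = (L : ℝ) ^ (i + 1) - 1 := by
    rw [Nat.cast_sub (Nat.one_le_pow _ _ hL'), Nat.cast_pow, Nat.cast_one]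
  have hK : ((4 * (d * (L ^ (i + 1) - 1)) : ℕ) : ℝ) = 4 * (d * ((L : ℝ) ^ (i + 1) - 1)) := by rw [← hL1]; norm_cast
  rw [← hK]
  exact sum266_le_of_cmp hδ y' S
    (fun y'' hy'' => (nl_window_dist_printed hL hM₀ hnest hcube hik hy (hS y'' hy'').1 (hS y'' hy'').2).1)
    (fun y'' hy'' => (nl_window_dist_printed hL hM₀ hnest hcube hik hy (hS y'' hy'').1 (hS y'' hy'').2).2)

/-! ### 12k. Sanity: every point of the top lattice is a point of the model [folklore] -/

/-- Every L^k-lattice point is a point of the model (of the largest level j ≤ k with L^k·z ∈ Ω_j, or of level 0):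
the top lattice used in §12h is part of T, not an external device. [folklore] -/
theorem scalePt_top_mem_nlPts (z : Site d) : scalePt (L ^ k) z ∈ nlPts d k L M₀ Ω := by
  classical
  -- the largest level j ≤ k such that L^k z ∈ Ω_m for all 1 ≤ m ≤ j... we use Nat.findGreatest on "x ∈ Ω j ∨ j = 0"
  set x := scalePt (L ^ k) z with hx
  let P : ℕ → Prop := fun j => j = 0 ∨ x ∈ Ω j
  have hP0 : P 0 := Or.inl rfl
  set j := Nat.findGreatest P k with hj
  have hjk : j ≤ k := Nat.findGreatest_le k
  have hPj : P j := Nat.findGreatest_spec (P := P) (Nat.zero_le k) hP0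
  have habove : ∀ m, j < m → m ≤ k → ¬ P m := fun m hjm hmk => Nat.findGreatest_is_greatest hjm hmk
  refine ⟨j, hjk, ⟨scalePt (L ^ (k - j)) z, ?_⟩, fun h1 => ?_, fun hlt => ?_⟩
  · rw [scalePt_scalePt, ← pow_add, Nat.add_sub_cancel' hjk]
  · exact hPj.resolve_left (by omega)
  · -- zone: x ∉ Ω (j+1), and supDist x x = 0
    refine ⟨x, fun h => habove (j + 1) (by omega) (by omega) (Or.inr h), ?_⟩
    rw [supDist_self]
    exact Nat.zero_le _

/-! ### 12l. With the SEPARATION clause of (2.2): only the three levels i − 1, i, i + 1 meet the window [folklore] -/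

/-- The SEPARATION clause of (2.2) p. 224, *"(L^jη)^{−1} dist(Ω_j^c, Ω_{j+1}) > RM"* (quoted in the sibling
`…B6LevelGapMetric`), in the model's η-units and Bałaban's ℓ¹ distance of p. 223: every η-point outside Ω_j and every
η-point of Ω_{j+1} are more than R·M₀L^j apart, for 1 ≤ j < k (R ∈ ℕ).  A hypothesis, never asserted; it is used ONLY
in this §12l and in §13d–e — nowhere in §§12a–12k, 12m, 13a–c. [folklore] -/
def L1Sep (k L M₀ R : ℕ) (Ω : ℕ → Set (Site d)) : Prop :=
  ∀ j, 1 ≤ j → j < k → ∀ ⦃x x' : Site d⦄, x ∉ Ω j → x' ∈ Ω (j + 1) → R * (M₀ * L ^ j) < latL1Dist x x'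

/-- **Three levels in the window** (L ≥ 1, nesting (2.1), separation clause of (2.2) with the integer R): if y is a
point of level i, y″ a point of level i′ and ‖y − y″‖_∞ ≤ W, then i − 1 ≤ i′ ≤ i + 1 as soon as
d·(M₀L^{i−1} + W) ≤ R·M₀L^{i−1} (needed when i ≥ 2) and d·(M₀L^{i+1} + W) ≤ R·M₀L^{i+1} (needed when i + 2 ≤ k): a point
of level ≤ i − 2 is within M₀L^{i−1} of Ω_{i−1}^c, which is more than R·M₀L^{i−1} from Ω_i ∋ y in ℓ¹, hence more than
R·M₀L^{i−1}/d in ℓ^∞; a point of level ≥ i + 2 lies in Ω_{i+2}, more than R·M₀L^{i+1} from the witness w ∉ Ω_{i+1} of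
y, ‖y − w‖_∞ ≤ M₀L^{i+1}. [folklore] -/
theorem nl_window_levels (hL : 1 ≤ L) (hnest : Nested k Ω) {R : ℕ} (hsep : L1Sep k L M₀ R Ω) {i i' : ℕ}
    (hik : i ≤ k) (hi'k : i' ≤ k) {W : ℕ}
    (hRlo : 2 ≤ i → d * (M₀ * L ^ (i - 1) + W) ≤ R * (M₀ * L ^ (i - 1)))
    (hRhi : i + 2 ≤ k → d * (M₀ * L ^ (i + 1) + W) ≤ R * (M₀ * L ^ (i + 1)))
    {y y'' : Site d} (hy : y ∈ nlPtsAt k L M₀ Ω i) (hy'' : y'' ∈ nlPtsAt k L M₀ Ω i') (hW : supDist y y'' ≤ W) :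
    i ≤ i' + 1 ∧ i' ≤ i + 1 := by
  obtain ⟨-, hΩy, hzy⟩ := hy
  obtain ⟨-, hΩy'', hzy''⟩ := hy''
  constructor
  · refine Nat.le_of_not_lt fun hlt => ?_
    obtain ⟨w, hw, hw''⟩ := hzy'' (by omega)
    have hwΩ : w ∉ Ω (i - 1) := fun h => hw (hnest.subset (by omega) (by omega : i' + 1 ≤ i - 1) (by omega) h)
    have hyΩ : y ∈ Ω (i - 1 + 1) := by
      rw [Nat.sub_add_cancel (by omega : 1 ≤ i)]
      exact hΩy (by omega)
    have h1 := hsep (i - 1) (by omega) (by omega) hwΩ hyΩ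
    have h2 := latL1Dist_le_mul_supDist w y
    have h3 := supDist_triangle w y'' y
    have h4 : supDist w y'' ≤ M₀ * L ^ (i' + 1) := by rw [supDist_comm]; exact hw''
    have h5 : M₀ * L ^ (i' + 1) ≤ M₀ * L ^ (i - 1) := Nat.mul_le_mul_left _ (Nat.pow_le_pow_right hL (by omega))
    have h6 : supDist y'' y ≤ W := by rw [supDist_comm]; exact hW
    have h7 := hRlo (by omega)
    have h8 : d * supDist w y ≤ d * (M₀ * L ^ (i - 1) + W) := Nat.mul_le_mul_left _ (by omega)
    omega
  · refine Nat.le_of_not_lt fun hlt => ?_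
    obtain ⟨w, hw, hyw⟩ := hzy (by omega)
    have hy''Ω : y'' ∈ Ω (i + 1 + 1) :=
      hnest.subset (by omega) (by omega : i + 1 + 1 ≤ i') hi'k (hΩy'' (by omega))
    have h1 := hsep (i + 1) (by omega) (by omega) hw hy''Ω
    have h2 := latL1Dist_le_mul_supDist w y''
    have h3 := supDist_triangle w y y''
    have h4 : supDist w y ≤ M₀ * L ^ (i + 1) := by rw [supDist_comm]; exact hyw
    have h7 := hRhi (by omega)
    have h8 : d * supDist w y'' ≤ d * (M₀ * L ^ (i + 1) + W) := Nat.mul_le_mul_left _ (by omega)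
    omega

/-- **Three levels in the PRINTED window** (L ≥ 1, nesting, separation clause with R ≥ d(2dL + 1)): a model point y″
with ‖y − y″‖_∞ ≤ 2dM₀L^i — in particular every y″ of the window (L^iη)^{−1}|y − y″| ≤ 2dM of (2.66) p. 234 (quoted in the
parent; M₀ ↔ M, ‖·‖_∞ ≤ ‖·‖₁) — of a point y of level i has level i − 1, i or i + 1: the «(2.2)-separated levels
j − 1, j, j + 1» of the located list, as a theorem of the model.  (The integer threshold d(2dL + 1) reflects the passage
ℓ¹ → ℓ^∞ → ℓ¹ of the model's sup-norm windows; no attempt at the sharp R.) [folklore] -/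
theorem nl_window_levels_printed (hL : 1 ≤ L) (hnest : Nested k Ω) {R : ℕ} (hsep : L1Sep k L M₀ R Ω)
    (hR : d * (2 * d * L + 1) ≤ R) {i i' : ℕ} (hik : i ≤ k) (hi'k : i' ≤ k) {y y'' : Site d}
    (hy : y ∈ nlPtsAt k L M₀ Ω i) (hy'' : y'' ∈ nlPtsAt k L M₀ Ω i') (hW : supDist y y'' ≤ 2 * d * M₀ * L ^ i) :
    i ≤ i' + 1 ∧ i' ≤ i + 1 := by
  refine nl_window_levels hL hnest hsep hik hi'k (fun hi2 => ?_) (fun _ => ?_) hy hy'' hW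
  · have hP : L ^ i = L ^ (i - 1) * L := by rw [← pow_succ, Nat.sub_add_cancel (by omega : 1 ≤ i)]
    rw [hP]
    calc d * (M₀ * L ^ (i - 1) + 2 * d * M₀ * (L ^ (i - 1) * L))
        = (M₀ * L ^ (i - 1)) * (d * (2 * d * L + 1)) := by ring
      _ ≤ (M₀ * L ^ (i - 1)) * R := Nat.mul_le_mul_left _ hR
      _ = R * (M₀ * L ^ (i - 1)) := by ring
  · have h1 : 2 * d ≤ 2 * d * (L * L) := Nat.le_mul_of_pos_right _ (Nat.mul_pos hL hL)
    have h2 : d * (L + 2 * d) ≤ R * L := by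
      have h3 := Nat.mul_le_mul_right L hR
      nlinarith [h1, h3]
    rw [pow_succ]
    calc d * (M₀ * (L ^ i * L) + 2 * d * M₀ * L ^ i) = (M₀ * L ^ i) * (d * (L + 2 * d)) := by ring
      _ ≤ (M₀ * L ^ i) * (R * L) := Nat.mul_le_mul_left _ h2
      _ = R * (M₀ * (L ^ i * L)) := by ring

/-! ### 12m. WITHOUT the separation clause the comparison in the LITERAL units of (2.66) is not level-uniform: the
tower of equal half-spaces [folklore] -/

/-- The tower of equal half-spaces Ω_m = {0 ≤ x_μ} at every level m: nested, a cube union of every side, and violating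
the separation clause of (2.2) as badly as possible (Ω_j^c and Ω_{j+1} are adjacent). [folklore] -/
def hsTower (μ : Fin d) : ℕ → Set (Site d) := fun _ => {x | 0 ≤ x μ}

/-- The tower is nested. [folklore] -/
theorem hsTower_nested (μ : Fin d) (k : ℕ) : Nested k (hsTower μ) := fun _ _ _ => subset_rfl

/-- The tower consists of cube unions of every side. [folklore] -/
theorem hsTower_cubeUnions (μ : Fin d) (k L M₀ : ℕ) : CubeUnions k L M₀ (hsTower μ) :=
  fun _ _ _ => isCubeUnion_halfspace _ μ

/-- Along the bonds of the model over the tower the depth (−x_μ)⁺ below Σ = {x_μ = 0} changes by at most 1: a level-0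
bond is an η-bond; a bond of level j ≥ 1 has both ends in Ω_j = {0 ≤ x_μ}, at depth 0. [folklore] -/
theorem depth_le_of_nlRel_hsTower {μ : Fin d} {u v : Site d} (h : nlRel d k L M₀ (hsTower μ) u v) :
    B6BoxCharts.depth μ u ≤ B6BoxCharts.depth μ v + 1 ∧ B6BoxCharts.depth μ v ≤ B6BoxCharts.depth μ u + 1 := by
  obtain ⟨j, -, a, a', hadj, rfl, rfl, hu, hv⟩ := h
  rcases Nat.eq_zero_or_pos j with rfl | hj
  · have hadj' : (zdGraph d).Adj (scalePt (L ^ 0) a) (scalePt (L ^ 0) a') := by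
      rwa [pow_zero, scalePt_one, scalePt_one]
    exact ⟨depth_le_of_zd_adj hadj' μ, depth_le_of_zd_adj hadj'.symm μ⟩
  · have h1 : 0 ≤ scalePt (L ^ j) a μ := hu.1 hj
    have h2 : 0 ≤ scalePt (L ^ j) a' μ := hv.1 hj
    unfold B6BoxCharts.depth
    constructor <;> omega

/-- … so the depth is 1-Lipschitz for the bond graph over the tower. [folklore] -/
theorem depth_le_of_nlGraph_hsTower_adj {μ : Fin d} {u v : Site d} (h : (nlGraph d k L M₀ (hsTower μ)).Adj u v) :
    B6BoxCharts.depth μ u ≤ B6BoxCharts.depth μ v + 1 := by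
  rw [nlGraph, SimpleGraph.fromRel_adj] at h
  rcases h.2 with h' | h'
  · exact (depth_le_of_nlRel_hsTower h').1
  · exact (depth_le_of_nlRel_hsTower h').2

/-- The origin is a point of every level i ≤ k of the model over the tower (L ≥ 1, M₀ ≥ 1). [folklore] -/
theorem zero_mem_nlPtsAt_hsTower (hL : 1 ≤ L) (hM₀ : 1 ≤ M₀) (μ : Fin d) (i : ℕ) :
    (0 : Site d) ∈ nlPtsAt k L M₀ (hsTower μ) i := by
  refine ⟨⟨0, ?_⟩, fun _ => ?_, fun _ => ⟨Pi.single μ (-1), ?_, ?_⟩⟩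
  · funext j; rw [scalePt_apply, Pi.zero_apply, mul_zero]
  · show (0 : ℤ) ≤ (0 : Site d) μ
    rw [Pi.zero_apply]
  · show ¬ ((0 : ℤ) ≤ (Pi.single μ (-1 : ℤ) : Site d) μ)
    rw [Pi.single_eq_same]
    omega
  · refine (supDist_le_iff.2 fun j => ?_).trans (Nat.mul_pos hM₀ (Nat.pow_pos hL))
    rw [Pi.zero_apply, zero_sub, Int.natAbs_neg]
    by_cases hj : j = μ
    · subst hj; rw [Pi.single_eq_same]; simp
    · rw [Pi.single_eq_of_ne hj]; simp

/-- The point −D·e_μ, D ≥ 1, is a point of level 0 of the model over the tower. [folklore] -/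
theorem negPt_mem_nlPtsAt_hsTower (μ : Fin d) {D : ℕ} (hD : 1 ≤ D) :
    Pi.single μ (-(D : ℤ)) ∈ nlPtsAt k L M₀ (hsTower μ) 0 := by
  refine ⟨⟨Pi.single μ (-(D : ℤ)), by rw [pow_zero, scalePt_one]⟩, fun h => absurd h (by omega),
    fun _ => ⟨Pi.single μ (-(D : ℤ)), ?_, by rw [supDist_self]; exact Nat.zero_le _⟩⟩
  show ¬ ((0 : ℤ) ≤ (Pi.single μ (-(D : ℤ)) : Site d) μ)
  rw [Pi.single_eq_same]
  omega

/-- **The comparison in the LITERAL units of (2.66) is not level-uniform without the separation clause** (L ≥ 1,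
M₀ ≥ 1, any k, any level i ≤ k, 1 ≤ D): over the tower of equal half-spaces — nested, cube unions, separation clause
violated — the point y = 0 OF LEVEL i and the level-0 point y″ = −D·e_μ are joined and at distance EXACTLY
D = ‖y − y″‖₁ (η-units; ≤: the D η-bonds below Σ, ≥: the 1-Lipschitz depth).  For D ≤ 2dM₀L^i the pair lies in the
printed window of y, and D = L^i·(L^iη)^{−1}|y − y″|: a comparison d(y, y″) ≤ C·(L^iη)^{−1}|y − y″| + C′ in the units of
the display therefore forces C′ ≥ 2dM₀(L^i − C) at level i — NO constants C, C′ independent of the level (equivalently,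
for the top-but-one level, of the number of levels k) exist, the obstruction being a pocket of depth i (η-bonds only)
inside the window.  The finest-unit comparison of §12i is unaffected (it holds here with its constant 4d(L^{i+1} − 1)),
and §12l shows that the separation clause of (2.2) with R ≥ d(2dL + 1) is exactly what keeps pockets of depth ≥ 2 out of
the window; the positive three-level comparison in literal units under (2.2) is NOT proved in this file. [folklore] -/
theorem hsTower_literal_witness (hL : 1 ≤ L) (hM₀ : 1 ≤ M₀) (μ : Fin d) {i : ℕ} (hik : i ≤ k) {D : ℕ} (hD : 1 ≤ D) :
    (0 : Site d) ∈ nlPtsAt k L M₀ (hsTower μ) i ∧ (0 : Site d) ∈ nlPts d k L M₀ (hsTower μ) ∧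
      Pi.single μ (-(D : ℤ)) ∈ nlPtsAt k L M₀ (hsTower μ) 0 ∧
      latL1Dist (0 : Site d) (Pi.single μ (-(D : ℤ))) = D ∧
      (nlGraph d k L M₀ (hsTower μ)).Reachable 0 (Pi.single μ (-(D : ℤ))) ∧
      (nlGraph d k L M₀ (hsTower μ)).dist 0 (Pi.single μ (-(D : ℤ))) = D := by
  have hy := zero_mem_nlPtsAt_hsTower (k := k) hL hM₀ μ i
  have hy'' := negPt_mem_nlPtsAt_hsTower (k := k) (L := L) (M₀ := M₀) μ hD
  have hl1 : latL1Dist (0 : Site d) (Pi.single μ (-(D : ℤ))) = D := by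
    unfold latL1Dist
    rw [Finset.sum_eq_single μ]
    · rw [Pi.zero_apply, Pi.single_eq_same, zero_sub, neg_neg, Int.natAbs_natCast]
    · intro j _ hj
      rw [Pi.zero_apply, Pi.single_eq_of_ne hj, sub_zero, Int.natAbs_zero]
    · intro h; exact absurd (Finset.mem_univ μ) h
  -- ≤ D: the η-segment from 0 to −D·e_μ lies in the zone of level 0 (each of its points x has x − e_μ ∉ Ω₁ at
  -- sup-distance 1 ≤ M₀L)
  have hbox : ∀ b ∈ cbox (0 : Site d) (Pi.single μ (-(D : ℤ))), scalePt (L ^ 0) b ∈ nlZone k L M₀ (hsTower μ) 0 := by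
    intro b hb _
    rw [pow_zero, scalePt_one]
    refine ⟨b + Pi.single μ (-1), ?_, ?_⟩
    · show ¬ ((0 : ℤ) ≤ (b + (Pi.single μ (-1 : ℤ) : Site d)) μ)
      have h1 := (hb μ).2
      rw [Pi.zero_apply, Pi.single_eq_same] at h1
      rw [Pi.add_apply, Pi.single_eq_same]
      have h2 : max (0 : ℤ) (-(D : ℤ)) = 0 := max_eq_left (by omega)
      omega
    · refine (supDist_le_iff.2 fun j => ?_).trans (Nat.mul_pos hM₀ (Nat.pow_pos hL))
      rw [Pi.add_apply]
      by_cases hj : j = μ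
      · subst hj; rw [Pi.single_eq_same]; simp
      · rw [Pi.single_eq_of_ne hj]; simp
  obtain ⟨hr, hd⟩ := nl_lattice (k := k) (M₀ := M₀) (Ω := hsTower μ) hL hM₀ (Nat.zero_le k) hbox
  rw [pow_zero, scalePt_one, scalePt_one, one_mul, hl1] at hd
  rw [pow_zero, scalePt_one, scalePt_one] at hr
  -- ≥ D: the depth below Σ is 1-Lipschitz
  have hge := le_add_dist_of_adj_le (B6BoxCharts.depth μ) (fun _ _ h => depth_le_of_nlGraph_hsTower_adj h) hr.symm
  have hdepth0 : B6BoxCharts.depth μ (0 : Site d) = 0 := by unfold B6BoxCharts.depth; rw [Pi.zero_apply, neg_zero, Int.toNat_zero]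
  have hdepthD : B6BoxCharts.depth μ (Pi.single μ (-(D : ℤ))) = D := by
    unfold B6BoxCharts.depth; rw [Pi.single_eq_same, neg_neg, Int.toNat_natCast]
  rw [hdepth0, hdepthD, SimpleGraph.dist_comm] at hge
  exact ⟨hy, ⟨i, hik, hy⟩, hy'', hl1, hr, le_antisymm hd (by omega)⟩

/-! ## 13. LITERAL UNITS.  Above a base level m the constructions of §12 cost L^{−m} times as many bonds, provided
they stay inside Ω_m; under the separation clause of (2.2) they do, and the comparison behind (2.66) then holds in the
units L^i of the level of y with constants independent of the level and of k [folklore model computations] -/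

/-! ### 13a. The skeleton above a base level [folklore] -/

/-- The coordinate box is symmetric. [folklore] -/
theorem cbox_comm (x y : Site d) : cbox x y = cbox y x := by
  refine Set.ext fun z => ⟨fun hz i => ?_, fun hz i => ?_⟩
  · rw [min_comm, max_comm]; exact hz i
  · rw [min_comm, max_comm]; exact hz i

/-- **The skeleton step above the base level m** (L ≥ 1, M₀ ≥ 1): a level-(m+n) lattice step, m + n ≤ k, with both
ends in the zone of level m + n and whose η-segment lies inside Ω_m (no condition when m = 0) costs at most L^n bonds:
the descents of §12d stop at level m, where every sub-step has both ends in Ω_m and is a bond.  For m = 0 this is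
`nl_step` (cost L^n in η-bonds); for m ≥ 1 the bound counts each bond once whatever its level ≥ m, as Bałaban's
|Γ| = nη does (p. 231, quoted in the parent). [folklore] -/
theorem nl_stepFrom (hL : 1 ≤ L) (hM₀ : 1 ≤ M₀) (m : ℕ) :
    ∀ (n : ℕ), m + n ≤ k → ∀ (a : Site d) (i : Fin d),
      scalePt (L ^ (m + n)) a ∈ nlZone k L M₀ Ω (m + n) →
      scalePt (L ^ (m + n)) (a + Pi.single i 1) ∈ nlZone k L M₀ Ω (m + n) →
      (1 ≤ m → cbox (scalePt (L ^ (m + n)) a) (scalePt (L ^ (m + n)) (a + Pi.single i 1)) ⊆ Ω m) →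
      (nlGraph d k L M₀ Ω).Reachable (scalePt (L ^ (m + n)) a) (scalePt (L ^ (m + n)) (a + Pi.single i 1)) ∧
        (nlGraph d k L M₀ Ω).dist (scalePt (L ^ (m + n)) a) (scalePt (L ^ (m + n)) (a + Pi.single i 1)) ≤
          L ^ n := by
  intro n
  induction n with
  | zero =>
    intro hk a i ha ha' hseg
    simp only [Nat.add_zero] at hk ha ha' hseg ⊢
    have hadj : (zdGraph d).Adj a (a + Pi.single i 1) := (zdGraph_adj_iff _ _).2 ⟨i, Or.inl rfl⟩
    have h := nlGraph_adj_of_step hL hk hadj ⟨fun hm => hseg hm (left_mem_cbox _ _), ha⟩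
      ⟨fun hm => hseg hm (right_mem_cbox _ _), ha'⟩
    refine ⟨h.reachable, ?_⟩
    rw [pow_zero]
    exact dist_le_one_of_eq_or_adj (Or.inr h)
  | succ n ih =>
    intro hk a i ha ha' hseg
    rw [← Nat.add_assoc] at hk ha ha' hseg ⊢
    have hadj : (zdGraph d).Adj a (a + Pi.single i 1) := (zdGraph_adj_iff _ _).2 ⟨i, Or.inl rfl⟩
    by_cases hΩ : scalePt (L ^ (m + n + 1)) a ∈ Ω (m + n + 1) ∧
        scalePt (L ^ (m + n + 1)) (a + Pi.single i 1) ∈ Ω (m + n + 1)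
    · have h := nlGraph_adj_of_step hL hk hadj ⟨fun _ => hΩ.1, ha⟩ ⟨fun _ => hΩ.2, ha'⟩
      exact ⟨h.reachable, (dist_le_one_of_eq_or_adj (Or.inr h)).trans (Nat.one_le_pow _ _ hL)⟩
    · have hout : ∃ c : Site d, (c = scalePt L a ∨ c = scalePt L (a + Pi.single i 1)) ∧
          scalePt (L ^ (m + n)) c ∉ Ω (m + n + 1) := by
        by_cases h1 : scalePt (L ^ (m + n + 1)) a ∈ Ω (m + n + 1)
        · refine ⟨_, Or.inr rfl, fun h2 => hΩ ⟨h1, ?_⟩⟩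
          rwa [scalePt_scalePt, ← pow_succ] at h2
        · refine ⟨_, Or.inl rfl, fun h2 => h1 ?_⟩
          rwa [scalePt_scalePt, ← pow_succ] at h2
      obtain ⟨c, hc, hcΩ⟩ := hout
      have hseg' : supDist (scalePt L a) (scalePt L (a + Pi.single i 1)) ≤ L := by
        refine supDist_le_iff.2 fun i' => ?_
        rw [scalePt_apply, scalePt_apply, Pi.add_apply]
        by_cases hi : i' = i
        · subst hi
          rw [Pi.single_eq_same]
          have h3 : (L : ℤ) * a i' - (L : ℤ) * (a i' + 1) = -(L : ℤ) := by ring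
          rw [h3, Int.natAbs_neg, Int.natAbs_natCast]
        · rw [Pi.single_eq_of_ne hi, add_zero, sub_self]
          exact Nat.zero_le _
      have hzone : ∀ b ∈ cbox (scalePt L a) (scalePt L (a + Pi.single i 1)),
          scalePt (L ^ (m + n)) b ∈ nlZone k L M₀ Ω (m + n) := by
        intro b hb _
        refine ⟨scalePt (L ^ (m + n)) c, hcΩ, ?_⟩
        have hbc : supDist b c ≤ L := by
          obtain ⟨h1, h2⟩ := supDist_le_of_mem_cbox hb
          rcases hc with rfl | rfl
          · rw [supDist_comm]; exact h1.trans hseg'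
          · exact h2.trans hseg'
        calc supDist (scalePt (L ^ (m + n)) b) (scalePt (L ^ (m + n)) c)
            ≤ L ^ (m + n) * supDist b c := supDist_scalePt_le _ _ _
          _ ≤ L ^ (m + n) * L := Nat.mul_le_mul_left _ hbc
          _ = L ^ (m + n + 1) := (pow_succ L (m + n)).symm
          _ ≤ M₀ * L ^ (m + n + 1) := Nat.le_mul_of_pos_left _ hM₀
      have hU : ∀ b ∈ cbox (scalePt L a) (scalePt L (a + Pi.single i 1)), scalePt (L ^ (m + n)) b ∈
          cbox (scalePt (L ^ (m + n + 1)) a) (scalePt (L ^ (m + n + 1)) (a + Pi.single i 1)) := by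
        intro b hb
        have h := scalePt_mem_cbox (L ^ (m + n)) hb
        rwa [scalePt_scalePt, scalePt_scalePt, ← pow_succ] at h
      have hcost := reachable_dist_of_costChart (G := nlGraph d k L M₀ Ω) (φ := scalePt (L ^ (m + n))) (c := L ^ n)
        (cboxClosed_cbox (scalePt L a) (scalePt L (a + Pi.single i 1)))
        (fun b b' hb hb' hbb' => by
          have hsub : 1 ≤ m → cbox (scalePt (L ^ (m + n)) b) (scalePt (L ^ (m + n)) b') ⊆ Ω m :=
            fun hm => (cboxClosed_cbox _ _ (hU b hb) (hU b' hb')).trans (hseg hm)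
          obtain ⟨i', h | h⟩ := (zdGraph_adj_iff b b').1 hbb'
          · rw [h] at hb' hsub ⊢
            exact ih (by omega) b i' (hzone b hb) (hzone _ hb') hsub
          · rw [h] at hb hsub
            rw [cbox_comm] at hsub
            obtain ⟨hr, hd⟩ := ih (by omega) b' i' (hzone b' hb') (hzone _ hb) hsub
            rw [← h] at hr hd
            rw [SimpleGraph.dist_comm] at hd
            exact ⟨hr.symm, hd⟩)
        (left_mem_cbox _ _) (right_mem_cbox _ _)
      rw [scalePt_scalePt, scalePt_scalePt, ← pow_succ, latL1Dist_scalePt, latL1Dist_add_single, mul_one,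
        ← pow_succ] at hcost
      exact hcost

/-- The skeleton step above the base level for an unoriented lattice step. [folklore] -/
theorem nl_stepFrom' (hL : 1 ≤ L) (hM₀ : 1 ≤ M₀) {m n j : ℕ} (hj : j = m + n) (hn : j ≤ k) {b b' : Site d}
    (h : (zdGraph d).Adj b b') (hb : scalePt (L ^ j) b ∈ nlZone k L M₀ Ω j)
    (hb' : scalePt (L ^ j) b' ∈ nlZone k L M₀ Ω j)
    (hseg : 1 ≤ m → cbox (scalePt (L ^ j) b) (scalePt (L ^ j) b') ⊆ Ω m) :
    (nlGraph d k L M₀ Ω).Reachable (scalePt (L ^ j) b) (scalePt (L ^ j) b') ∧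
      (nlGraph d k L M₀ Ω).dist (scalePt (L ^ j) b) (scalePt (L ^ j) b') ≤ L ^ n := by
  subst hj
  obtain ⟨i, hi | hi⟩ := (zdGraph_adj_iff b b').1 h
  · subst hi
    exact nl_stepFrom hL hM₀ m n hn b i hb hb' hseg
  · subst hi
    rw [cbox_comm] at hseg
    obtain ⟨hr, hd⟩ := nl_stepFrom hL hM₀ m n hn b' i hb' hb hseg
    rw [SimpleGraph.dist_comm] at hd
    exact ⟨hr.symm, hd⟩

/-! ### 13b. The lattice of level m + n inside its zone and inside Ω_m: L^n bonds per unit step [folklore] -/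

/-- **The level-(m+n) lattice above the base level m** (L ≥ 1, M₀ ≥ 1, m + n ≤ k): if the L^{m+n}-points of the
coordinate box of z, z′ lie in the zone of level m + n and (for m ≥ 1) its η-points lie in Ω_m, then
d(L^{m+n}·z, L^{m+n}·z′) ≤ L^n·‖z − z′‖₁ = L^{−m}·‖L^{m+n}·z − L^{m+n}·z′‖₁. [folklore] -/
theorem nl_latticeFrom (hL : 1 ≤ L) (hM₀ : 1 ≤ M₀) {m n j : ℕ} (hj : j = m + n) (hn : j ≤ k) {z z' : Site d}
    (hbox : ∀ b ∈ cbox z z', scalePt (L ^ j) b ∈ nlZone k L M₀ Ω j)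
    (hΩ : 1 ≤ m → cbox (scalePt (L ^ j) z) (scalePt (L ^ j) z') ⊆ Ω m) :
    (nlGraph d k L M₀ Ω).Reachable (scalePt (L ^ j) z) (scalePt (L ^ j) z') ∧
      (nlGraph d k L M₀ Ω).dist (scalePt (L ^ j) z) (scalePt (L ^ j) z') ≤ L ^ n * latL1Dist z z' :=
  reachable_dist_of_costChart (cboxClosed_cbox z z')
    (fun _ _ hb hb' h => nl_stepFrom' hL hM₀ hj hn h (hbox _ hb) (hbox _ hb') fun hm =>
      (cboxClosed_cbox _ _ (scalePt_mem_cbox _ hb) (scalePt_mem_cbox _ hb')).trans (hΩ hm))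
    (left_mem_cbox z z') (right_mem_cbox z z')

/-! ### 13c. The climb above a base level: d(L − 1)·L^n bonds [folklore] -/

/-- **The one-level climb above the base level m** (L ≥ 1, M₀ ≥ 1, j = m + n < k, Ω_{j+1} a cube union): as `nl_climb`,
with cost d(L − 1)·L^n instead of d(L − 1)·L^j, provided (for m ≥ 1) the sup-ball of radius 2M₀L^{j+1} about the point
— which contains the hull used by the climb — lies in Ω_m. [folklore] -/
theorem nl_climbFrom (hL : 1 ≤ L) (hM₀ : 1 ≤ M₀) {m n j : ℕ} (hj : j = m + n) (hjk : j < k)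
    (hΩ : IsCubeUnion (M₀ * L ^ (j + 1)) (Ω (j + 1))) {a : Site d} (ha : scalePt (L ^ j) a ∈ nlZone k L M₀ Ω j)
    (hball : 1 ≤ m → ∀ x, supDist (scalePt (L ^ j) a) x ≤ 2 * (M₀ * L ^ (j + 1)) → x ∈ Ω m) :
    ∃ z : Site d, (nlGraph d k L M₀ Ω).Reachable (scalePt (L ^ j) a) (scalePt (L ^ (j + 1)) z) ∧
      (nlGraph d k L M₀ Ω).dist (scalePt (L ^ j) a) (scalePt (L ^ (j + 1)) z) ≤ L ^ n * (d * (L - 1)) ∧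
      (∀ i, (scalePt (L ^ j) a i - scalePt (L ^ (j + 1)) z i).natAbs ≤ L ^ j * (L - 1)) ∧
      scalePt (L ^ (j + 1)) z ∈ nlZone k L M₀ Ω j := by
  subst hj
  have hL0 : (0 : ℤ) < L := by exact_mod_cast hL
  have hs0 : 0 < L ^ (m + n) := Nat.pow_pos hL
  have hNpos : 0 < M₀ * L ^ (m + n + 1) := Nat.mul_pos hM₀ (Nat.pow_pos hL)
  have hLN' : L ≤ M₀ * L := Nat.le_mul_of_pos_left L hM₀
  have hsL : L ^ (m + n + 1) = L ^ (m + n) * L := pow_succ L (m + n)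
  have hN : M₀ * L ^ (m + n + 1) = L ^ (m + n) * (M₀ * L) := by rw [pow_succ]; ring
  obtain ⟨w, hwΩ, huw⟩ := ha hjk
  have hjk' : m + n ≤ k := hjk.le
  generalize hs : L ^ (m + n) = s at *
  generalize hN' : M₀ * L = N' at *
  generalize hNN : M₀ * L ^ (m + n + 1) = N at *
  have hs1 : (1 : ℤ) ≤ s := by exact_mod_cast hs0
  have hNcast : ((N : ℕ) : ℤ) = (s : ℤ) * (N' : ℤ) := by rw [hN]; push_cast; ring
  have hLN'z : (L : ℤ) ≤ N' := by exact_mod_cast hLN'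
  have hwi : ∀ i, (N : ℤ) * blockIdx N w i ≤ w i ∧ w i ≤ (N : ℤ) * blockIdx N w i + ((N : ℤ) - 1) :=
    mem_blockBox_iff.1 (mem_blockBox_blockIdx hNpos w)
  have huwi : ∀ i, (scalePt s a i - w i).natAbs ≤ N := supDist_le_iff.1 huw
  obtain ⟨lo, hlo⟩ : ∃ lo : Site d, ∀ i, lo i = min (a i) ((N' : ℤ) * blockIdx N w i) := ⟨_, fun _ => rfl⟩
  obtain ⟨hi, hhi⟩ : ∃ hi : Site d, ∀ i, hi i = max (a i) ((N' : ℤ) * blockIdx N w i + ((N' : ℤ) - 1)) :=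
    ⟨_, fun _ => rfl⟩
  have haH : a ∈ Set.Icc lo hi :=
    Set.mem_Icc.2 ⟨fun i => by rw [hlo i]; exact min_le_left _ _, fun i => by rw [hhi i]; exact le_max_left _ _⟩
  have hH : ∀ c ∈ Set.Icc lo hi, scalePt s c ∈ cuFine N (Ω (m + n + 1)) := by
    intro c hc
    rw [Set.mem_Icc] at hc
    refine mem_cuFine_of_hull hNpos hΩ hwΩ huw fun i => ?_
    have h1 : lo i ≤ c i := hc.1 i
    have h2 : c i ≤ hi i := hc.2 i
    rw [hlo i] at h1
    rw [hhi i] at h2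
    rw [scalePt_apply, scalePt_apply, hNcast]
    have hsz : (0 : ℤ) ≤ s := by omega
    constructor
    · rcases le_total (a i) ((N' : ℤ) * blockIdx N w i) with h | h
      · rw [min_eq_left h] at h1
        exact min_le_of_left_le (mul_le_mul_of_nonneg_left h1 hsz)
      · rw [min_eq_right h] at h1
        have h3 := mul_le_mul_of_nonneg_left h1 hsz
        refine min_le_of_right_le ?_
        calc (s : ℤ) * (N' : ℤ) * blockIdx N w i = (s : ℤ) * ((N' : ℤ) * blockIdx N w i) := by ring
          _ ≤ (s : ℤ) * c i := h3
    · rcases le_total (a i) ((N' : ℤ) * blockIdx N w i + ((N' : ℤ) - 1)) with h | h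
      · rw [max_eq_right h] at h2
        have h3 := mul_le_mul_of_nonneg_left h2 hsz
        refine le_max_of_le_right ?_
        have h4 : (s : ℤ) * ((N' : ℤ) * blockIdx N w i + ((N' : ℤ) - 1)) =
            (s : ℤ) * (N' : ℤ) * blockIdx N w i + ((s : ℤ) * (N' : ℤ) - s) := by ring
        rw [h4] at h3
        linarith
      · rw [max_eq_left h] at h2
        exact le_max_of_le_left (mul_le_mul_of_nonneg_left h2 hsz)
  -- every L^j-point of the hull is within sup-distance 2N of the point
  have hnear : ∀ c ∈ Set.Icc lo hi, ∀ i, (scalePt s a i - scalePt s c i).natAbs ≤ 2 * N := by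
    intro c hc i
    rw [Set.mem_Icc] at hc
    have h1 : lo i ≤ c i := hc.1 i
    have h2 : c i ≤ hi i := hc.2 i
    rw [hlo i] at h1
    rw [hhi i] at h2
    have h5 := hwi i
    have h6 := huwi i
    rw [scalePt_apply] at h6
    rw [scalePt_apply, scalePt_apply]
    rw [hNcast] at h5
    have hsz : (0 : ℤ) ≤ s := by omega
    have hsN' : (0 : ℤ) ≤ (s : ℤ) * (N' : ℤ) := by positivity
    have e1 : (s : ℤ) * ((N' : ℤ) * blockIdx N w i) = (s : ℤ) * (N' : ℤ) * blockIdx N w i := by ring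
    have e2 : (s : ℤ) * ((N' : ℤ) * blockIdx N w i + ((N' : ℤ) - 1)) =
        (s : ℤ) * (N' : ℤ) * blockIdx N w i + ((s : ℤ) * (N' : ℤ) - s) := by ring
    have hlow : (s : ℤ) * a i - (s : ℤ) * c i ≤ 2 * ((s : ℤ) * (N' : ℤ)) := by
      rcases le_total (a i) ((N' : ℤ) * blockIdx N w i) with h | h
      · rw [min_eq_left h] at h1
        have h3 := mul_le_mul_of_nonneg_left h1 hsz
        omega
      · rw [min_eq_right h] at h1
        have h3 := mul_le_mul_of_nonneg_left h1 hsz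
        rw [e1] at h3
        omega
    have hupp : (s : ℤ) * c i - (s : ℤ) * a i ≤ 2 * ((s : ℤ) * (N' : ℤ)) := by
      rcases le_total (a i) ((N' : ℤ) * blockIdx N w i + ((N' : ℤ) - 1)) with h | h
      · rw [max_eq_right h] at h2
        have h3 := mul_le_mul_of_nonneg_left h2 hsz
        rw [e2] at h3
        omega
      · rw [max_eq_left h] at h2
        have h3 := mul_le_mul_of_nonneg_left h2 hsz
        omega
    omega
  obtain ⟨z, hz⟩ : ∃ z : Site d, ∀ i, z i = if lo i ≤ (L : ℤ) * (a i / L) then a i / L else a i / L + 1 :=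
    ⟨_, fun _ => rfl⟩
  have hzi : ∀ i, lo i ≤ (L : ℤ) * z i ∧ (L : ℤ) * z i ≤ hi i ∧ (a i - (L : ℤ) * z i).natAbs ≤ L - 1 := by
    intro i
    have h1 := Int.mul_ediv_add_emod (a i) (L : ℤ)
    have h2 := Int.emod_nonneg (a i) hL0.ne'
    have h3 := Int.emod_lt_of_pos (a i) hL0
    have h6 := hlo i
    have h7 := hhi i
    rw [hz i]
    split_ifs with h
    · refine ⟨h, ?_, ?_⟩ <;> omega
    · rw [mul_add, mul_one]
      refine ⟨?_, ?_, ?_⟩ <;> omega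
  have hzH : scalePt L z ∈ Set.Icc lo hi :=
    Set.mem_Icc.2 ⟨fun i => by rw [scalePt_apply]; exact (hzi i).1, fun i => by rw [scalePt_apply]; exact (hzi i).2.1⟩
  have hzoneH : ∀ c ∈ Set.Icc lo hi, scalePt s c ∈ nlZone k L M₀ Ω (m + n) := fun c hc _ => by
    rw [hNN]; exact hH c hc
  -- the η-segments between adjacent hull points lie in Ω_m
  have hsegH : ∀ ⦃b b' : Site d⦄, b ∈ Set.Icc lo hi → b' ∈ Set.Icc lo hi →
      1 ≤ m → cbox (scalePt s b) (scalePt s b') ⊆ Ω m := by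
    intro b b' hb hb' hm x hx
    refine hball hm x (supDist_le_iff.2 fun i => ?_)
    have h1 := natAbs_sub_le_of_mem_cbox hx (scalePt s a i) i
    have h2 := hnear b hb i
    have h3 := hnear b' hb' i
    omega
  have hstep : ∀ ⦃b b' : Site d⦄, b ∈ Set.Icc lo hi → b' ∈ Set.Icc lo hi → (zdGraph d).Adj b b' →
      (nlGraph d k L M₀ Ω).Reachable (scalePt s b) (scalePt s b') ∧
        (nlGraph d k L M₀ Ω).dist (scalePt s b) (scalePt s b') ≤ L ^ n := by
    intro b b' hb hb' hbb'
    have h := fun (hb₁ : scalePt (L ^ (m + n)) b ∈ nlZone k L M₀ Ω (m + n))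
        (hb₂ : scalePt (L ^ (m + n)) b' ∈ nlZone k L M₀ Ω (m + n))
        (hb₃ : 1 ≤ m → cbox (scalePt (L ^ (m + n)) b) (scalePt (L ^ (m + n)) b') ⊆ Ω m) =>
      nl_stepFrom' (k := k) (L := L) (M₀ := M₀) (Ω := Ω) hL hM₀ rfl hjk' hbb' hb₁ hb₂ hb₃
    rw [hs] at h
    exact h (hzoneH b hb) (hzoneH b' hb') (hsegH hb hb')
  have hcost := reachable_dist_of_costChart (G := nlGraph d k L M₀ Ω) (φ := scalePt s) (c := L ^ n)
    (cboxClosed_Icc lo hi) hstep haH hzH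
  have hdist : latL1Dist a (scalePt L z) ≤ d * (L - 1) :=
    latL1Dist_le_of_coord fun i => by rw [scalePt_apply]; exact (hzi i).2.2
  refine ⟨z, ?_, ?_, ?_, ?_⟩
  · rw [hsL, ← scalePt_scalePt]
    exact hcost.1
  · rw [hsL, ← scalePt_scalePt]
    exact hcost.2.trans (Nat.mul_le_mul_left _ hdist)
  · intro i
    rw [hsL, ← scalePt_scalePt, scalePt_apply, scalePt_apply, ← mul_sub, Int.natAbs_mul, Int.natAbs_natCast,
      scalePt_apply]
    exact Nat.mul_le_mul_left _ (hzi i).2.2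
  · rw [hsL, ← scalePt_scalePt]
    exact hzoneH _ hzH

/-! ### 13d. The window pairs above the base level: the comparison in the units L^{i−1}, i the level of y [folklore] -/

/-- Window pairs above the base level m, CASE y″ ONE LEVEL FINER (y of level m + 1 ≤ k, y″ of level m; nesting, cube
unions, L ≥ 1, M₀ ≥ 1): if ‖y − y″‖_∞ ≤ W, (for m + 1 < k) M₀L^{m+1} + L^{m+1} + W ≤ M₀L^{m+2}, and (for m ≥ 1) the
sup-ball of radius W + 2M₀L^{m+2} about y lies in Ω_m, then L^m·d(y, y″) ≤ ‖y − y″‖₁ + 2d(L − 1)L^m, i.e.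
d(y, y″) ≤ (L^mη)^{−1}‖y − y″‖₁ + 2d(L − 1): `nl_cmp_finer` run above the base level (§13a–§13c). [folklore] -/
theorem nl_cmpFrom_finer (hL : 1 ≤ L) (hM₀ : 1 ≤ M₀) (hnest : Nested k Ω) (hcube : CubeUnions k L M₀ Ω)
    {m : ℕ} (hmk : m + 1 ≤ k) {W : ℕ} (h1 : m + 1 < k → M₀ * L ^ (m + 1) + L ^ (m + 1) + W ≤ M₀ * L ^ (m + 2))
    {y y'' : Site d} (hy : y ∈ nlPtsAt k L M₀ Ω (m + 1)) (hy'' : y'' ∈ nlPtsAt k L M₀ Ω m)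
    (hW : supDist y y'' ≤ W) (hρ : 1 ≤ m → ∀ x, supDist y x ≤ W + 2 * (M₀ * L ^ (m + 2)) → x ∈ Ω m) :
    (nlGraph d k L M₀ Ω).Reachable y y'' ∧
      L ^ m * (nlGraph d k L M₀ Ω).dist y y'' ≤ latL1Dist y y'' + 2 * (L ^ m * (d * (L - 1))) := by
  obtain ⟨⟨a, rfl⟩, -, hyz⟩ := hy
  obtain ⟨⟨a'', rfl⟩, -, hyz''⟩ := hy''
  have hlt : m < k := by omega
  have hcu : IsCubeUnion (M₀ * L ^ (m + 1)) (Ω (m + 1)) := hcube (m + 1) (by omega) hmk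
  have hp12 : L ^ (m + 1) ≤ L ^ (m + 2) := Nat.pow_le_pow_right hL (by omega)
  have hpM : L ^ (m + 2) ≤ M₀ * L ^ (m + 2) := Nat.le_mul_of_pos_left _ hM₀
  have hM12 : M₀ * L ^ (m + 1) ≤ M₀ * L ^ (m + 2) := Nat.mul_le_mul_left _ hp12
  have e0 : L ^ m * (L - 1) = L ^ (m + 1) - L ^ m := pow_mul_sub_one L m
  -- climb y″ once, inside Ω_m
  obtain ⟨z, hr, hd, hc, -⟩ := nl_climbFrom hL hM₀ (m := m) (n := 0) (j := m) rfl hlt hcu hyz'' fun hm x hx =>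
    hρ hm x (by
      have := supDist_triangle (scalePt (L ^ (m + 1)) a) (scalePt (L ^ m) a'') x
      omega)
  rw [pow_zero, one_mul] at hd
  -- the box between z and a at level m + 1: in the zone of level m + 1, and inside Ω_m
  have hbox : ∀ b ∈ cbox z a, scalePt (L ^ (m + 1)) b ∈ nlZone k L M₀ Ω (m + 1) := by
    intro b hb hk'
    obtain ⟨w, hw, hyw⟩ := hyz'' hlt
    refine ⟨w, fun h => hw (hnest (m + 1) (by omega) hk' h), ?_⟩
    have hxbox : scalePt (L ^ (m + 1)) b ∈ cbox (scalePt (L ^ (m + 1)) z) (scalePt (L ^ (m + 1)) a) :=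
      scalePt_mem_cbox _ hb
    have hxy'' : supDist (scalePt (L ^ (m + 1)) b) (scalePt (L ^ m) a'') ≤ L ^ m * (L - 1) + W := by
      refine supDist_le_iff.2 fun c => ?_
      have h3 := natAbs_sub_le_of_mem_cbox hxbox (scalePt (L ^ m) a'' c) c
      have h4 := hc c
      have h5 : (scalePt (L ^ (m + 1)) a c - scalePt (L ^ m) a'' c).natAbs ≤ W :=
        (natAbs_sub_le_supDist _ _ c).trans hW
      omega
    have h6 : M₀ * L ^ (m + 1) + L ^ (m + 1) + W ≤ M₀ * L ^ (m + 1 + 1) := h1 hk'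
    calc supDist (scalePt (L ^ (m + 1)) b) w ≤ supDist (scalePt (L ^ (m + 1)) b) (scalePt (L ^ m) a'') +
          supDist (scalePt (L ^ m) a'') w := supDist_triangle _ _ _
      _ ≤ (L ^ m * (L - 1) + W) + M₀ * L ^ (m + 1) := add_le_add hxy'' hyw
      _ ≤ M₀ * L ^ (m + 1 + 1) := by rw [e0]; omega
  have hΩ' : 1 ≤ m → cbox (scalePt (L ^ (m + 1)) z) (scalePt (L ^ (m + 1)) a) ⊆ Ω m := by
    intro hm x hx
    refine hρ hm x (supDist_le_iff.2 fun c => ?_)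
    have h3 := natAbs_sub_le_of_mem_cbox hx (scalePt (L ^ (m + 1)) a c) c
    have h4 := hc c
    have h5 : (scalePt (L ^ (m + 1)) a c - scalePt (L ^ m) a'' c).natAbs ≤ W :=
      (natAbs_sub_le_supDist _ _ c).trans hW
    have h6 : (scalePt (L ^ (m + 1)) a c - scalePt (L ^ (m + 1)) a c).natAbs = 0 := by simp
    omega
  obtain ⟨hrl, hdl⟩ := nl_latticeFrom hL hM₀ (m := m) (n := 1) (j := m + 1) rfl hmk hbox hΩ'
  rw [pow_one] at hdl
  have h5 : L ^ (m + 1) * latL1Dist z a = latL1Dist (scalePt (L ^ (m + 1)) z) (scalePt (L ^ (m + 1)) a) :=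
    (latL1Dist_scalePt _ _ _).symm
  have hcz : latL1Dist (scalePt (L ^ m) a'') (scalePt (L ^ (m + 1)) z) ≤ d * (L ^ m * (L - 1)) :=
    latL1Dist_le_of_coord hc
  have e5 : d * (L ^ m * (L - 1)) = L ^ m * (d * (L - 1)) := by ring
  rw [e5] at hcz
  have htri := latL1Dist_triangle (scalePt (L ^ (m + 1)) z) (scalePt (L ^ m) a'') (scalePt (L ^ (m + 1)) a)
  have hcomm1 := latL1Dist_comm (scalePt (L ^ m) a'') (scalePt (L ^ (m + 1)) z)
  have hcomm2 := latL1Dist_comm (scalePt (L ^ m) a'') (scalePt (L ^ (m + 1)) a)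
  have g1 := hrl.symm.dist_triangle_left (G := nlGraph d k L M₀ Ω) (scalePt (L ^ m) a'')
  have g2 : (nlGraph d k L M₀ Ω).dist (scalePt (L ^ (m + 1)) a) (scalePt (L ^ (m + 1)) z) =
      (nlGraph d k L M₀ Ω).dist (scalePt (L ^ (m + 1)) z) (scalePt (L ^ (m + 1)) a) := SimpleGraph.dist_comm
  have g3 : (nlGraph d k L M₀ Ω).dist (scalePt (L ^ (m + 1)) z) (scalePt (L ^ m) a'') =
      (nlGraph d k L M₀ Ω).dist (scalePt (L ^ m) a'') (scalePt (L ^ (m + 1)) z) := SimpleGraph.dist_comm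
  have hsum : (nlGraph d k L M₀ Ω).dist (scalePt (L ^ (m + 1)) a) (scalePt (L ^ m) a'') ≤
      L * latL1Dist z a + d * (L - 1) := by omega
  have hmul := Nat.mul_le_mul_left (L ^ m) hsum
  have e3 : L ^ m * (L * latL1Dist z a + d * (L - 1)) = L ^ (m + 1) * latL1Dist z a + L ^ m * (d * (L - 1)) := by
    ring
  rw [e3, h5] at hmul
  exact ⟨hrl.symm.trans hr.symm, by omega⟩

/-- Window pairs above the base level m, CASE SAME LEVEL m + 1 ≤ k (nesting, cube unions, L ≥ 1, M₀ ≥ 1): if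
‖y − y″‖_∞ ≤ W, (for m + 2 < k) M₀L^{m+2} + L^{m+2} + W ≤ M₀L^{m+3}, and (for m ≥ 1) the sup-ball of radius
W + 2M₀L^{m+2} about y lies in Ω_m, then L^m·d(y, y″) ≤ ‖y − y″‖₁ + 4d(L − 1)L^{m+1}: `nl_cmp_same` above the base
level. [folklore] -/
theorem nl_cmpFrom_same (hL : 1 ≤ L) (hM₀ : 1 ≤ M₀) (hnest : Nested k Ω) (hcube : CubeUnions k L M₀ Ω)
    {m : ℕ} (hmk : m + 1 ≤ k) {W : ℕ} (h2 : m + 2 < k → M₀ * L ^ (m + 2) + L ^ (m + 2) + W ≤ M₀ * L ^ (m + 3))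
    {y y'' : Site d} (hy : y ∈ nlPtsAt k L M₀ Ω (m + 1)) (hy'' : y'' ∈ nlPtsAt k L M₀ Ω (m + 1))
    (hW : supDist y y'' ≤ W) (hρ : 1 ≤ m → ∀ x, supDist y x ≤ W + 2 * (M₀ * L ^ (m + 2)) → x ∈ Ω m) :
    (nlGraph d k L M₀ Ω).Reachable y y'' ∧
      L ^ m * (nlGraph d k L M₀ Ω).dist y y'' ≤ latL1Dist y y'' + 4 * (L ^ (m + 1) * (d * (L - 1))) := by
  obtain ⟨⟨a, rfl⟩, -, hyz⟩ := hy
  obtain ⟨⟨a'', rfl⟩, -, hyz''⟩ := hy''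
  rcases Nat.lt_or_ge (m + 1) k with hlt | hge
  · -- below the top: climb both once (inside Ω_m) and join at level m + 2
    have hcu : IsCubeUnion (M₀ * L ^ (m + 2)) (Ω (m + 2)) := hcube (m + 2) (by omega) hlt
    have hpM : L ^ (m + 2) ≤ M₀ * L ^ (m + 2) := Nat.le_mul_of_pos_left _ hM₀
    have e1 : L ^ (m + 1) * (L - 1) = L ^ (m + 2) - L ^ (m + 1) := pow_mul_sub_one L (m + 1)
    obtain ⟨z, hrq, hdq, hcq, -⟩ := nl_climbFrom hL hM₀ (m := m) (n := 1) (j := m + 1) rfl hlt hcu hyz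
      fun hm x hx => by
        have hx' : supDist (scalePt (L ^ (m + 1)) a) x ≤ 2 * (M₀ * L ^ (m + 2)) := hx
        exact hρ hm x (by omega)
    obtain ⟨z'', hr''q, hd''q, hc''q, -⟩ := nl_climbFrom hL hM₀ (m := m) (n := 1) (j := m + 1) rfl hlt hcu hyz''
      fun hm x hx => by
        have hx' : supDist (scalePt (L ^ (m + 1)) a'') x ≤ 2 * (M₀ * L ^ (m + 2)) := hx
        have := supDist_triangle (scalePt (L ^ (m + 1)) a) (scalePt (L ^ (m + 1)) a'') x
        exact hρ hm x (by omega)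
    -- restate the climbs at level m + 2
    have hr : (nlGraph d k L M₀ Ω).Reachable (scalePt (L ^ (m + 1)) a) (scalePt (L ^ (m + 2)) z) := hrq
    have hd : (nlGraph d k L M₀ Ω).dist (scalePt (L ^ (m + 1)) a) (scalePt (L ^ (m + 2)) z) ≤ L * (d * (L - 1)) := by
      simpa only [pow_one] using hdq
    have hc : ∀ c, (scalePt (L ^ (m + 1)) a c - scalePt (L ^ (m + 2)) z c).natAbs ≤ L ^ (m + 1) * (L - 1) := hcq
    have hr'' : (nlGraph d k L M₀ Ω).Reachable (scalePt (L ^ (m + 1)) a'') (scalePt (L ^ (m + 2)) z'') := hr''q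
    have hd'' : (nlGraph d k L M₀ Ω).dist (scalePt (L ^ (m + 1)) a'') (scalePt (L ^ (m + 2)) z'') ≤
        L * (d * (L - 1)) := by
      simpa only [pow_one] using hd''q
    have hc'' : ∀ c, (scalePt (L ^ (m + 1)) a'' c - scalePt (L ^ (m + 2)) z'' c).natAbs ≤ L ^ (m + 1) * (L - 1) :=
      hc''q
    clear hrq hdq hcq hr''q hd''q hc''q
    have hbox : ∀ b ∈ cbox z z'', scalePt (L ^ (m + 2)) b ∈ nlZone k L M₀ Ω (m + 2) := by
      intro b hb hk'
      obtain ⟨w, hw, hyw⟩ := hyz hlt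
      have hyw' : supDist (scalePt (L ^ (m + 1)) a) w ≤ M₀ * L ^ (m + 2) := hyw
      refine ⟨w, fun h => hw (hnest (m + 2) (by omega) hk' h), ?_⟩
      have hxbox : scalePt (L ^ (m + 2)) b ∈ cbox (scalePt (L ^ (m + 2)) z) (scalePt (L ^ (m + 2)) z'') :=
        scalePt_mem_cbox _ hb
      have hxy : supDist (scalePt (L ^ (m + 2)) b) (scalePt (L ^ (m + 1)) a) ≤ L ^ (m + 1) * (L - 1) + W := by
        refine supDist_le_iff.2 fun c => ?_
        have h3 := natAbs_sub_le_of_mem_cbox hxbox (scalePt (L ^ (m + 1)) a c) c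
        have h4 := hc c
        have h5 := hc'' c
        have h6 : (scalePt (L ^ (m + 1)) a c - scalePt (L ^ (m + 1)) a'' c).natAbs ≤ W :=
          (natAbs_sub_le_supDist _ _ c).trans hW
        omega
      have h7 : M₀ * L ^ (m + 2) + L ^ (m + 2) + W ≤ M₀ * L ^ (m + 2 + 1) := h2 hk'
      calc supDist (scalePt (L ^ (m + 2)) b) w
          ≤ supDist (scalePt (L ^ (m + 2)) b) (scalePt (L ^ (m + 1)) a) + supDist (scalePt (L ^ (m + 1)) a) w :=
            supDist_triangle _ _ _
        _ ≤ (L ^ (m + 1) * (L - 1) + W) + M₀ * L ^ (m + 2) := add_le_add hxy hyw'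
        _ ≤ M₀ * L ^ (m + 2 + 1) := by rw [e1]; omega
    have hΩ' : 1 ≤ m → cbox (scalePt (L ^ (m + 2)) z) (scalePt (L ^ (m + 2)) z'') ⊆ Ω m := by
      intro hm x hx
      refine hρ hm x (supDist_le_iff.2 fun c => ?_)
      have h3 := natAbs_sub_le_of_mem_cbox hx (scalePt (L ^ (m + 1)) a c) c
      have h4 := hc c
      have h5 := hc'' c
      have h6 : (scalePt (L ^ (m + 1)) a c - scalePt (L ^ (m + 1)) a'' c).natAbs ≤ W :=
        (natAbs_sub_le_supDist _ _ c).trans hW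
      omega
    obtain ⟨hrl, hdl⟩ := nl_latticeFrom hL hM₀ (m := m) (n := 2) (j := m + 2) rfl (by omega) hbox hΩ'
    have h5 : L ^ (m + 2) * latL1Dist z z'' = latL1Dist (scalePt (L ^ (m + 2)) z) (scalePt (L ^ (m + 2)) z'') :=
      (latL1Dist_scalePt _ _ _).symm
    have hcz : latL1Dist (scalePt (L ^ (m + 1)) a) (scalePt (L ^ (m + 2)) z) ≤ d * (L ^ (m + 1) * (L - 1)) :=
      latL1Dist_le_of_coord hc
    have hcz'' : latL1Dist (scalePt (L ^ (m + 1)) a'') (scalePt (L ^ (m + 2)) z'') ≤ d * (L ^ (m + 1) * (L - 1)) :=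
      latL1Dist_le_of_coord hc''
    have e5 : d * (L ^ (m + 1) * (L - 1)) = L ^ (m + 1) * (d * (L - 1)) := by ring
    rw [e5] at hcz hcz''
    have htri1 := latL1Dist_triangle (scalePt (L ^ (m + 2)) z) (scalePt (L ^ (m + 1)) a) (scalePt (L ^ (m + 2)) z'')
    have htri2 :=
      latL1Dist_triangle (scalePt (L ^ (m + 1)) a) (scalePt (L ^ (m + 1)) a'') (scalePt (L ^ (m + 2)) z'')
    have hcomm1 := latL1Dist_comm (scalePt (L ^ (m + 1)) a) (scalePt (L ^ (m + 2)) z)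
    have g1 := hr.dist_triangle_left (G := nlGraph d k L M₀ Ω) (scalePt (L ^ (m + 1)) a'')
    have g2 := hrl.dist_triangle_left (G := nlGraph d k L M₀ Ω) (scalePt (L ^ (m + 1)) a'')
    have g3 : (nlGraph d k L M₀ Ω).dist (scalePt (L ^ (m + 2)) z'') (scalePt (L ^ (m + 1)) a'') =
        (nlGraph d k L M₀ Ω).dist (scalePt (L ^ (m + 1)) a'') (scalePt (L ^ (m + 2)) z'') := SimpleGraph.dist_comm
    have hsum : (nlGraph d k L M₀ Ω).dist (scalePt (L ^ (m + 1)) a) (scalePt (L ^ (m + 1)) a'') ≤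
        L * (d * (L - 1)) + L ^ 2 * latL1Dist z z'' + L * (d * (L - 1)) := by omega
    have hmul := Nat.mul_le_mul_left (L ^ m) hsum
    have e3 : L ^ m * (L * (d * (L - 1)) + L ^ 2 * latL1Dist z z'' + L * (d * (L - 1))) =
        L ^ (m + 2) * latL1Dist z z'' + 2 * (L ^ (m + 1) * (d * (L - 1))) := by ring
    rw [e3, h5] at hmul
    exact ⟨hr.trans (hrl.trans hr''.symm), by omega⟩
  · -- at the top: the L^k-lattice itself, inside Ω_m
    have hbox : ∀ b ∈ cbox a a'', scalePt (L ^ (m + 1)) b ∈ nlZone k L M₀ Ω (m + 1) :=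
      fun b _ h => absurd h (by omega)
    have hΩ' : 1 ≤ m → cbox (scalePt (L ^ (m + 1)) a) (scalePt (L ^ (m + 1)) a'') ⊆ Ω m := by
      intro hm x hx
      refine hρ hm x (supDist_le_iff.2 fun c => ?_)
      have h3 := natAbs_sub_le_of_mem_cbox hx (scalePt (L ^ (m + 1)) a c) c
      have h6 : (scalePt (L ^ (m + 1)) a c - scalePt (L ^ (m + 1)) a'' c).natAbs ≤ W :=
        (natAbs_sub_le_supDist _ _ c).trans hW
      have h7 : (scalePt (L ^ (m + 1)) a c - scalePt (L ^ (m + 1)) a c).natAbs = 0 := by simp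
      omega
    obtain ⟨hrl, hdl⟩ := nl_latticeFrom hL hM₀ (m := m) (n := 1) (j := m + 1) rfl hmk hbox hΩ'
    rw [pow_one] at hdl
    have h5 : L ^ (m + 1) * latL1Dist a a'' = latL1Dist (scalePt (L ^ (m + 1)) a) (scalePt (L ^ (m + 1)) a'') :=
      (latL1Dist_scalePt _ _ _).symm
    have hmul := Nat.mul_le_mul_left (L ^ m) hdl
    have e3 : L ^ m * (L * latL1Dist a a'') = L ^ (m + 1) * latL1Dist a a'' := by ring
    rw [e3, h5] at hmul
    exact ⟨hrl, by omega⟩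

/-- Window pairs above the base level m, CASE y″ ONE LEVEL COARSER (y of level m + 1, y″ of level m + 2 ≤ k; nesting,
cube unions, L ≥ 1, M₀ ≥ 1): if ‖y − y″‖_∞ ≤ W, (for m + 2 < k) M₀L^{m+2} + L^{m+2} + W ≤ M₀L^{m+3}, and (for m ≥ 1)
the sup-ball of radius W + 2M₀L^{m+2} about y lies in Ω_m, then L^m·d(y, y″) ≤ ‖y − y″‖₁ + 2d(L − 1)L^{m+1}:
`nl_cmp_coarser` above the base level. [folklore] -/
theorem nl_cmpFrom_coarser (hL : 1 ≤ L) (hM₀ : 1 ≤ M₀) (hnest : Nested k Ω) (hcube : CubeUnions k L M₀ Ω)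
    {m : ℕ} (hmk : m + 2 ≤ k) {W : ℕ} (h2 : m + 2 < k → M₀ * L ^ (m + 2) + L ^ (m + 2) + W ≤ M₀ * L ^ (m + 3))
    {y y'' : Site d} (hy : y ∈ nlPtsAt k L M₀ Ω (m + 1)) (hy'' : y'' ∈ nlPtsAt k L M₀ Ω (m + 2))
    (hW : supDist y y'' ≤ W) (hρ : 1 ≤ m → ∀ x, supDist y x ≤ W + 2 * (M₀ * L ^ (m + 2)) → x ∈ Ω m) :
    (nlGraph d k L M₀ Ω).Reachable y y'' ∧
      L ^ m * (nlGraph d k L M₀ Ω).dist y y'' ≤ latL1Dist y y'' + 2 * (L ^ (m + 1) * (d * (L - 1))) := by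
  obtain ⟨⟨a, rfl⟩, -, hyz⟩ := hy
  obtain ⟨⟨a'', rfl⟩, -, -⟩ := hy''
  have hlt : m + 1 < k := by omega
  have hcu : IsCubeUnion (M₀ * L ^ (m + 2)) (Ω (m + 2)) := hcube (m + 2) (by omega) hmk
  have hpM : L ^ (m + 2) ≤ M₀ * L ^ (m + 2) := Nat.le_mul_of_pos_left _ hM₀
  have e1 : L ^ (m + 1) * (L - 1) = L ^ (m + 2) - L ^ (m + 1) := pow_mul_sub_one L (m + 1)
  obtain ⟨z, hrq, hdq, hcq, -⟩ := nl_climbFrom hL hM₀ (m := m) (n := 1) (j := m + 1) rfl hlt hcu hyz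
    fun hm x hx => by
      have hx' : supDist (scalePt (L ^ (m + 1)) a) x ≤ 2 * (M₀ * L ^ (m + 2)) := hx
      exact hρ hm x (by omega)
  have hr : (nlGraph d k L M₀ Ω).Reachable (scalePt (L ^ (m + 1)) a) (scalePt (L ^ (m + 2)) z) := hrq
  have hd : (nlGraph d k L M₀ Ω).dist (scalePt (L ^ (m + 1)) a) (scalePt (L ^ (m + 2)) z) ≤ L * (d * (L - 1)) := by
    simpa only [pow_one] using hdq
  have hc : ∀ c, (scalePt (L ^ (m + 1)) a c - scalePt (L ^ (m + 2)) z c).natAbs ≤ L ^ (m + 1) * (L - 1) := hcq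
  clear hrq hdq hcq
  have hbox : ∀ b ∈ cbox z a'', scalePt (L ^ (m + 2)) b ∈ nlZone k L M₀ Ω (m + 2) := by
    intro b hb hk'
    obtain ⟨w, hw, hyw⟩ := hyz hlt
    have hyw' : supDist (scalePt (L ^ (m + 1)) a) w ≤ M₀ * L ^ (m + 2) := hyw
    refine ⟨w, fun h => hw (hnest (m + 2) (by omega) hk' h), ?_⟩
    have hxbox : scalePt (L ^ (m + 2)) b ∈ cbox (scalePt (L ^ (m + 2)) z) (scalePt (L ^ (m + 2)) a'') :=
      scalePt_mem_cbox _ hb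
    have hxy : supDist (scalePt (L ^ (m + 2)) b) (scalePt (L ^ (m + 1)) a) ≤ L ^ (m + 1) * (L - 1) + W := by
      refine supDist_le_iff.2 fun c => ?_
      have h3 := natAbs_sub_le_of_mem_cbox hxbox (scalePt (L ^ (m + 1)) a c) c
      have h4 := hc c
      have h6 : (scalePt (L ^ (m + 1)) a c - scalePt (L ^ (m + 2)) a'' c).natAbs ≤ W :=
        (natAbs_sub_le_supDist _ _ c).trans hW
      omega
    have h7 : M₀ * L ^ (m + 2) + L ^ (m + 2) + W ≤ M₀ * L ^ (m + 2 + 1) := h2 hk'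
    calc supDist (scalePt (L ^ (m + 2)) b) w
        ≤ supDist (scalePt (L ^ (m + 2)) b) (scalePt (L ^ (m + 1)) a) + supDist (scalePt (L ^ (m + 1)) a) w :=
          supDist_triangle _ _ _
      _ ≤ (L ^ (m + 1) * (L - 1) + W) + M₀ * L ^ (m + 2) := add_le_add hxy hyw'
      _ ≤ M₀ * L ^ (m + 2 + 1) := by rw [e1]; omega
  have hΩ' : 1 ≤ m → cbox (scalePt (L ^ (m + 2)) z) (scalePt (L ^ (m + 2)) a'') ⊆ Ω m := by
    intro hm x hx
    refine hρ hm x (supDist_le_iff.2 fun c => ?_)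
    have h3 := natAbs_sub_le_of_mem_cbox hx (scalePt (L ^ (m + 1)) a c) c
    have h4 := hc c
    have h6 : (scalePt (L ^ (m + 1)) a c - scalePt (L ^ (m + 2)) a'' c).natAbs ≤ W :=
      (natAbs_sub_le_supDist _ _ c).trans hW
    omega
  obtain ⟨hrl, hdl⟩ := nl_latticeFrom hL hM₀ (m := m) (n := 2) (j := m + 2) rfl hmk hbox hΩ'
  have h5 : L ^ (m + 2) * latL1Dist z a'' = latL1Dist (scalePt (L ^ (m + 2)) z) (scalePt (L ^ (m + 2)) a'') :=
    (latL1Dist_scalePt _ _ _).symm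
  have hcz : latL1Dist (scalePt (L ^ (m + 1)) a) (scalePt (L ^ (m + 2)) z) ≤ d * (L ^ (m + 1) * (L - 1)) :=
    latL1Dist_le_of_coord hc
  have e5 : d * (L ^ (m + 1) * (L - 1)) = L ^ (m + 1) * (d * (L - 1)) := by ring
  rw [e5] at hcz
  have htri1 := latL1Dist_triangle (scalePt (L ^ (m + 2)) z) (scalePt (L ^ (m + 1)) a) (scalePt (L ^ (m + 2)) a'')
  have hcomm1 := latL1Dist_comm (scalePt (L ^ (m + 1)) a) (scalePt (L ^ (m + 2)) z)
  have g1 := hr.dist_triangle_left (G := nlGraph d k L M₀ Ω) (scalePt (L ^ (m + 2)) a'')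
  have hsum : (nlGraph d k L M₀ Ω).dist (scalePt (L ^ (m + 1)) a) (scalePt (L ^ (m + 2)) a'') ≤
      L * (d * (L - 1)) + L ^ 2 * latL1Dist z a'' := by omega
  have hmul := Nat.mul_le_mul_left (L ^ m) hsum
  have e3 : L ^ m * (L * (d * (L - 1)) + L ^ 2 * latL1Dist z a'') =
      L ^ (m + 2) * latL1Dist z a'' + L ^ (m + 1) * (d * (L - 1)) := by ring
  rw [e3, h5] at hmul
  exact ⟨hr.trans hrl, by omega⟩

/-- **The comparison behind (2.66) in the LITERAL units, with LEVEL-FREE constants, under the separation clause of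
(2.2)** (L ≥ 2d + 2, M₀ ≥ 1, nesting (2.1), cube unions (2.2), separation `L1Sep` with R ≥ 2dL(d + L)).  Let y be a
point of level i = m + 1 ≥ 1 (i ≤ k) and y″ ANY point of the model in the printed window ‖y − y″‖_∞ ≤ 2dM₀L^i.  Then
y″ has level i − 1, i or i + 1 (§12l), every path used stays inside Ω_{i−1} (it stays within 2dM₀L^i + 2M₀L^{i+1} of
y ∈ Ω_i in the sup norm, hence within d times that = 2dL(d + L)·M₀L^{i−1} ≤ R·M₀L^{i−1} in ℓ¹, and the separation
clause at level i − 1 applies), so only bonds of levels ≥ i − 1 are paid, and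
`L^{i−1}·dist y y″ ≤ ‖y − y″‖₁ + 4d(L − 1)·L^i`, i.e.
dist y y″ ≤ (L^{i−1}η)^{−1}‖y − y″‖₁ + 4dL(L − 1) = L·(L^iη)^{−1}‖y − y″‖₁ + 4dL(L − 1): the constants L and
4dL(L − 1) depend on d and L only — NOT on the level i, not on k, not on M₀.  (For i = 0 the η-unit statement
`nl_window_dist` is already literal.)  Contrast `hsTower_literal_witness`: without the separation clause no such
constants exist. [folklore] -/
theorem nl_window_dist_literal (hL : 2 * d + 2 ≤ L) (hM₀ : 1 ≤ M₀) (hnest : Nested k Ω)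
    (hcube : CubeUnions k L M₀ Ω) {R : ℕ} (hsep : L1Sep k L M₀ R Ω) (hR : 2 * d * L * (d + L) ≤ R) {m : ℕ}
    (hmk : m + 1 ≤ k) {y y'' : Site d} (hy : y ∈ nlPtsAt k L M₀ Ω (m + 1)) (hy'' : y'' ∈ nlPts d k L M₀ Ω)
    (hW : supDist y y'' ≤ 2 * d * M₀ * L ^ (m + 1)) :
    (nlGraph d k L M₀ Ω).Reachable y y'' ∧
      L ^ m * (nlGraph d k L M₀ Ω).dist y y'' ≤ latL1Dist y y'' + 4 * (L ^ (m + 1) * (d * (L - 1))) := by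
  have hL1 : 1 ≤ L := by omega
  obtain ⟨i', hi'k, hy''⟩ := hy''
  -- only the levels m, m + 1, m + 2 meet the window (§12l)
  have hR' : d * (2 * d * L + 1) ≤ R := by
    have h1 : d ≤ d * (2 * L * L) := Nat.le_mul_of_pos_right _ (by positivity)
    calc d * (2 * d * L + 1) = 2 * d * d * L + d := by ring
      _ ≤ 2 * d * d * L + d * (2 * L * L) := by omega
      _ = 2 * d * L * (d + L) := by ring
      _ ≤ R := hR
  obtain ⟨hlo, hhi⟩ := nl_window_levels_printed hL1 hnest hsep hR' hmk hi'k hy hy'' hW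
  -- everything within 2dM₀L^{m+1} + 2M₀L^{m+2} of y in the sup norm lies in Ω_m (separation at level m)
  have hρ : 1 ≤ m → ∀ x, supDist y x ≤ 2 * d * M₀ * L ^ (m + 1) + 2 * (M₀ * L ^ (m + 2)) → x ∈ Ω m := by
    intro hm x hx
    by_contra hxΩ
    have hyΩ : y ∈ Ω (m + 1) := hy.2.1 (by omega)
    have h1 := hsep m hm (by omega) hxΩ hyΩ
    have h2 := latL1Dist_le_mul_supDist x y
    rw [supDist_comm] at h2
    have h3 : d * supDist y x ≤ d * (2 * d * M₀ * L ^ (m + 1) + 2 * (M₀ * L ^ (m + 2))) := Nat.mul_le_mul_left _ hx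
    have e : d * (2 * d * M₀ * L ^ (m + 1) + 2 * (M₀ * L ^ (m + 2))) = (M₀ * L ^ m) * (2 * d * L * (d + L)) := by
      ring
    have h4 : (M₀ * L ^ m) * (2 * d * L * (d + L)) ≤ (M₀ * L ^ m) * R := Nat.mul_le_mul_left _ hR
    have e' : (M₀ * L ^ m) * R = R * (M₀ * L ^ m) := Nat.mul_comm _ _
    omega
  have h1g : m + 1 < k → M₀ * L ^ (m + 1) + L ^ (m + 1) + 2 * d * M₀ * L ^ (m + 1) ≤ M₀ * L ^ (m + 2) :=
    fun _ => grow_printed₁ hL hM₀ (m + 1)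
  have h2g : m + 2 < k → M₀ * L ^ (m + 2) + L ^ (m + 2) + 2 * d * M₀ * L ^ (m + 1) ≤ M₀ * L ^ (m + 3) :=
    fun _ => grow_printed₂ hL hM₀ (m + 1)
  have hp : L ^ m ≤ L ^ (m + 1) := Nat.pow_le_pow_right hL1 (by omega)
  have hK : L ^ m * (d * (L - 1)) ≤ L ^ (m + 1) * (d * (L - 1)) := Nat.mul_le_mul_right _ hp
  rcases Nat.lt_trichotomy i' (m + 1) with hlt | rfl | hgt
  · have e : i' = m := by omega
    subst e
    obtain ⟨hr, hdd⟩ := nl_cmpFrom_finer hL1 hM₀ hnest hcube hmk h1g hy hy'' hW hρ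
    exact ⟨hr, by omega⟩
  · obtain ⟨hr, hdd⟩ := nl_cmpFrom_same hL1 hM₀ hnest hcube hmk h2g hy hy'' hW hρ
    exact ⟨hr, by omega⟩
  · have e : i' = m + 2 := by omega
    subst e
    obtain ⟨hr, hdd⟩ := nl_cmpFrom_coarser hL1 hM₀ hnest hcube hi'k h2g hy hy'' hW hρ
    exact ⟨hr, by omega⟩

/-- **… as a bound by a constant depending on d, L, M₀ only**: inside the printed window of a point y of level
i ≥ 1, under the hypotheses of `nl_window_dist_literal`, dist y y″ ≤ 2d²M₀L + 4dL(L − 1) (from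
‖y − y″‖₁ ≤ d‖y − y″‖_∞ ≤ 2d²M₀L^i).  Level-free and k-free; the M₀-dependence is that of the two-level model
(`…B6BoxCharts.twoScale_literal266_not_uniform`). [folklore] -/
theorem nl_window_dist_literal_const (hL : 2 * d + 2 ≤ L) (hM₀ : 1 ≤ M₀) (hnest : Nested k Ω)
    (hcube : CubeUnions k L M₀ Ω) {R : ℕ} (hsep : L1Sep k L M₀ R Ω) (hR : 2 * d * L * (d + L) ≤ R) {m : ℕ}
    (hmk : m + 1 ≤ k) {y y'' : Site d} (hy : y ∈ nlPtsAt k L M₀ Ω (m + 1)) (hy'' : y'' ∈ nlPts d k L M₀ Ω)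
    (hW : supDist y y'' ≤ 2 * d * M₀ * L ^ (m + 1)) :
    (nlGraph d k L M₀ Ω).Reachable y y'' ∧
      (nlGraph d k L M₀ Ω).dist y y'' ≤ 2 * d * d * M₀ * L + 4 * (d * (L * (L - 1))) := by
  obtain ⟨hr, hd⟩ := nl_window_dist_literal hL hM₀ hnest hcube hsep hR hmk hy hy'' hW
  have hL1 : 1 ≤ L := by omega
  have h1 := latL1Dist_le_mul_supDist y y''
  have h2 : d * supDist y y'' ≤ d * (2 * d * M₀ * L ^ (m + 1)) := Nat.mul_le_mul_left _ hW
  have e : d * (2 * d * M₀ * L ^ (m + 1)) + 4 * (L ^ (m + 1) * (d * (L - 1))) =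
      L ^ m * (2 * d * d * M₀ * L + 4 * (d * (L * (L - 1)))) := by ring
  have h3 : L ^ m * (nlGraph d k L M₀ Ω).dist y y'' ≤ L ^ m * (2 * d * d * M₀ * L + 4 * (d * (L * (L - 1)))) := by
    rw [← e]; omega
  exact ⟨hr, Nat.le_of_mul_le_mul_left h3 (Nat.pow_pos hL1)⟩

/-! ### 13e. The sum of (2.66) with its LITERAL weights inside the printed window [folklore] -/

/-- **The last «≤» of (2.66) with the LITERAL weights e^{−δ₀(L^iη)^{−1}|y − y″|} — indeed with ANY weights ≤ 1 —
inside the printed window, under the separation clause of (2.2)** (δ₀ ≥ 0; hypotheses of `nl_window_dist_literal`: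
L ≥ 2d + 2, M₀ ≥ 1, nesting, cube unions, `L1Sep` with R ≥ 2dL(d + L); y of level i = m + 1 ≥ 1; finite S ⊆ T
inside the window ‖y − y″‖_∞ ≤ 2dM₀L^i): Σ_{y″∈S} w(y″)·e^{−½δ₀·d(y″,y′)} ≤
#S·e^{½δ₀·(2d²M₀L + 4dL(L − 1))}·e^{−½δ₀·d(y,y′)}.  The constant depends on d, L, M₀, δ₀ and the number #S of points
summed (at most the number of model points in the window — L^{i−1}-lattice points by §12l — which is
≤ (4dM₀L + 1)^d; this count is NOT formalised here), and on nothing else: not on the level i of y, not on k.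
[folklore] -/
theorem nl_sum266_literal_le (hL : 2 * d + 2 ≤ L) (hM₀ : 1 ≤ M₀) (hnest : Nested k Ω)
    (hcube : CubeUnions k L M₀ Ω) {R : ℕ} (hsep : L1Sep k L M₀ R Ω) (hR : 2 * d * L * (d + L) ≤ R) {m : ℕ}
    (hmk : m + 1 ≤ k) {y : Site d} (hy : y ∈ nlPtsAt k L M₀ Ω (m + 1)) {δ₀ : ℝ} (hδ : 0 ≤ δ₀)
    (w : Site d → ℝ) (hw : ∀ x, w x ≤ 1) (y' : Site d) (S : Finset (Site d))
    (hS : ∀ y'' ∈ S, y'' ∈ nlPts d k L M₀ Ω ∧ supDist y y'' ≤ 2 * d * M₀ * L ^ (m + 1)) :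
    ∑ y'' ∈ S, w y'' * Real.exp (-(δ₀ / 2 * ((nlGraph d k L M₀ Ω).dist y'' y' : ℝ))) ≤
      S.card * Real.exp (δ₀ / 2 * ((2 * d * d * M₀ * L + 4 * (d * (L * (L - 1))) : ℕ) : ℝ)) *
        Real.exp (-(δ₀ / 2 * ((nlGraph d k L M₀ Ω).dist y y' : ℝ))) := by
  have hterm : ∀ y'' ∈ S, w y'' * Real.exp (-(δ₀ / 2 * ((nlGraph d k L M₀ Ω).dist y'' y' : ℝ))) ≤
      Real.exp (δ₀ / 2 * ((2 * d * d * M₀ * L + 4 * (d * (L * (L - 1))) : ℕ) : ℝ)) *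
        Real.exp (-(δ₀ / 2 * ((nlGraph d k L M₀ Ω).dist y y' : ℝ))) := by
    intro y'' hy''
    obtain ⟨hr, hd⟩ :=
      nl_window_dist_literal_const hL hM₀ hnest hcube hsep hR hmk hy (hS y'' hy'').1 (hS y'' hy'').2
    have htri : ((nlGraph d k L M₀ Ω).dist y y' : ℝ) ≤
        ((nlGraph d k L M₀ Ω).dist y y'' : ℝ) + ((nlGraph d k L M₀ Ω).dist y'' y' : ℝ) := by
      exact_mod_cast hr.dist_triangle_left y'
    have hd' : ((nlGraph d k L M₀ Ω).dist y y'' : ℝ) ≤ ((2 * d * d * M₀ * L + 4 * (d * (L * (L - 1))) : ℕ) : ℝ) := by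
      exact_mod_cast hd
    have h5 : 0 ≤ δ₀ / 2 := by linarith
    have h6 : δ₀ / 2 * ((nlGraph d k L M₀ Ω).dist y y' : ℝ) ≤
        δ₀ / 2 * (((2 * d * d * M₀ * L + 4 * (d * (L * (L - 1))) : ℕ) : ℝ) +
          ((nlGraph d k L M₀ Ω).dist y'' y' : ℝ)) :=
      mul_le_mul_of_nonneg_left (by linarith) h5
    rw [← Real.exp_add]
    calc w y'' * Real.exp (-(δ₀ / 2 * ((nlGraph d k L M₀ Ω).dist y'' y' : ℝ)))
        ≤ 1 * Real.exp (δ₀ / 2 * ((2 * d * d * M₀ * L + 4 * (d * (L * (L - 1))) : ℕ) : ℝ) +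
            -(δ₀ / 2 * ((nlGraph d k L M₀ Ω).dist y y' : ℝ))) :=
          mul_le_mul (hw y'') (Real.exp_le_exp.2 (by linarith)) (Real.exp_pos _).le zero_le_one
      _ = _ := one_mul _
  calc ∑ y'' ∈ S, w y'' * Real.exp (-(δ₀ / 2 * ((nlGraph d k L M₀ Ω).dist y'' y' : ℝ)))
      ≤ ∑ y'' ∈ S, Real.exp (δ₀ / 2 * ((2 * d * d * M₀ * L + 4 * (d * (L * (L - 1))) : ℕ) : ℝ)) *
          Real.exp (-(δ₀ / 2 * ((nlGraph d k L M₀ Ω).dist y y' : ℝ))) := Finset.sum_le_sum hterm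
    _ = _ := by rw [Finset.sum_const, nsmul_eq_mul]; ring

/-! ### 14. The literal window sum WITHOUT the factor #S (appendix to §13e, v1.1): the window points are
L^{i−1}-lattice points, so the literal weights of (2.66) sum to at most c₀(δ₀, 1/L)^d [folklore] -/

/-- A point of level i′ ≥ m is an L^m-lattice point. [folklore] -/
theorem exists_eq_scalePt_of_le {m i' : ℕ} (hmi : m ≤ i') {x : Site d} (hx : x ∈ nlPtsAt k L M₀ Ω i') :
    ∃ b, x = scalePt (L ^ m) b := by
  obtain ⟨a, rfl⟩ := hx.1
  refine ⟨scalePt (L ^ (i' - m)) a, ?_⟩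
  rw [scalePt_scalePt, ← pow_add, Nat.add_sub_cancel' hmi]

/-- d(2dL + 1) ≤ 2dL(d + L) for L ≥ 1: the levels threshold of §12l is below the threshold of §13d. [folklore] -/
theorem levels_threshold_le (hL : 1 ≤ L) : d * (2 * d * L + 1) ≤ 2 * d * L * (d + L) := by
  have h1 : d ≤ d * (L * L) := Nat.le_mul_of_pos_right _ (by positivity)
  calc d * (2 * d * L + 1) = 2 * d * d * L + d := by ring
    _ ≤ 2 * d * d * L + 2 * (d * (L * L)) := by omega
    _ = 2 * d * L * (d + L) := by ring

/-- **The LITERAL weights of (2.66) sum to at most c₀(δ₀, 1/L)^d inside the printed window** (L ≥ 1, nesting,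
separation clause with R ≥ d(2dL + 1), δ₀ > 0; y of level m + 1 ≤ k; finite S ⊆ T inside the window
‖y − y″‖_∞ ≤ 2dM₀L^{m+1}): Σ_{y″∈S} e^{−δ₀‖y − y″‖₁/L^{m+1}} ≤ c₀(δ₀, 1/L)^d.  Every y″ of the window is a point of
level ≥ m (§12l `nl_window_levels_printed`), hence y − y″ ∈ L^m·ℤ^d and the map y″ ↦ (y″ − y)/L^m is injective into
ℤ^d with ‖y − y″‖₁/L^{m+1} = (1/L)·‖(y″ − y)/L^m‖₁; then Σ_{w∈ℤ^d} e^{−(δ₀/L)‖w‖₁} ≤ c₀(δ₀, 1/L)^d is the sibling's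
`B6Lemma21TwoScale.sum_exp_le_c0_pow`, BY NAME.  The bound depends on d, L, δ₀ only — not on M₀, not on the level,
not on k, not on #S. [folklore] -/
theorem nl_window_literal_weights_le (hL : 1 ≤ L) (hnest : Nested k Ω) {R : ℕ} (hsep : L1Sep k L M₀ R Ω)
    (hR : d * (2 * d * L + 1) ≤ R) {m : ℕ} (hmk : m + 1 ≤ k) {y : Site d} (hy : y ∈ nlPtsAt k L M₀ Ω (m + 1))
    {δ₀ : ℝ} (hδ : 0 < δ₀) (S : Finset (Site d))
    (hS : ∀ y'' ∈ S, y'' ∈ nlPts d k L M₀ Ω ∧ supDist y y'' ≤ 2 * d * M₀ * L ^ (m + 1)) :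
    ∑ y'' ∈ S, Real.exp (-(δ₀ * (latL1Dist y y'' : ℝ) / (L : ℝ) ^ (m + 1))) ≤ B6.c0 δ₀ (1 / L) ^ d := by
  classical
  -- every point of S, and y itself, is an L^m-lattice point
  have hlat : ∀ x ∈ S, ∀ j, ((L : ℤ) ^ m) ∣ (x j - y j) := by
    intro x hx j
    obtain ⟨hxT, hxW⟩ := hS x hx
    obtain ⟨i', hi'k, hx'⟩ := hxT
    have hlev := (nl_window_levels_printed hL hnest hsep hR hmk hi'k hy hx' hxW).1
    obtain ⟨b, rfl⟩ := exists_eq_scalePt_of_le (by omega : m ≤ i') hx'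
    obtain ⟨a, rfl⟩ := exists_eq_scalePt_of_le (Nat.le_succ m) hy
    exact ⟨b j - a j, by simp only [scalePt]; push_cast; ring⟩
  set ρ : Site d → (Fin d → ℤ) := fun x j => (x j - y j) / (L : ℤ) ^ m with hρ
  have hinj : Set.InjOn ρ ↑S := by
    intro x₁ hx₁ x₂ hx₂ h
    funext j
    have hj : (x₁ j - y j) / (L : ℤ) ^ m = (x₂ j - y j) / (L : ℤ) ^ m := congrFun h j
    have e₁ := Int.ediv_mul_cancel (hlat x₁ hx₁ j)
    have e₂ := Int.ediv_mul_cancel (hlat x₂ hx₂ j)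
    have : x₁ j - y j = x₂ j - y j := by rw [← e₁, ← e₂, hj]
    linarith
  have hl1 : ∀ x ∈ S, L ^ m * B6Lemma21TwoScale.l1 (ρ x) = latL1Dist y x := by
    intro x hx
    unfold B6Lemma21TwoScale.l1 latL1Dist
    rw [Finset.mul_sum]
    refine Finset.sum_congr rfl fun j _ => ?_
    have e := Int.ediv_mul_cancel (hlat x hx j)
    have hyx : y j - x j = -((L : ℤ) ^ m * ((x j - y j) / (L : ℤ) ^ m)) := by linarith
    rw [hyx, Int.natAbs_neg, Int.natAbs_mul, Int.natAbs_pow]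
    simp [hρ]
  have hLpos : (0 : ℝ) < L := by exact_mod_cast hL
  have hL0 : (L : ℝ) ≠ 0 := hLpos.ne'
  have hw : ∀ x ∈ S, (B6Lemma21TwoScale.l1 (ρ x) : ℝ) ≤ (latL1Dist y x : ℝ) / (L : ℝ) ^ m := by
    intro x hx
    have e : ((latL1Dist y x : ℕ) : ℝ) = (L : ℝ) ^ m * (B6Lemma21TwoScale.l1 (ρ x) : ℝ) := by
      rw [← hl1 x hx]; push_cast; ring
    rw [le_div_iff₀ (by positivity), e, mul_comm]
  have hα : 0 < 1 / (L : ℝ) * δ₀ := by positivity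
  have key := B6Lemma21TwoScale.sum_exp_le_c0_pow hα S ρ hinj
    (fun x => (latL1Dist y x : ℝ) / (L : ℝ) ^ m) hw
  rw [Fintype.card_fin] at key
  refine le_of_eq_of_le (Finset.sum_congr rfl fun x _ => ?_) key
  congr 1
  rw [pow_succ]
  field_simp

/-- **The last «≤» of (2.66) with its LITERAL weights and a constant free of #S, of the level and of k, under the
separation clause of (2.2)** (δ₀ > 0; hypotheses of `nl_window_dist_literal`: L ≥ 2d + 2, M₀ ≥ 1, nesting, cube
unions, `L1Sep` with R ≥ 2dL(d + L); y of level i = m + 1 ≥ 1; finite S ⊆ T inside the window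
‖y − y″‖_∞ ≤ 2dM₀L^i ⊇ the printed window): Σ_{y″∈S} e^{−δ₀(L^iη)^{−1}‖y − y″‖₁}·e^{−½δ₀·d(y″,y′)} ≤
e^{½δ₀·(2d²M₀L + 4dL(L − 1))}·c₀(δ₀, 1/L)^d·e^{−½δ₀·d(y,y′)} — `nl_window_dist_literal_const` for the shift of the
d-decay, `nl_window_literal_weights_le` for the weights.  The constant depends on d, L, M₀, δ₀ ONLY (M₀ enters
through the printed window 2dM, as in print's O(1)). [folklore] -/
theorem nl_sum266_literal_c0_le (hL : 2 * d + 2 ≤ L) (hM₀ : 1 ≤ M₀) (hnest : Nested k Ω)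
    (hcube : CubeUnions k L M₀ Ω) {R : ℕ} (hsep : L1Sep k L M₀ R Ω) (hR : 2 * d * L * (d + L) ≤ R) {m : ℕ}
    (hmk : m + 1 ≤ k) {y : Site d} (hy : y ∈ nlPtsAt k L M₀ Ω (m + 1)) {δ₀ : ℝ} (hδ : 0 < δ₀)
    (y' : Site d) (S : Finset (Site d))
    (hS : ∀ y'' ∈ S, y'' ∈ nlPts d k L M₀ Ω ∧ supDist y y'' ≤ 2 * d * M₀ * L ^ (m + 1)) :
    ∑ y'' ∈ S, Real.exp (-(δ₀ * (latL1Dist y y'' : ℝ) / (L : ℝ) ^ (m + 1))) *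
        Real.exp (-(δ₀ / 2 * ((nlGraph d k L M₀ Ω).dist y'' y' : ℝ))) ≤
      Real.exp (δ₀ / 2 * ((2 * d * d * M₀ * L + 4 * (d * (L * (L - 1))) : ℕ) : ℝ)) * B6.c0 δ₀ (1 / L) ^ d *
        Real.exp (-(δ₀ / 2 * ((nlGraph d k L M₀ Ω).dist y y' : ℝ))) := by
  have hL1 : 1 ≤ L := by omega
  have hR' : d * (2 * d * L + 1) ≤ R := (levels_threshold_le hL1).trans hR
  set C : ℕ := 2 * d * d * M₀ * L + 4 * (d * (L * (L - 1))) with hC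
  have hterm : ∀ y'' ∈ S, Real.exp (-(δ₀ * (latL1Dist y y'' : ℝ) / (L : ℝ) ^ (m + 1))) *
        Real.exp (-(δ₀ / 2 * ((nlGraph d k L M₀ Ω).dist y'' y' : ℝ))) ≤
      Real.exp (-(δ₀ * (latL1Dist y y'' : ℝ) / (L : ℝ) ^ (m + 1))) *
        (Real.exp (δ₀ / 2 * (C : ℝ)) * Real.exp (-(δ₀ / 2 * ((nlGraph d k L M₀ Ω).dist y y' : ℝ)))) := by
    intro y'' hy''
    refine mul_le_mul_of_nonneg_left ?_ (Real.exp_pos _).le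
    obtain ⟨hr, hd⟩ :=
      nl_window_dist_literal_const hL hM₀ hnest hcube hsep hR hmk hy (hS y'' hy'').1 (hS y'' hy'').2
    have htri : ((nlGraph d k L M₀ Ω).dist y y' : ℝ) ≤
        ((nlGraph d k L M₀ Ω).dist y y'' : ℝ) + ((nlGraph d k L M₀ Ω).dist y'' y' : ℝ) := by
      exact_mod_cast hr.dist_triangle_left y'
    have hd' : ((nlGraph d k L M₀ Ω).dist y y'' : ℝ) ≤ (C : ℝ) := by exact_mod_cast hd
    have h5 : 0 ≤ δ₀ / 2 := by linarith
    have h6 : δ₀ / 2 * ((nlGraph d k L M₀ Ω).dist y y' : ℝ) ≤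
        δ₀ / 2 * ((C : ℝ) + ((nlGraph d k L M₀ Ω).dist y'' y' : ℝ)) :=
      mul_le_mul_of_nonneg_left (by linarith) h5
    rw [← Real.exp_add]
    exact Real.exp_le_exp.2 (by linarith)
  have hwt := nl_window_literal_weights_le hL1 hnest hsep hR' hmk hy hδ S hS
  calc ∑ y'' ∈ S, Real.exp (-(δ₀ * (latL1Dist y y'' : ℝ) / (L : ℝ) ^ (m + 1))) *
          Real.exp (-(δ₀ / 2 * ((nlGraph d k L M₀ Ω).dist y'' y' : ℝ)))
      ≤ ∑ y'' ∈ S, Real.exp (-(δ₀ * (latL1Dist y y'' : ℝ) / (L : ℝ) ^ (m + 1))) *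
          (Real.exp (δ₀ / 2 * (C : ℝ)) * Real.exp (-(δ₀ / 2 * ((nlGraph d k L M₀ Ω).dist y y' : ℝ)))) :=
        Finset.sum_le_sum hterm
    _ = (∑ y'' ∈ S, Real.exp (-(δ₀ * (latL1Dist y y'' : ℝ) / (L : ℝ) ^ (m + 1)))) *
          (Real.exp (δ₀ / 2 * (C : ℝ)) * Real.exp (-(δ₀ / 2 * ((nlGraph d k L M₀ Ω).dist y y' : ℝ)))) := by
        rw [Finset.sum_mul]
    _ ≤ B6.c0 δ₀ (1 / L) ^ d *
          (Real.exp (δ₀ / 2 * (C : ℝ)) * Real.exp (-(δ₀ / 2 * ((nlGraph d k L M₀ Ω).dist y y' : ℝ)))) :=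
        mul_le_mul_of_nonneg_right hwt (by positivity)
    _ = _ := by ring

/-! ### 15. (len), (sep) and the WALK FORM of (2.2) — hence the level-distance bound behind (2.60) — DERIVED in the
nested model from `Nested` + `L1Sep` (v1.2; the siblings' `B6LevelGapMetric.levelGap_of_metric` and
`B6Geometry.levelGap_dist_real` BY NAME, on the sub-graph of `nlGraph` induced on its point set T, positions in
ℓ¹(ℝ^d) so that the ambient distance IS Bałaban's |x − y| of p. 223) [folklore] -/

/-- The LEVEL of a point: the greatest j ≤ k such that x is a point of level j (0 if none) — the closed-Ω convention of
the siblings (a point of L^{j+1}·ℤ^d in the collar of Ω_{j+1} is a point of the levels j and j + 1 and gets level j + 1,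
so that a level-j bond has both ends of level ≥ j). [folklore] -/
noncomputable def nlLevel (k L M₀ : ℕ) (Ω : ℕ → Set (Site d)) (x : Site d) : ℕ := by
  classical exact Nat.findGreatest (fun j => x ∈ nlPtsAt k L M₀ Ω j) k

/-- The level is at most k. [folklore] -/
theorem nlLevel_le (x : Site d) : nlLevel k L M₀ Ω x ≤ k := by
  classical
  unfold nlLevel
  exact Nat.findGreatest_le _

/-- A point of level j has level ≥ j. [folklore] -/
theorem le_nlLevel {j : ℕ} (hj : j ≤ k) {x : Site d} (hx : x ∈ nlPtsAt k L M₀ Ω j) : j ≤ nlLevel k L M₀ Ω x := by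
  classical
  unfold nlLevel
  exact Nat.le_findGreatest hj hx

/-- A point of T is a point of its level. [folklore] -/
theorem mem_nlPtsAt_nlLevel {x : Site d} (hx : x ∈ nlPts d k L M₀ Ω) : x ∈ nlPtsAt k L M₀ Ω (nlLevel k L M₀ Ω x) := by
  classical
  obtain ⟨j, hj, hxj⟩ := hx
  unfold nlLevel
  exact Nat.findGreatest_spec (P := fun j => x ∈ nlPtsAt k L M₀ Ω j) hj hxj

/-- ℓ¹ POSITIONS: the lattice point x ∈ ℤ^d placed in ℓ¹(ℝ^d) (`PiLp 1`), so that the ambient distance is Bałaban's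
|x − y| = Σ_μ |x_μ − y_μ| (p. 223, quoted in the parent's header; η = 1). [folklore] -/
noncomputable def l1Pos (x : Site d) : PiLp 1 (fun _ : Fin d => ℝ) :=
  (WithLp.equiv 1 (Fin d → ℝ)).symm fun i => (x i : ℝ)

/-- dist (l1Pos x) (l1Pos y) = ‖x − y‖₁. [folklore] -/
theorem dist_l1Pos (x y : Site d) : dist (l1Pos x) (l1Pos y) = (latL1Dist x y : ℝ) := by
  rw [l1Pos, l1Pos, PiLp.dist_eq_of_L1, latL1Dist]
  push_cast
  refine Finset.sum_congr rfl fun i _ => ?_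
  rw [Real.dist_eq]
  simp

/-- **(len) in the nested model** (`B6LevelGapMetric.BondScale`, L ≥ 1): on the sub-graph of `nlGraph` induced on T,
with levels `nlLevel`, ℓ¹ positions and ℓ j = L^j, every bond has length ≤ ℓ(min of the levels of its ends) — a level-j
bond {L^j·a, L^j·a′} has ℓ¹-length exactly L^j and both ends of level ≥ j (p. 231 *"a part of Γ contained in B^j(Λ_j)
consists of bonds of the lattice Λ_j"*, in the model). [folklore] -/
theorem nl_bondScale (hL : 1 ≤ L) :
    BondScale ((nlGraph d k L M₀ Ω).induce (nlPts d k L M₀ Ω)) (fun v => nlLevel k L M₀ Ω v)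
      (fun v => l1Pos (v : Site d)) (fun j => (L : ℝ) ^ j) := by
  have key : ∀ u v : Site d, nlRel d k L M₀ Ω u v →
      dist (l1Pos u) (l1Pos v) ≤ (L : ℝ) ^ min (nlLevel k L M₀ Ω u) (nlLevel k L M₀ Ω v) := by
    intro u v h
    obtain ⟨j, hj, a, a', hadj, rfl, rfl, hu, hv⟩ := h
    rw [dist_l1Pos, latL1Dist_scalePt, latL1Dist_eq_one_of_adj hadj, mul_one]
    push_cast
    exact pow_le_pow_right₀ (by exact_mod_cast hL)
      (le_min (le_nlLevel hj ⟨⟨a, rfl⟩, hu⟩) (le_nlLevel hj ⟨⟨a', rfl⟩, hv⟩))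
  intro u v huv
  have h : (nlGraph d k L M₀ Ω).Adj (u : Site d) (v : Site d) := SimpleGraph.comap_adj.1 huv
  rw [nlGraph, SimpleGraph.fromRel_adj] at h
  obtain ⟨-, h | h⟩ := h
  · exact key _ _ h
  · rw [dist_comm, min_comm]; exact key _ _ h

/-- **(sep) in the nested model** (`B6LevelGapMetric.ZoneSep`; L ≥ 1, nesting (2.1), separation clause of (2.2) as
`L1Sep` with the integer R): if level u < i < level x then ((R − d)·M₀)·L^i < |u − x| in ℓ¹.  For: u, of level j < i,
lies in the zone of level j < k, i.e. within sup-distance M₀L^{j+1} ≤ M₀L^i — ℓ¹-distance d·M₀L^i — of a point w of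
Ω_{j+1}^c ⊆ Ω_i^c; x, of level > i, lies in Ω_{level x} ⊆ Ω_{i+1}; so R·M₀L^i < |w − x| ≤ |w − u| + |u − x| ≤
d·M₀L^i + |u − x| (the printed (2.57) *"(L^{j_{l,l+1}}η)^{−1}|y′_l − y_{l+1}| > RM"*, in the model, with the collar
width d·M₀ of the zone convention lost from R·M₀). [folklore] -/
theorem nl_zoneSep (hL : 1 ≤ L) (hnest : Nested k Ω) {R : ℕ} (hsep : L1Sep k L M₀ R Ω) :
    ZoneSep (fun v : nlPts d k L M₀ Ω => nlLevel k L M₀ Ω v) (fun v => l1Pos (v : Site d)) (fun j => (L : ℝ) ^ j)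
      (((R : ℝ) - d) * M₀) := by
  intro i u x hui hix
  have hxk : nlLevel k L M₀ Ω (x : Site d) ≤ k := nlLevel_le _
  have hu := mem_nlPtsAt_nlLevel (k := k) (L := L) (M₀ := M₀) (Ω := Ω) u.2
  have hx := mem_nlPtsAt_nlLevel (k := k) (L := L) (M₀ := M₀) (Ω := Ω) x.2
  have hui' : nlLevel k L M₀ Ω (u : Site d) < i := hui
  have hix' : i < nlLevel k L M₀ Ω (x : Site d) := hix
  obtain ⟨w, hw, huw⟩ := nlZone_of_nlPtsAt hu (by omega)
  have hwi : w ∉ Ω i := fun h => hw (hnest.subset (by omega) (by omega) (by omega) h)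
  have hxΩ : (x : Site d) ∈ Ω (i + 1) := hnest.subset (by omega) (by omega) hxk (hx.2.1 (by omega))
  have hs := hsep i (by omega) (by omega) hwi hxΩ
  have hwu : latL1Dist w u ≤ d * (M₀ * L ^ (nlLevel k L M₀ Ω (u : Site d) + 1)) := by
    rw [latL1Dist_comm]; exact (latL1Dist_le_mul_supDist _ _).trans (Nat.mul_le_mul_left _ huw)
  have hpow : d * (M₀ * L ^ (nlLevel k L M₀ Ω (u : Site d) + 1)) ≤ d * (M₀ * L ^ i) :=
    Nat.mul_le_mul_left _ (Nat.mul_le_mul_left _ (Nat.pow_le_pow_right hL (by omega)))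
  have h1 : R * (M₀ * L ^ i) < d * (M₀ * L ^ i) + latL1Dist (u : Site d) x :=
    calc R * (M₀ * L ^ i) < latL1Dist w x := hs
      _ ≤ latL1Dist w u + latL1Dist (u : Site d) x := latL1Dist_triangle w u x
      _ ≤ d * (M₀ * L ^ i) + latL1Dist (u : Site d) x := Nat.add_le_add_right (hwu.trans hpow) _
  have h2 : ((R : ℝ) * (M₀ * (L : ℝ) ^ i)) < d * (M₀ * (L : ℝ) ^ i) + (latL1Dist (u : Site d) x : ℝ) := by
    exact_mod_cast h1
  show ((R : ℝ) - d) * M₀ * (L : ℝ) ^ i < dist (l1Pos (u : Site d)) (l1Pos (x : Site d))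
  rw [dist_l1Pos]
  linarith

/-- **THE WALK FORM OF (2.2) in the nested model** (`B6Geometry.LevelGap`; L ≥ 1, nesting, `L1Sep` with the integer R,
N + d·M₀ ≤ R·M₀): every chain of bonds of the model from a point of level < i to a point of level > i has MORE than N
bonds — the siblings' `levelGap_of_metric` ((len) + (sep) + monotonicity of L^j) BY NAME.  The first COORDINATE-FREE
multi-level instance in the tree (the sibling `…B6LevelTower` exercises the same chain on its glued tower of boxes; with
two levels the statement is vacuous). [folklore] -/
theorem nl_levelGap (hL : 1 ≤ L) (hnest : Nested k Ω) {R : ℕ} (hsep : L1Sep k L M₀ R Ω) {N : ℕ}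
    (hN : N + d * M₀ ≤ R * M₀) :
    LevelGap ((nlGraph d k L M₀ Ω).induce (nlPts d k L M₀ Ω)) (fun v => nlLevel k L M₀ Ω v) N := by
  have hL1 : (1 : ℝ) ≤ L := by exact_mod_cast hL
  have hN' : (N : ℝ) + d * M₀ ≤ R * M₀ := by exact_mod_cast hN
  exact levelGap_of_metric (ℓ := fun j => (L : ℝ) ^ j) (fun a b hab => pow_le_pow_right₀ hL1 hab) (nl_bondScale hL)
    (nl_zoneSep hL hnest hsep) (by linarith)

/-- Every chain of bonds of `nlGraph` from a point of T stays in T and is a chain of the sub-graph induced on T, of the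
same number of bonds. [folklore] -/
theorem nl_liftWalk {u v : Site d} (p : (nlGraph d k L M₀ Ω).Walk u v) (hu : u ∈ nlPts d k L M₀ Ω) :
    ∃ hv : v ∈ nlPts d k L M₀ Ω,
      ∃ q : ((nlGraph d k L M₀ Ω).induce (nlPts d k L M₀ Ω)).Walk ⟨u, hu⟩ ⟨v, hv⟩, q.length = p.length := by
  induction p with
  | nil => exact ⟨hu, SimpleGraph.Walk.nil, rfl⟩
  | @cons a b c hadj p ih =>
    have hb : b ∈ nlPts d k L M₀ Ω := by
      have h := hadj
      rw [nlGraph, SimpleGraph.fromRel_adj] at h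
      obtain ⟨-, h | h⟩ := h
      · exact (mem_nlPts_of_rel h).2
      · exact (mem_nlPts_of_rel h).1
    obtain ⟨hv, q, hq⟩ := ih hb
    have hadj' : ((nlGraph d k L M₀ Ω).induce (nlPts d k L M₀ Ω)).Adj ⟨a, hu⟩ ⟨b, hb⟩ :=
      SimpleGraph.comap_adj.2 hadj
    exact ⟨hv, SimpleGraph.Walk.cons hadj' q, by rw [SimpleGraph.Walk.length_cons, SimpleGraph.Walk.length_cons, hq]⟩

/-- The sub-graph induced on T is connected (L ≥ 1, M₀ ≥ 1, nesting, cube unions; T ∋ x non-empty) — input (α) of §12f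
transported. [folklore] -/
theorem nl_induce_connected (hL : 1 ≤ L) (hM₀ : 1 ≤ M₀) (hnest : Nested k Ω) (hcube : CubeUnions k L M₀ Ω)
    {x : Site d} (hx : x ∈ nlPts d k L M₀ Ω) : ((nlGraph d k L M₀ Ω).induce (nlPts d k L M₀ Ω)).Connected := by
  refine (SimpleGraph.connected_iff _).2 ⟨fun u v => ?_, ⟨⟨x, hx⟩⟩⟩
  obtain ⟨p⟩ := (nl_reachable_dist hL hM₀ hnest hcube u.2 v.2).1
  obtain ⟨hv, q, -⟩ := nl_liftWalk p u.2
  exact ⟨q⟩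

/-- The distance in the induced sub-graph IS the distance of `nlGraph` between points of T. [folklore] -/
theorem nl_induce_dist_eq {u v : Site d} (hu : u ∈ nlPts d k L M₀ Ω) (hv : v ∈ nlPts d k L M₀ Ω)
    (h : (nlGraph d k L M₀ Ω).Reachable u v) :
    ((nlGraph d k L M₀ Ω).induce (nlPts d k L M₀ Ω)).dist ⟨u, hu⟩ ⟨v, hv⟩ = (nlGraph d k L M₀ Ω).dist u v := by
  obtain ⟨p, hp⟩ := h.exists_walk_length_eq_dist
  obtain ⟨hv', q, hq⟩ := nl_liftWalk p hu
  refine le_antisymm ((SimpleGraph.dist_le q).trans (by rw [hq, hp])) ?_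
  obtain ⟨q', hq'⟩ := q.reachable.exists_walk_length_eq_dist
  have h' := SimpleGraph.dist_le (q'.map (SimpleGraph.Embedding.induce (nlPts d k L M₀ Ω)).toHom)
  rwa [SimpleGraph.Walk.length_map, hq'] at h'

/-- **The level-distance bound behind (2.60) in the nested model** (L ≥ 1, M₀ ≥ 1, nesting (2.1), cube unions, the
separation clause of (2.2) as `L1Sep` with the integer R, and N + d·M₀ ≤ R·M₀): for any two points x, x′ of T,
N·max{|level x − level x′| − 1, 0} ≤ d(x, x′) — so e^{−αδ₀d(x,x′)} ≤ e^{−αδ₀N max{|j−j′|−1,0}} for αδ₀ ≥ 0, the shape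
of (2.60) *"e^{−αδ₀d(y,y′)} ≤ e^{−αδ₀RM max{|j−j′|−1,0}}, y ∈ Λ_j, y′ ∈ Λ_{j′}"* with N in place of RM (the collar
width d·M₀ lost; in the dictionary M = M₀L the printed threshold RM·L^jη of (2.2) is `L1Sep` with R·L in place of R).
The siblings' `levelGap_dist_real` BY NAME on the induced sub-graph + `nl_induce_dist_eq`; nothing printed asserted.
[folklore] -/
theorem nl_levelGap_dist (hL : 1 ≤ L) (hM₀ : 1 ≤ M₀) (hnest : Nested k Ω) (hcube : CubeUnions k L M₀ Ω) {R : ℕ}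
    (hsep : L1Sep k L M₀ R Ω) {N : ℕ} (hN : N + d * M₀ ≤ R * M₀) {x x' : Site d} (hx : x ∈ nlPts d k L M₀ Ω)
    (hx' : x' ∈ nlPts d k L M₀ Ω) :
    (N : ℝ) * max (|(nlLevel k L M₀ Ω x : ℝ) - nlLevel k L M₀ Ω x'| - 1) 0 ≤ ((nlGraph d k L M₀ Ω).dist x x' : ℝ) := by
  have h := levelGap_dist_real (nl_induce_connected hL hM₀ hnest hcube hx) (nl_levelGap hL hnest hsep hN)
    ⟨x, hx⟩ ⟨x', hx'⟩
  rw [nl_induce_dist_eq hx hx' (nl_reachable_dist hL hM₀ hnest hcube hx hx').1] at h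
  exact h

/-- The exponential form: e^{−αδ₀·d(x,x′)} ≤ e^{−αδ₀·N·max{|level x − level x′| − 1, 0}} for αδ₀ ≥ 0 (hypotheses of
`nl_levelGap_dist`) — the shape of (2.60) in the model, N + d·M₀ ≤ R·M₀. [folklore] -/
theorem nl_exp_le_260 (hL : 1 ≤ L) (hM₀ : 1 ≤ M₀) (hnest : Nested k Ω) (hcube : CubeUnions k L M₀ Ω) {R : ℕ}
    (hsep : L1Sep k L M₀ R Ω) {N : ℕ} (hN : N + d * M₀ ≤ R * M₀) {α δ₀ : ℝ} (hαδ : 0 ≤ α * δ₀) {x x' : Site d}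
    (hx : x ∈ nlPts d k L M₀ Ω) (hx' : x' ∈ nlPts d k L M₀ Ω) :
    Real.exp (-(α * δ₀ * ((nlGraph d k L M₀ Ω).dist x x' : ℝ))) ≤
      Real.exp (-(α * δ₀ * (N * max (|(nlLevel k L M₀ Ω x : ℝ) - nlLevel k L M₀ Ω x'| - 1) 0))) := by
  have h := nl_levelGap_dist hL hM₀ hnest hcube hsep hN hx hx'
  exact Real.exp_le_exp.2 (by nlinarith [mul_le_mul_of_nonneg_left h hαδ])

/-- A SHIFTED coordinate half-space {M·c ≤ x_μ} (threshold a multiple of the block side) is a cube union: a block meeting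
it has M·a_μ + M − 1 ≥ M·c, so a_μ ≥ c and the whole block has x_μ ≥ M·a_μ ≥ M·c (the first leaf's
`isCubeUnion_halfspace` is c = 0). [folklore] -/
theorem isCubeUnion_halfspace_mul (M : ℕ) (μ : Fin d) (c : ℤ) : IsCubeUnion M {x : Site d | (M : ℤ) * c ≤ x μ} := by
  intro a x hx hxc z hz
  have hxc' : (M : ℤ) * c ≤ x μ := hxc
  obtain ⟨-, h2⟩ := mem_blockBox_iff.1 hx μ
  obtain ⟨h3, -⟩ := mem_blockBox_iff.1 hz μ
  show (M : ℤ) * c ≤ z μ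
  have h4 : 0 < (M : ℤ) * (a μ - c + 1) := by rw [mul_add, mul_sub, mul_one]; omega
  have h5 : 0 < a μ - c + 1 := pos_of_mul_pos_right h4 (Int.natCast_nonneg M)
  have h6 : (M : ℤ) * c ≤ (M : ℤ) * a μ := mul_le_mul_of_nonneg_left (by omega) (Int.natCast_nonneg M)
  omega

/-- THE SEPARATED TOWER (non-vacuity witness of §15): Ω_m = {c_m ≤ x_μ} for thresholds c : ℕ → ℕ. [folklore] -/
def sepTower (μ : Fin d) (c : ℕ → ℕ) : ℕ → Set (Site d) := fun m => {x | (c m : ℤ) ≤ x μ}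

/-- Increasing thresholds give a nested tower. [folklore] -/
theorem sepTower_nested (μ : Fin d) {c : ℕ → ℕ} (hc : Monotone c) (k : ℕ) : Nested k (sepTower μ c) := by
  intro m _ _ x hx
  have hx' : (c (m + 1) : ℤ) ≤ x μ := hx
  have hcm : (c m : ℤ) ≤ c (m + 1) := by exact_mod_cast hc (Nat.le_succ m)
  show (c m : ℤ) ≤ x μ
  omega

/-- Thresholds divisible by the block sides M₀L^m give cube unions. [folklore] -/
theorem sepTower_cubeUnions (μ : Fin d) {c : ℕ → ℕ} (hc : ∀ m, 1 ≤ m → m ≤ k → M₀ * L ^ m ∣ c m) :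
    CubeUnions k L M₀ (sepTower μ c) := by
  intro m hm hmk
  obtain ⟨c', hc'⟩ := hc m hm hmk
  have h : sepTower μ c m = {x : Site d | ((M₀ * L ^ m : ℕ) : ℤ) * (c' : ℤ) ≤ x μ} := by
    ext x
    show (c m : ℤ) ≤ x μ ↔ ((M₀ * L ^ m : ℕ) : ℤ) * (c' : ℤ) ≤ x μ
    rw [hc']; push_cast; exact Iff.rfl
  rw [h]
  exact isCubeUnion_halfspace_mul _ μ _

/-- Gaps c_{j+1} − c_j ≥ R·M₀L^j (1 ≤ j < k) give the separation clause `L1Sep` with the integer R: a point with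
x_μ < c_j and a point with x′_μ ≥ c_{j+1} differ by more than R·M₀L^j in the μ-th coordinate alone. [folklore] -/
theorem sepTower_l1Sep (μ : Fin d) {R : ℕ} {c : ℕ → ℕ} (hc : ∀ j, 1 ≤ j → j < k → c j + R * (M₀ * L ^ j) ≤ c (j + 1)) :
    L1Sep k L M₀ R (sepTower μ c) := by
  intro j hj hjk x x' hx hx'
  have hx1 : ¬ ((c j : ℤ) ≤ x μ) := hx
  have hx2 : (c (j + 1) : ℤ) ≤ x' μ := hx'
  have h1 := natAbs_apply_sub_le_latL1Dist x x' μ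
  obtain ⟨D, hD⟩ : ∃ D, D = R * (M₀ * L ^ j) := ⟨_, rfl⟩
  have h2 : (c j : ℤ) + D ≤ c (j + 1) := by rw [hD]; exact_mod_cast hc j hj hjk
  rw [← hD]
  omega

/-- The thresholds of the witness: c_m = m·R·M₀·L^k (increasing; divisible by every M₀L^m, m ≤ k; gaps R·M₀L^k ≥
R·M₀L^j). [folklore] -/
def sepThr (k L M₀ R : ℕ) (m : ℕ) : ℕ := m * (R * (M₀ * L ^ k))

/-- **NON-VACUITY of §15** (L ≥ 1, M₀ ≥ 1, any k, any R, any direction μ): the separated tower with the thresholds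
`sepThr` is nested, a tower of cube unions and satisfies `L1Sep` with the integer R; the point −e_μ is a point of T of
LEVEL 0 and the point L^k·(kRM₀)·e_μ is a point of T of LEVEL k — so for k ≥ 2 the bound of `nl_levelGap_dist` has
content (next corollary). [folklore] -/
theorem sepTower_witness (hL : 1 ≤ L) (hM₀ : 1 ≤ M₀) (μ : Fin d) (R : ℕ) :
    Nested k (sepTower μ (sepThr k L M₀ R)) ∧ CubeUnions k L M₀ (sepTower μ (sepThr k L M₀ R)) ∧
      L1Sep k L M₀ R (sepTower μ (sepThr k L M₀ R)) ∧
      (Pi.single μ (-1) : Site d) ∈ nlPts d k L M₀ (sepTower μ (sepThr k L M₀ R)) ∧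
      nlLevel k L M₀ (sepTower μ (sepThr k L M₀ R)) (Pi.single μ (-1)) = 0 ∧
      scalePt (L ^ k) (Pi.single μ ((k * (R * M₀) : ℕ) : ℤ)) ∈ nlPts d k L M₀ (sepTower μ (sepThr k L M₀ R)) ∧
      nlLevel k L M₀ (sepTower μ (sepThr k L M₀ R)) (scalePt (L ^ k) (Pi.single μ ((k * (R * M₀) : ℕ) : ℤ))) = k := by
  have hpos : 0 < M₀ * L ^ k := Nat.mul_pos (by omega) (Nat.pow_pos hL)
  -- the level-0 point
  have h0 : (Pi.single μ (-1) : Site d) ∈ nlPtsAt k L M₀ (sepTower μ (sepThr k L M₀ R)) 0 := by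
    refine ⟨⟨Pi.single μ (-1), by rw [pow_zero, scalePt_one]⟩, fun h => absurd h (by omega), fun _ =>
      ⟨Pi.single μ (-1), ?_, by rw [supDist_self]; exact Nat.zero_le _⟩⟩
    show ¬ ((sepThr k L M₀ R 1 : ℤ) ≤ (Pi.single μ (-1 : ℤ) : Site d) μ)
    rw [Pi.single_eq_same]
    have : (0 : ℤ) ≤ (sepThr k L M₀ R 1 : ℤ) := Int.natCast_nonneg _
    omega
  -- the level-k point
  have hk : scalePt (L ^ k) (Pi.single μ ((k * (R * M₀) : ℕ) : ℤ)) ∈ nlPtsAt k L M₀ (sepTower μ (sepThr k L M₀ R)) k := by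
    refine ⟨⟨_, rfl⟩, fun _ => ?_, fun h => absurd h (lt_irrefl k)⟩
    show (sepThr k L M₀ R k : ℤ) ≤ scalePt (L ^ k) (Pi.single μ ((k * (R * M₀) : ℕ) : ℤ)) μ
    rw [scalePt_apply, Pi.single_eq_same, sepThr]
    push_cast
    nlinarith [mul_comm ((L : ℤ) ^ k) ((k : ℤ) * (R * M₀))]
  refine ⟨sepTower_nested μ (fun a b hab => Nat.mul_le_mul_right _ hab) k,
    sepTower_cubeUnions μ fun m _ hmk => ?_, sepTower_l1Sep μ fun j _ hjk => ?_, ⟨0, Nat.zero_le _, h0⟩, ?_,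
    ⟨k, le_rfl, hk⟩, le_antisymm (nlLevel_le _) (le_nlLevel le_rfl hk)⟩
  · -- divisibility: M₀L^m ∣ m·R·M₀·L^k
    obtain ⟨n, hn⟩ := Nat.exists_eq_add_of_le hmk
    refine ⟨m * R * L ^ n, ?_⟩
    rw [sepThr, hn, pow_add]; ring
  · -- gaps: c_j + R·M₀L^j ≤ c_{j+1} = c_j + R·M₀L^k
    have hpow : L ^ j ≤ L ^ k := Nat.pow_le_pow_right hL (by omega)
    have h1 : R * (M₀ * L ^ j) ≤ R * (M₀ * L ^ k) := Nat.mul_le_mul_left _ (Nat.mul_le_mul_left _ hpow)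
    have h2 : sepThr k L M₀ R (j + 1) = sepThr k L M₀ R j + R * (M₀ * L ^ k) := by rw [sepThr, sepThr]; ring
    omega
  · -- the level of −e_μ is 0: a point of level j ≥ 1 lies in Ω_j = {c_j ≤ x_μ}, c_j ≥ 0 > −1
    have hmem := mem_nlPtsAt_nlLevel (k := k) (L := L) (M₀ := M₀) (Ω := sepTower μ (sepThr k L M₀ R))
      ⟨0, Nat.zero_le _, h0⟩
    by_contra hne
    have h1 : 1 ≤ nlLevel k L M₀ (sepTower μ (sepThr k L M₀ R)) (Pi.single μ (-1)) := Nat.one_le_iff_ne_zero.2 hne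
    have h2 : (sepThr k L M₀ R (nlLevel k L M₀ (sepTower μ (sepThr k L M₀ R)) (Pi.single μ (-1))) : ℤ) ≤
        (Pi.single μ (-1 : ℤ) : Site d) μ := hmem.2.1 h1
    rw [Pi.single_eq_same] at h2
    have h3 : (0 : ℤ) ≤ (sepThr k L M₀ R (nlLevel k L M₀ (sepTower μ (sepThr k L M₀ R)) (Pi.single μ (-1))) : ℤ) :=
      Int.natCast_nonneg _
    omega

/-- **§15 has content**: in the separated tower (L ≥ 1, M₀ ≥ 1, any k, N + d·M₀ ≤ R·M₀) the level-0 point −e_μ and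
the level-k point L^k·(kRM₀)·e_μ are joined and at least N·(k − 1) bonds apart. [folklore] -/
theorem sepTower_levelGap_dist (hL : 1 ≤ L) (hM₀ : 1 ≤ M₀) (μ : Fin d) {R N : ℕ} (hN : N + d * M₀ ≤ R * M₀) :
    (nlGraph d k L M₀ (sepTower μ (sepThr k L M₀ R))).Reachable (Pi.single μ (-1))
        (scalePt (L ^ k) (Pi.single μ ((k * (R * M₀) : ℕ) : ℤ))) ∧
      (N : ℝ) * ((k : ℝ) - 1) ≤ ((nlGraph d k L M₀ (sepTower μ (sepThr k L M₀ R))).dist (Pi.single μ (-1))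
        (scalePt (L ^ k) (Pi.single μ ((k * (R * M₀) : ℕ) : ℤ))) : ℝ) := by
  obtain ⟨hnest, hcube, hsep, h0, hl0, hk, hlk⟩ := sepTower_witness (k := k) hL hM₀ μ R
  refine ⟨(nl_reachable_dist hL hM₀ hnest hcube h0 hk).1, ?_⟩
  have h := nl_levelGap_dist hL hM₀ hnest hcube hsep hN h0 hk
  rw [hl0, hlk, Nat.cast_zero, zero_sub, abs_neg, Nat.abs_cast] at h
  exact (mul_le_mul_of_nonneg_left (le_max_left _ _) (Nat.cast_nonneg N)).trans h

/-- **WHY N + d·M₀ ≤ R·M₀ AND NOT N ≤ R·M₀ — the collar, LOCATED** (L ≥ 2, M₀ ≥ 1, k ≥ 1, any R): in print Λ_j ∩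
Ω_{j+1} = ∅ by (2.3), the sibling's dictionary `B6LevelGapMetric.ZonesOf` (x ∈ Ω_j ↔ j ≤ level x) holds and its
`setSep_iff_zoneSep` turns the set form of (2.2) into (sep) with the SAME constant; in this model the level-j lattice
reaches ONE big block into Ω_{j+1} (the parent's §8 zone convention), so `ZonesOf` FAILS on T — witness: in the
separated tower the η-point (c₁ + 1)·e_μ lies in Ω₁ but is a point of level 0 only (c₁ + 1 is prime to L) — and
`nl_zoneSep` pays the collar's ℓ¹-width d·M₀L^i out of R·M₀L^i.  Whether the loss is sharp is NOT decided. [folklore] -/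
theorem sepTower_not_zonesOf (hL : 2 ≤ L) (hM₀ : 1 ≤ M₀) (hk : 1 ≤ k) (μ : Fin d) (R : ℕ) :
    ¬ ZonesOf (fun j => {v : nlPts d k L M₀ (sepTower μ (sepThr k L M₀ R)) | (v : Site d) ∈ sepTower μ (sepThr k L M₀ R) j})
        (fun v => nlLevel k L M₀ (sepTower μ (sepThr k L M₀ R)) v) := by
  set Ω := sepTower μ (sepThr k L M₀ R) with hΩ
  set x : Site d := Pi.single μ ((sepThr k L M₀ R 1 : ℤ) + 1) with hxdef
  have hxμ : x μ = (sepThr k L M₀ R 1 : ℤ) + 1 := by rw [hxdef, Pi.single_eq_same]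
  -- x is a point of level 0: an η-point within sup-distance 2 ≤ M₀L of the point (c₁ − 1)·e_μ of Ω₁^c
  have h0 : x ∈ nlPtsAt k L M₀ Ω 0 := by
    refine ⟨⟨x, by rw [pow_zero, scalePt_one]⟩, fun h => absurd h (by omega), fun _ =>
      ⟨Pi.single μ ((sepThr k L M₀ R 1 : ℤ) - 1), ?_, ?_⟩⟩
    · show ¬ ((sepThr k L M₀ R 1 : ℤ) ≤ (Pi.single μ ((sepThr k L M₀ R 1 : ℤ) - 1) : Site d) μ)
      rw [Pi.single_eq_same]
      omega
    · have h2 : 2 ≤ M₀ * L ^ (0 + 1) := by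
        rw [zero_add, pow_one]; exact le_trans hL (Nat.le_mul_of_pos_left L hM₀)
      refine (supDist_le_iff.2 fun j => ?_).trans h2
      by_cases hj : j = μ
      · subst hj; rw [hxdef, Pi.single_eq_same, Pi.single_eq_same]; omega
      · rw [hxdef, Pi.single_eq_of_ne hj, Pi.single_eq_of_ne hj]; simp
  have hxT : x ∈ nlPts d k L M₀ Ω := ⟨0, Nat.zero_le _, h0⟩
  -- its level is 0: a point of level j ≥ 1 is an L^j-lattice point, so L ∣ x_μ = c₁ + 1, while L ∣ c₁ = R·M₀·L^k
  have hlvl : nlLevel k L M₀ Ω x = 0 := by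
    have hmem := mem_nlPtsAt_nlLevel (k := k) (L := L) (M₀ := M₀) (Ω := Ω) hxT
    by_contra hne
    have h1 : 1 ≤ nlLevel k L M₀ Ω x := Nat.one_le_iff_ne_zero.2 hne
    obtain ⟨⟨a, ha⟩, -, -⟩ := hmem
    have h2 : x μ = ((L ^ nlLevel k L M₀ Ω x : ℕ) : ℤ) * a μ := by rw [ha, scalePt_apply, ← ha]
    have hdvd1 : (L : ℤ) ∣ x μ := by
      rw [h2]; push_cast
      exact dvd_mul_of_dvd_left (dvd_pow_self _ (by omega)) _
    have hdvd2 : (L : ℤ) ∣ (sepThr k L M₀ R 1 : ℤ) := by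
      obtain ⟨n, hn⟩ := Nat.exists_eq_add_of_le hk
      refine ⟨(R * (M₀ * L ^ n) : ℕ), ?_⟩
      rw [sepThr, hn]; push_cast; ring
    have hdvd3 : (L : ℤ) ∣ 1 := by
      have h := dvd_sub hdvd1 hdvd2
      rwa [hxμ, add_sub_cancel_left] at h
    have hL1 : (L : ℤ) = 1 := Int.eq_one_of_dvd_one (Int.natCast_nonneg L) hdvd3
    omega
  -- but x ∈ Ω₁, so `ZonesOf` would give 1 ≤ level x = 0
  intro hZ
  have hxΩ : (⟨x, hxT⟩ : nlPts d k L M₀ Ω) ∈ {v : nlPts d k L M₀ Ω | (v : Site d) ∈ Ω 1} := by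
    show (sepThr k L M₀ R 1 : ℤ) ≤ x μ
    rw [hxμ]; omega
  have h := (hZ ⟨x, hxT⟩ 1).1 hxΩ
  have h' : 1 ≤ nlLevel k L M₀ Ω x := h
  omega

/-! ### 16. The separation clause is NECESSARY for the walk form (appendix to §15, v1.3): over the tower of equal
half-spaces of §12m — nested, cube unions, separation clause violated — the point −e_μ OF LEVEL 0 and the point 0 OF
LEVEL k are ONE bond apart, so `LevelGap … N` fails for every N ≥ 1 once k ≥ 2.  With §15: in the model the walk form
of (2.2) and the bound behind (2.60) HOLD under `L1Sep` (N + d·M₀ ≤ R·M₀) and FAIL without it; and in the dictionary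
M = M₀L the printed threshold of (2.2) is `L1Sep` with R·L, under which the bound holds with N ≤ RM − dM₀, i.e. the
collar costs the fraction d∕(RL) of the printed constant RM. [folklore] -/

/-- Over the tower of equal half-spaces the origin has level k (it is a point of every level; L, M₀ ≥ 1). [folklore] -/
theorem hsTower_nlLevel_zero (hL : 1 ≤ L) (hM₀ : 1 ≤ M₀) (μ : Fin d) : nlLevel k L M₀ (hsTower μ) 0 = k :=
  le_antisymm (nlLevel_le _) (le_nlLevel le_rfl (zero_mem_nlPtsAt_hsTower hL hM₀ μ k))

/-- Over the tower of equal half-spaces the point −D·e_μ (D ≥ 1) has level 0 (it lies outside Ω₁ = … = Ω_k). [folklore] -/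
theorem hsTower_nlLevel_negPt (μ : Fin d) {D : ℕ} (hD : 1 ≤ D) : nlLevel k L M₀ (hsTower μ) (Pi.single μ (-(D : ℤ))) = 0 := by
  have hmem := mem_nlPtsAt_nlLevel (k := k) (L := L) (M₀ := M₀) (Ω := hsTower μ)
    ⟨0, Nat.zero_le _, negPt_mem_nlPtsAt_hsTower (k := k) (L := L) (M₀ := M₀) μ hD⟩
  by_contra hne
  have h1 : 1 ≤ nlLevel k L M₀ (hsTower μ) (Pi.single μ (-(D : ℤ))) := Nat.one_le_iff_ne_zero.2 hne
  have h2 : (0 : ℤ) ≤ (Pi.single μ (-(D : ℤ)) : Site d) μ := hmem.2.1 h1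
  rw [Pi.single_eq_same] at h2
  omega

/-- **The walk form of (2.2) FAILS without the separation clause** (L ≥ 1, M₀ ≥ 1, k ≥ 2, any N ≥ 1): over the tower of
equal half-spaces (`hsTower_nested`, `hsTower_cubeUnions`; `L1Sep` violated for R ≥ 1) the sub-graph of `nlGraph`
induced on T does NOT satisfy `LevelGap … N` — the η-bond {−e_μ, 0} joins a point of level 0 to a point of level
k ≥ 2.  Contrast `nl_levelGap` (§15). [folklore] -/
theorem hsTower_not_levelGap (hL : 1 ≤ L) (hM₀ : 1 ≤ M₀) (hk : 2 ≤ k) (μ : Fin d) {N : ℕ} (hN : 1 ≤ N) :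
    ¬ LevelGap ((nlGraph d k L M₀ (hsTower μ)).induce (nlPts d k L M₀ (hsTower μ)))
        (fun v => nlLevel k L M₀ (hsTower μ) v) N := by
  obtain ⟨-, h0T, hpt, -, -, hdist⟩ :=
    hsTower_literal_witness (k := k) hL hM₀ μ (i := k) le_rfl (D := 1) le_rfl
  have hpT : (Pi.single μ (-((1 : ℕ) : ℤ)) : Site d) ∈ nlPts d k L M₀ (hsTower μ) := ⟨0, Nat.zero_le _, hpt⟩
  have hadj : (nlGraph d k L M₀ (hsTower μ)).Adj 0 (Pi.single μ (-((1 : ℕ) : ℤ))) :=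
    SimpleGraph.dist_eq_one_iff_adj.1 hdist
  have hadj' : ((nlGraph d k L M₀ (hsTower μ)).induce (nlPts d k L M₀ (hsTower μ))).Adj
      ⟨Pi.single μ (-((1 : ℕ) : ℤ)), hpT⟩ ⟨0, h0T⟩ := SimpleGraph.comap_adj.2 hadj.symm
  have hlv0 := hsTower_nlLevel_negPt (k := k) (L := L) (M₀ := M₀) μ (D := 1) le_rfl
  have hlvk := hsTower_nlLevel_zero (k := k) hL hM₀ μ
  intro hgap
  have h := hgap (i := 1) (u := ⟨Pi.single μ (-((1 : ℕ) : ℤ)), hpT⟩) (x := ⟨0, h0T⟩)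
    (show nlLevel k L M₀ (hsTower μ) (Pi.single μ (-((1 : ℕ) : ℤ))) < 1 by rw [hlv0]; exact Nat.one_pos)
    (show 1 < nlLevel k L M₀ (hsTower μ) 0 by rw [hlvk]; exact hk)
    (SimpleGraph.Walk.cons hadj' SimpleGraph.Walk.nil)
  rw [SimpleGraph.Walk.length_cons, SimpleGraph.Walk.length_nil] at h
  omega

/-- **The bound behind (2.60) with the PRINTED threshold of (2.2)** (dictionary M = M₀L, η = 1: the printed
*"(L^jη)^{−1} dist(Ω_j^c, Ω_{j+1}) > RM"* is dist > R·M₀L·L^j, i.e. `L1Sep` with the integer R·L; L ≥ 1, M₀ ≥ 1,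
nesting, cube unions): N·max{|level x − level x′| − 1, 0} ≤ d(x, x′) on T for every N with N + d·M₀ ≤ R·M, M = M₀L —
the printed constant RM of (2.60) less the collar d·M₀ = (d∕L)·M.  Nothing printed asserted; which R Bałaban fixes
is not determined here. [folklore] -/
theorem nl_levelGap_dist_printedR (hL : 1 ≤ L) (hM₀ : 1 ≤ M₀) (hnest : Nested k Ω) (hcube : CubeUnions k L M₀ Ω)
    {R : ℕ} (hsep : L1Sep k L M₀ (R * L) Ω) {N : ℕ} (hN : N + d * M₀ ≤ R * (M₀ * L)) {x x' : Site d}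
    (hx : x ∈ nlPts d k L M₀ Ω) (hx' : x' ∈ nlPts d k L M₀ Ω) :
    (N : ℝ) * max (|(nlLevel k L M₀ Ω x : ℝ) - nlLevel k L M₀ Ω x'| - 1) 0 ≤ ((nlGraph d k L M₀ Ω).dist x x' : ℝ) :=
  nl_levelGap_dist hL hM₀ hnest hcube hsep (by rw [Nat.mul_assoc, Nat.mul_comm L M₀]; exact hN) hx hx'

/-! ### 17. PRINT'S LEVEL CONVENTION RESTORES THE FULL CONSTANT R·M₀ (appendix to §15–§16, v1.4).  §15 measured
levels by `nlLevel` — the greatest j with x a point OF LEVEL j of the model, under which a level-j lattice point one big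
block inside Ω_{j+1} still counts as level j (the closed-collar convention) — and lost the collar d·M₀ from R·M₀.  With
the PRINTED convention Λ_j = Ω_j ∖ Ω_{j+1} ((2.1), (2.3) p. 224 — the level of a point is the greatest j ≤ k with
x ∈ Ω_j, `pzLevel`; the siblings' reading `ZonesOf` of (2.3)–(2.4) then HOLDS, `pz_zonesOf`), (len) holds on the whole
of `nlGraph` (`nl_bondScale_pz`), the separation clause `L1Sep` with the integer R IS (sep) ∕ the set-level (2.2) with
the FULL constant R·M₀ (`nl_zoneSep_pz`, `nl_setSep_pz`: no collar, no cube unions, all of ℤ^d), so the walk form of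
(2.2) holds for every N ≤ R·M₀ on the whole bond graph (`nl_levelGap_pz`) and the bound behind (2.60) reads
N·max{|zone x − zone x′| − 1, 0} ≤ d(x, x′) on T for N ≤ R·M₀ (`nl_levelGap_dist_pz`) — under the printed threshold
(`L1Sep` with R·L, M = M₀L) for every N ≤ R·M, i.e. with the PRINTED constant RM of (2.60) (`nl_levelGap_dist_pz_printedR`,
`nl_exp_le_260_pz_printedR`).  The two conventions differ by at most one level under `L1Sep` with R ≥ d
(`nlLevel_le_pzLevel`, `pzLevel_le_nlLevel_succ`), and WITHOUT the separation clause the walk form fails under print's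
convention too (`hsTower_not_levelGap_pz`).  So the loss located in §15 is the LEVEL CONVENTION's, not the geometry's;
nothing printed is asserted (the model is not Bałaban's T: no torus, no 𝒟, Ω₀ plays no role). [folklore] -/

/-- PRINT'S LEVEL of a point ((2.1), (2.3) p. 224, Λ_j = Ω_j ∖ Ω_{j+1}): the greatest j ≤ k with x ∈ Ω_j (0 if x lies
in none of Ω₁, …, Ω_k; Ω₀ plays no role, as in `nlOK`). [folklore] -/
noncomputable def pzLevel (k : ℕ) (Ω : ℕ → Set (Site d)) (x : Site d) : ℕ := by
  classical exact Nat.findGreatest (fun j => x ∈ Ω j) k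

/-- Print's level is at most k. [folklore] -/
theorem pzLevel_le (x : Site d) : pzLevel k Ω x ≤ k := by
  classical
  unfold pzLevel
  exact Nat.findGreatest_le _

/-- A point of Ω_j, j ≤ k, has print's level ≥ j. [folklore] -/
theorem le_pzLevel {j : ℕ} (hj : j ≤ k) {x : Site d} (hx : x ∈ Ω j) : j ≤ pzLevel k Ω x := by
  classical
  unfold pzLevel
  exact Nat.le_findGreatest hj hx

/-- A point of print's level < j ≤ k is not in Ω_j. [folklore] -/
theorem not_mem_of_pzLevel_lt {j : ℕ} {x : Site d} (hlt : pzLevel k Ω x < j) (hjk : j ≤ k) : x ∉ Ω j := by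
  classical
  unfold pzLevel at hlt
  exact Nat.findGreatest_is_greatest hlt hjk

/-- Under nesting (2.1) a point of print's level ≥ j ≥ 1 lies in Ω_j. [folklore] -/
theorem mem_of_le_pzLevel (hnest : Nested k Ω) {j : ℕ} (hj1 : 1 ≤ j) {x : Site d} (hj : j ≤ pzLevel k Ω x) :
    x ∈ Ω j := by
  classical
  have hp : x ∈ Ω (pzLevel k Ω x) := by
    have hne : pzLevel k Ω x ≠ 0 := by omega
    unfold pzLevel at hne ⊢
    exact Nat.findGreatest_of_ne_zero rfl hne
  exact hnest.subset hj1 hj (pzLevel_le x) hp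

/-- PRINT'S DOMAINS read with the conventions of `nlOK` (no condition at level 0, nothing beyond level k): Ω′₀ = all of
ℤ^d, Ω′_j = Ω_j for 1 ≤ j ≤ k, Ω′_j = ∅ for j > k. [folklore] -/
def pzDom (k : ℕ) (Ω : ℕ → Set (Site d)) (j : ℕ) : Set (Site d) := {x | 1 ≤ j → j ≤ k ∧ x ∈ Ω j}

/-- **(2.3)–(2.4) in the model under print's convention** (nesting (2.1)): x ∈ Ω′_j ↔ j ≤ print's level of x — the
siblings' `ZonesOf`, which FAILS for the model's own level `nlLevel` (`sepTower_not_zonesOf`, §15). [folklore] -/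
theorem pz_zonesOf (hnest : Nested k Ω) : ZonesOf (pzDom k Ω) (pzLevel k Ω) := by
  intro x j
  constructor
  · intro h
    have h' : 1 ≤ j → j ≤ k ∧ x ∈ Ω j := h
    rcases Nat.eq_zero_or_pos j with rfl | hj
    · exact Nat.zero_le _
    · obtain ⟨hjk, hx⟩ := h' hj
      exact le_pzLevel hjk hx
  · intro h
    show 1 ≤ j → j ≤ k ∧ x ∈ Ω j
    intro hj
    exact ⟨h.trans (pzLevel_le x), mem_of_le_pzLevel hnest hj h⟩

/-- The model's level is at most print's: a point of level i ≥ 1 lies in Ω_i. [folklore] -/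
theorem nlLevel_le_pzLevel {x : Site d} (hx : x ∈ nlPts d k L M₀ Ω) : nlLevel k L M₀ Ω x ≤ pzLevel k Ω x := by
  rcases Nat.eq_zero_or_pos (nlLevel k L M₀ Ω x) with h | h
  · rw [h]; exact Nat.zero_le _
  · exact le_pzLevel (nlLevel_le x) ((mem_nlPtsAt_nlLevel hx).2.1 h)

/-- … and print's level is at most the model's + 1 under nesting and the separation clause with R ≥ d: a point of
level i < k lies within sup-distance M₀L^{i+1}, hence ℓ¹-distance ≤ d·M₀L^{i+1}, of a point of Ω_{i+1}^c, so by `L1Sep`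
(points of Ω_{i+2} are MORE than R·M₀L^{i+1} from Ω_{i+1}^c in ℓ¹) it is not in Ω_{i+2}.  The two conventions differ
exactly on the collars. [folklore] -/
theorem pzLevel_le_nlLevel_succ (hnest : Nested k Ω) {R : ℕ} (hsep : L1Sep k L M₀ R Ω) (hRd : d ≤ R) {x : Site d}
    (hx : x ∈ nlPts d k L M₀ Ω) : pzLevel k Ω x ≤ nlLevel k L M₀ Ω x + 1 := by
  by_contra hlt
  have hlt' : nlLevel k L M₀ Ω x + 1 + 1 ≤ pzLevel k Ω x := by omega
  have hk : nlLevel k L M₀ Ω x + 1 + 1 ≤ k := hlt'.trans (pzLevel_le x)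
  have hxm := mem_nlPtsAt_nlLevel (k := k) (L := L) (M₀ := M₀) (Ω := Ω) hx
  obtain ⟨w, hw, hxw⟩ := nlZone_of_nlPtsAt hxm (by omega)
  have hxΩ : x ∈ Ω (nlLevel k L M₀ Ω x + 1 + 1) := mem_of_le_pzLevel hnest (by omega) hlt'
  have hs := hsep (nlLevel k L M₀ Ω x + 1) (by omega) (by omega) hw hxΩ
  have h1 : latL1Dist w x ≤ d * (M₀ * L ^ (nlLevel k L M₀ Ω x + 1)) := by
    rw [latL1Dist_comm]; exact (latL1Dist_le_mul_supDist _ _).trans (Nat.mul_le_mul_left _ hxw)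
  have h2 : R * (M₀ * L ^ (nlLevel k L M₀ Ω x + 1)) < d * (M₀ * L ^ (nlLevel k L M₀ Ω x + 1)) := lt_of_lt_of_le hs h1
  exact absurd (Nat.lt_of_mul_lt_mul_right h2) (not_lt.2 hRd)

/-- **(len) on the whole of `nlGraph` with print's levels** (`B6LevelGapMetric.BondScale`, L ≥ 1): a level-j bond
{L^j·a, L^j·a′} has ℓ¹-length L^j and, for j ≥ 1, both ends in Ω_j, i.e. of print's level ≥ j. [folklore] -/
theorem nl_bondScale_pz (hL : 1 ≤ L) : BondScale (nlGraph d k L M₀ Ω) (pzLevel k Ω) l1Pos (fun j => (L : ℝ) ^ j) := by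
  have key : ∀ u v : Site d, nlRel d k L M₀ Ω u v →
      dist (l1Pos u) (l1Pos v) ≤ (L : ℝ) ^ min (pzLevel k Ω u) (pzLevel k Ω v) := by
    intro u v h
    obtain ⟨j, hj, a, a', hadj, rfl, rfl, hu, hv⟩ := h
    rw [dist_l1Pos, latL1Dist_scalePt, latL1Dist_eq_one_of_adj hadj, mul_one]
    push_cast
    refine pow_le_pow_right₀ (by exact_mod_cast hL) (le_min ?_ ?_)
    · rcases Nat.eq_zero_or_pos j with rfl | hj1
      · exact Nat.zero_le _
      · exact le_pzLevel hj (hu.1 hj1)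
    · rcases Nat.eq_zero_or_pos j with rfl | hj1
      · exact Nat.zero_le _
      · exact le_pzLevel hj (hv.1 hj1)
  intro u v huv
  rw [nlGraph, SimpleGraph.fromRel_adj] at huv
  obtain ⟨-, h | h⟩ := huv
  · exact key _ _ h
  · rw [dist_comm, min_comm]; exact key _ _ h

/-- **(sep) WITH THE FULL CONSTANT R·M₀ under print's convention** (`B6LevelGapMetric.ZoneSep`; nesting (2.1), the
separation clause of (2.2) as `L1Sep` with the integer R; NO cube unions, NO collar, on all of ℤ^d): zone u < i < zone x
⇒ u ∉ Ω_i and x ∈ Ω_{zone x} ⊆ Ω_{i+1}, so R·M₀·L^i < |u − x|₁ — the printed (2.57) *"(L^{j_{l,l+1}}η)^{−1}|y′_l −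
y_{l+1}| > RM"* in the model with RM ↦ R·M₀ and nothing lost (contrast `nl_zoneSep`: (R − d)·M₀). [folklore] -/
theorem nl_zoneSep_pz (hnest : Nested k Ω) {R : ℕ} (hsep : L1Sep k L M₀ R Ω) :
    ZoneSep (pzLevel k Ω) (fun x : Site d => l1Pos x) (fun j => (L : ℝ) ^ j) ((R : ℝ) * M₀) := by
  intro i u x hui hix
  have hxk := pzLevel_le (k := k) (Ω := Ω) x
  have hui' : u ∉ Ω i := not_mem_of_pzLevel_lt hui (by omega)
  have hxΩ : x ∈ Ω (i + 1) := mem_of_le_pzLevel hnest (by omega) (by omega)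
  have hs := hsep i (by omega) (by omega) hui' hxΩ
  have h2 : ((R : ℝ) * (M₀ * (L : ℝ) ^ i)) < (latL1Dist u x : ℝ) := by exact_mod_cast hs
  show (R : ℝ) * M₀ * (L : ℝ) ^ i < dist (l1Pos u) (l1Pos x)
  rw [dist_l1Pos]
  linarith

/-- **(2.2) AT SET LEVEL with the full constant** (`B6LevelGapMetric.SetSep` for print's domains Ω′, nesting, `L1Sep`
with the integer R): every point outside Ω′_j and every point of Ω′_{j+1} are more than R·M₀·L^j apart in ℓ¹ — by the
siblings' `setSep_iff_zoneSep` under `pz_zonesOf`. [folklore] -/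
theorem nl_setSep_pz (hnest : Nested k Ω) {R : ℕ} (hsep : L1Sep k L M₀ R Ω) :
    SetSep (pzDom k Ω) (fun x : Site d => l1Pos x) (fun j => (L : ℝ) ^ j) ((R : ℝ) * M₀) :=
  (setSep_iff_zoneSep (pz_zonesOf hnest)).2 (nl_zoneSep_pz hnest hsep)

/-- **THE WALK FORM OF (2.2) WITH THE FULL CONSTANT** (`B6Geometry.LevelGap` on the WHOLE bond graph `nlGraph` with
print's levels; L ≥ 1, nesting (2.1), `L1Sep` with the integer R, and every N ≤ R·M₀ — NO cube unions, NO collar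
loss): every chain of bonds of the model from a point of print's level < i to a point of print's level > i has MORE
than N bonds — the siblings' `levelGap_of_metric` BY NAME (contrast `nl_levelGap`: N + d·M₀ ≤ R·M₀). [folklore] -/
theorem nl_levelGap_pz (hL : 1 ≤ L) (hnest : Nested k Ω) {R : ℕ} (hsep : L1Sep k L M₀ R Ω) {N : ℕ}
    (hN : N ≤ R * M₀) : LevelGap (nlGraph d k L M₀ Ω) (pzLevel k Ω) N := by
  have hL1 : (1 : ℝ) ≤ L := by exact_mod_cast hL
  have hN' : (N : ℝ) ≤ R * M₀ := by exact_mod_cast hN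
  exact levelGap_of_metric (ℓ := fun j => (L : ℝ) ^ j) (fun a b hab => pow_le_pow_right₀ hL1 hab)
    (nl_bondScale_pz hL) (nl_zoneSep_pz hnest hsep) hN'

/-- The same on the sub-graph induced on T (a chain there is a chain of `nlGraph` with the same number of bonds). [folklore] -/
theorem nl_levelGap_pz_induce (hL : 1 ≤ L) (hnest : Nested k Ω) {R : ℕ} (hsep : L1Sep k L M₀ R Ω) {N : ℕ}
    (hN : N ≤ R * M₀) :
    LevelGap ((nlGraph d k L M₀ Ω).induce (nlPts d k L M₀ Ω)) (fun v => pzLevel k Ω (v : Site d)) N := by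
  intro i u x hu hx p
  have h := nl_levelGap_pz hL hnest hsep hN (i := i) (u := (u : Site d)) (x := (x : Site d)) hu hx
    (p.map (SimpleGraph.Embedding.induce (nlPts d k L M₀ Ω)).toHom)
  have hlen : (p.map (SimpleGraph.Embedding.induce (nlPts d k L M₀ Ω)).toHom).length = p.length :=
    SimpleGraph.Walk.length_map _ _
  exact h.trans hlen.le

/-- **THE BOUND BEHIND (2.60) WITH THE FULL CONSTANT R·M₀** (L ≥ 1, M₀ ≥ 1, nesting (2.1), cube unions — used for
the connectedness of T only —, `L1Sep` with the integer R, every N ≤ R·M₀): for all x, x′ ∈ T,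
N·max{|zone x − zone x′| − 1, 0} ≤ d(x, x′) with zone = print's level — the siblings' `levelGap_dist_real` BY NAME on
the induced sub-graph + `nl_induce_dist_eq` (contrast `nl_levelGap_dist`: N + d·M₀ ≤ R·M₀ for the model's own levels).
[folklore] -/
theorem nl_levelGap_dist_pz (hL : 1 ≤ L) (hM₀ : 1 ≤ M₀) (hnest : Nested k Ω) (hcube : CubeUnions k L M₀ Ω) {R : ℕ}
    (hsep : L1Sep k L M₀ R Ω) {N : ℕ} (hN : N ≤ R * M₀) {x x' : Site d} (hx : x ∈ nlPts d k L M₀ Ω)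
    (hx' : x' ∈ nlPts d k L M₀ Ω) :
    (N : ℝ) * max (|(pzLevel k Ω x : ℝ) - pzLevel k Ω x'| - 1) 0 ≤ ((nlGraph d k L M₀ Ω).dist x x' : ℝ) := by
  have h := levelGap_dist_real (nl_induce_connected hL hM₀ hnest hcube hx) (nl_levelGap_pz_induce hL hnest hsep hN)
    ⟨x, hx⟩ ⟨x', hx'⟩
  rw [nl_induce_dist_eq hx hx' (nl_reachable_dist hL hM₀ hnest hcube hx hx').1] at h
  exact h

/-- **(2.60) WITH THE PRINTED CONSTANT RM, in the model, under print's level convention** (dictionary M = M₀L,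
η = 1: the printed threshold *"(L^jη)^{−1} dist(Ω_j^c, Ω_{j+1}) > RM"* of (2.2) is `L1Sep` with the integer R·L;
L ≥ 1, M₀ ≥ 1, nesting, cube unions): N·max{|zone x − zone x′| − 1, 0} ≤ d(x, x′) on T for EVERY N ≤ R·M — the
constant of the printed (2.60) *"e^{−αδ₀d(y,y′)} ≤ e^{−αδ₀RM max{|j−j′|−1,0}}, y ∈ Λ_j, y′ ∈ Λ_{j′}"* on the nose.
Which R Bałaban fixes ((2.59)) is not determined here; nothing printed asserted. [folklore] -/
theorem nl_levelGap_dist_pz_printedR (hL : 1 ≤ L) (hM₀ : 1 ≤ M₀) (hnest : Nested k Ω) (hcube : CubeUnions k L M₀ Ω)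
    {R : ℕ} (hsep : L1Sep k L M₀ (R * L) Ω) {N : ℕ} (hN : N ≤ R * (M₀ * L)) {x x' : Site d}
    (hx : x ∈ nlPts d k L M₀ Ω) (hx' : x' ∈ nlPts d k L M₀ Ω) :
    (N : ℝ) * max (|(pzLevel k Ω x : ℝ) - pzLevel k Ω x'| - 1) 0 ≤ ((nlGraph d k L M₀ Ω).dist x x' : ℝ) :=
  nl_levelGap_dist_pz hL hM₀ hnest hcube hsep (by rw [Nat.mul_assoc, Nat.mul_comm L M₀]; exact hN) hx hx'

/-- The exponential form with N = R·M itself: e^{−αδ₀·d(x,x′)} ≤ e^{−αδ₀·RM·max{|zone x − zone x′| − 1, 0}} for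
αδ₀ ≥ 0, M = M₀L, zone = print's level (hypotheses of `nl_levelGap_dist_pz_printedR`). [folklore] -/
theorem nl_exp_le_260_pz_printedR (hL : 1 ≤ L) (hM₀ : 1 ≤ M₀) (hnest : Nested k Ω) (hcube : CubeUnions k L M₀ Ω)
    {R : ℕ} (hsep : L1Sep k L M₀ (R * L) Ω) {α δ₀ : ℝ} (hαδ : 0 ≤ α * δ₀) {x x' : Site d}
    (hx : x ∈ nlPts d k L M₀ Ω) (hx' : x' ∈ nlPts d k L M₀ Ω) :
    Real.exp (-(α * δ₀ * ((nlGraph d k L M₀ Ω).dist x x' : ℝ))) ≤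
      Real.exp (-(α * δ₀ * (((R * (M₀ * L) : ℕ) : ℝ) * max (|(pzLevel k Ω x : ℝ) - pzLevel k Ω x'| - 1) 0))) := by
  have h := nl_levelGap_dist_pz_printedR hL hM₀ hnest hcube hsep (N := R * (M₀ * L)) le_rfl hx hx'
  exact Real.exp_le_exp.2 (by nlinarith [mul_le_mul_of_nonneg_left h hαδ])

/-- **… and WITHOUT the separation clause the walk form fails under print's convention too** (L, M₀ ≥ 1, k ≥ 2,
N ≥ 1): over the tower of equal half-spaces the origin has print's level k, −e_μ has print's level 0, and {−e_μ, 0} is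
an η-bond of `nlGraph` (cf. `hsTower_not_levelGap`, §16). [folklore] -/
theorem hsTower_not_levelGap_pz (hL : 1 ≤ L) (hM₀ : 1 ≤ M₀) (hk : 2 ≤ k) (μ : Fin d) {N : ℕ} (hN : 1 ≤ N) :
    ¬ LevelGap (nlGraph d k L M₀ (hsTower μ)) (pzLevel k (hsTower μ)) N := by
  obtain ⟨-, -, -, -, -, hdist⟩ :=
    hsTower_literal_witness (k := k) hL hM₀ μ (i := k) le_rfl (D := 1) le_rfl
  have hadj : (nlGraph d k L M₀ (hsTower μ)).Adj 0 (Pi.single μ (-((1 : ℕ) : ℤ))) :=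
    SimpleGraph.dist_eq_one_iff_adj.1 hdist
  have hlvk : pzLevel k (hsTower μ) (0 : Site d) = k :=
    le_antisymm (pzLevel_le _) (le_pzLevel le_rfl (show (0 : ℤ) ≤ (0 : Site d) μ by simp))
  have hlv0 : pzLevel k (hsTower μ) (Pi.single μ (-((1 : ℕ) : ℤ)) : Site d) = 0 := by
    by_contra hne
    have h1 : 1 ≤ pzLevel k (hsTower μ) (Pi.single μ (-((1 : ℕ) : ℤ)) : Site d) := Nat.one_le_iff_ne_zero.2 hne
    have h2 : (0 : ℤ) ≤ (Pi.single μ (-((1 : ℕ) : ℤ)) : Site d) μ :=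
      mem_of_le_pzLevel (hsTower_nested μ k) le_rfl h1
    rw [Pi.single_eq_same] at h2
    omega
  intro hgap
  have h := hgap
    (show pzLevel k (hsTower μ) (Pi.single μ (-((1 : ℕ) : ℤ)) : Site d) < 1 by rw [hlv0]; exact Nat.one_pos)
    (show 1 < pzLevel k (hsTower μ) (0 : Site d) by rw [hlvk]; exact hk)
    (SimpleGraph.Walk.cons hadj.symm SimpleGraph.Walk.nil)
  rw [SimpleGraph.Walk.length_cons, SimpleGraph.Walk.length_nil] at h
  omega

/-! ### 18. THE DICTIONARY IS EXACT (appendix to §17, v1.5): under nesting (2.1) the lineage's typed separation clause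
`L1Sep k L M₀ R Ω` (parent §8 ∕ this leaf §12, in ℓ¹ on ℤ^d) is EQUIVALENT to the siblings' lattice-point form (sep)
`ZoneSep` of (2.2)/(2.57) with threshold R·M₀ and scales L^j for print's levels `pzLevel`, and to their set-level (2.2)
`SetSep` for print's domains `pzDom` — so §17's full-constant statements are (2.2) ⇒ (2.57)/(2.60)-shape in the model with
NOTHING lost or added in translation.  Nothing printed asserted. [folklore] -/

/-- (sep) for print's levels with threshold R·M₀ implies the separation clause `L1Sep` with the integer R (nesting
(2.1)): u ∉ Ω_j ⇒ print's level of u < j (nesting), x ∈ Ω_{j+1} ⇒ print's level of x > j. [folklore] -/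
theorem nl_l1Sep_of_zoneSep_pz (hnest : Nested k Ω) {R : ℕ}
    (h : ZoneSep (pzLevel k Ω) (fun x : Site d => l1Pos x) (fun j => (L : ℝ) ^ j) ((R : ℝ) * M₀)) :
    L1Sep k L M₀ R Ω := by
  intro j hj1 hjk u x hu hx
  have hzu : pzLevel k Ω u < j := by
    by_contra hle
    exact hu (mem_of_le_pzLevel hnest hj1 (Nat.le_of_not_lt hle))
  have hzx : j < pzLevel k Ω x := Nat.lt_of_lt_of_le (Nat.lt_succ_self j) (le_pzLevel (by omega) hx)
  have h1 : (R : ℝ) * M₀ * (L : ℝ) ^ j < dist (l1Pos u) (l1Pos x) := h hzu hzx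
  rw [dist_l1Pos] at h1
  have h2 : ((R * (M₀ * L ^ j) : ℕ) : ℝ) < (latL1Dist u x : ℝ) := by push_cast; linarith
  exact_mod_cast h2

/-- **`L1Sep` ⟺ (sep)** (nesting (2.1)): the separation clause of (2.2) typed in ℓ¹ with the integer R IS the
siblings' `ZoneSep` with threshold R·M₀, scales L^j, ℓ¹ positions and print's levels. [folklore] -/
theorem nl_l1Sep_iff_zoneSep_pz (hnest : Nested k Ω) {R : ℕ} :
    L1Sep k L M₀ R Ω ↔ ZoneSep (pzLevel k Ω) (fun x : Site d => l1Pos x) (fun j => (L : ℝ) ^ j) ((R : ℝ) * M₀) :=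
  ⟨nl_zoneSep_pz hnest, nl_l1Sep_of_zoneSep_pz hnest⟩

/-- **`L1Sep` ⟺ (2.2) at set level** (nesting (2.1)): … and IS the siblings' `SetSep` for print's domains Ω′
(`pzDom`), by `setSep_iff_zoneSep` under `pz_zonesOf`. [folklore] -/
theorem nl_l1Sep_iff_setSep_pz (hnest : Nested k Ω) {R : ℕ} :
    L1Sep k L M₀ R Ω ↔ SetSep (pzDom k Ω) (fun x : Site d => l1Pos x) (fun j => (L : ℝ) ^ j) ((R : ℝ) * M₀) :=
  (nl_l1Sep_iff_zoneSep_pz hnest).trans (setSep_iff_zoneSep (pz_zonesOf hnest)).symm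

end Nested

end Literature.MathematicalPhysics.QuantumFieldTheory.Balaban1983to89.B6BoxChartsNested
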